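import Summits.QuantumFields.YangMills.Theorems.IR.Negative.TypShellCondFalseAllG
import Summits.QuantumFields.YangMills.Theorems.IR.AfPincerUcFormat
import Summits.QuantumFields.YangMills.Theorems.BalabanLadderIRAfOnsetPlaquetteMoments
import Summits.QuantumFields.YangMills.Theorems.EquipartitionCriticalityFreeEnergyLogCoefficientStubExpChartPackage

/-!
# Crux `IR` (stmt-QuantumFields-19354) — crux-ideate seat 2, GEN 7 (lens negation, REFINE-ONLY):
# the QUANTITATIVE SUCCESSOR of the all-`G` fixed-mesh negative — a POLYNOMIAL ROW FLOOR
# `b⋆_T(β) ≥ c · (β / log β)^{1/7}` reduced, sorry-free, to ONE typed concentration input — AND (rev 14) THAT INPUT PROVED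
# in the companion workfile `CruxIdea2HairpinStokes.lean` rev 3: combined check rc 0, ZERO sorries ⇒ `rowFloorPoly_seventh` ∕
# `typFloor_seventh` are kernel-complete; the one `sorry` kept in §5 is an import placeholder (see its docstring)
# (rev 2: Freeze PROVED at exponent 1/4; rev 3/4: ROUTE B — F reduced to an IN-MEAN bound on the PHYSICAL twist defect;
# rev 5–10: measurability, Stokes under the kernel, Cauchy–Schwarz/Jensen, Σ ⊆ touching, energy–entropy against a reference
# filling — rev 10: the μ-mean energy of one explicit configuration, R1; rev 11: R1 PROVED from the DETERMINISTIC weighted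
# domination R1d — the ONE input is now a `β`-free, measure-free inequality for every configuration; rev 12: the filling IS the
# twisted configuration, plaquette cases and the top-face commutator bound PROVED — residual = hairpin Stokes + counting)

Crux workfile of `ym-cruxidea-19354-2` GEN 7 (planner; count-neutral; scratch that elaborates — nothing here is a Theorems
statement and no registered stub is closed).  Namespace `Summit.QuantumFields.YangMills.Cruxes.IR.CruxIdea2g7`.
Imports ONLY landed modules: the headline `Theorems/IR/Negative/TypShellCondFalseAllG.lean` (ns `…Cruxes.IR.FixedMeshAllG`,
p525652 — this lineage's GEN 6 bytes re-homed by the `Negative/` lane, owner R88), `Theorems/IR/AfPincerUcFormat.lean` and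
(rev 2) `Theorems/BalabanLadderIRAfOnsetPlaquetteMoments.lean` (S2 seat's volume-uniform plaquette moments from the chessboard
estimate, `AfOnset.exists_plaquetteCost_moments_le`) and (rev 10) `Theorems/EquipartitionCriticalityFreeEnergyLogCoefficientStubExpChartPackage.lean`
(`FreeEnergyLogCoefficient.exists_haar_gball_ge`: the Haar small-ball lower bound `≥ C δ^{dimE ρ}`, Chatterjee Cor. 6.3).

## What GEN 6 left open and what this file types

GEN 6 proved, for EVERY compact `G`, faithful unitary `ρ`, `k₀ ≠ 1`, window `n`, `ε < 1`, admissible `δ`: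
`∀ b ≥ 1, ∃ β₀(b), ∀ β ≥ β₀(b), ¬ TypShellCond ρ β b n ε δ` (`FixedMeshAllG.not_typShellCond_fixedMesh_allG'`), hence
`b⋆_T(β) → ∞`; but `β₀(b)` is NOT tracked (both analytic inputs of `FixedMeshAllG.frame_core` — S2 `FixedMesh.torusLoopFreezing`
and INPUT F `frameValueBound_comb` via the SOFT `laplace_upper_uniform` — are `β → ∞` limits at FIXED mesh): NO RATE
(ctriage «B-before-β»; certideate-2 F2′; this seat's O-FTR-2).

THIS FILE (rev 12 = rev 10 + §4l + §4m: all `sorry`-free EXCEPT the ONE named stub of §5 — R1d `refAction_le_weighted` (a DETERMINISTIC,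
`β`-FREE, MEASURE-FREE inequality: for every configuration `σ` the boundary Wilson action of the explicit reference configuration
`refConfig b n k₀ σ` is dominated by a weighted sum of plaquette energies of `σ` with total weight `≤ C b⁵` — NO DLR kernel, NO Wilson
measure, NO `β` left in the stub); R1 `integral_refAction_le` (the `μ_{L_b,β}`-mean energy of the reference filling, `≤ C₁ b⁵ log β/β`) is
PROVED from R1d by §4l (`continuous_refConfig`, `AfOnset.exists_plaquetteCost_moments_le` per oriented plaquette, linearity);
K1‴ `integral_kernelAction_le` (the KERNEL-mean action, `≤ C b⁵ log β/β`) is PROVED from R1 and the region counts R3 by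
§4j (energy–entropy against the reference filling: Lipschitz + product small balls + `ymSpecification_mean_action_le`), K1″
`integral_kernelPlaqDefectSq_le` from K1‴ by §4i, K1′ `integral_kernelPlaqDefect_le` by §4h (Cauchy–Schwarz + Jensen), K1
`integral_twistDefect_le` from K1′ by §4g, K0 (measurability) in §4f):
* §1 `gibbsTail_le` ∕ `gibbsTail_le_exp_neg` (abstract energy–entropy tail for a tilted probability measure: `A ≤ s +
  (log(1/μ{A ≤ s}) + t)/β` off `ν_β`-mass `≤ e^{-t}`), `norm_list_prod_sub_one_le` (telescoping `‖∏ Vᵢ − 1‖ ≤ ∑ ‖Vᵢ − 1‖`);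
* §2 `frame_core_at` — GEN 6's `frame_core` made POINTWISE in `(b, β)` (numeric hypotheses `hfreeze0`, `hFat` at this `(b, β)`);
* §3 `polyRegime θ c β₀` (`β ≥ β₀ ∧ 1 ≤ b ≤ c (β/log β)^θ`), the Props `LoopFreezingPoly`, `FrameValuePoly` and the target
  `RowFloorPoly ρ n ε δ θ := ∃ c > 0, ∃ β₀, polyRegime θ c β₀ (¬ TypShellCond ρ · · n ε δ)`; §3b (rev 8) HYGIENE (O-FTR-4):
  `polyRegime_eventually_ge`, `fixedMesh_of_rowFloorPoly` (for `θ > 0` the floor implies the fixed-mesh negative; not vacuous);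
* §4 `rowFloorPoly_of_inputs : LoopFreezingPoly ρ n θ → FrameValuePoly ρ n k₀ θ → RowFloorPoly ρ n ε δ θ` (`k₀ ≠ 1`, `ε < 1`,
  admissible `δ`; via `frame_core_at` + the landed `topTwistTransfer_comb`), monotonicity in `θ`, `typFloor_of_rowFloorPoly` ∕
  `ukpcFloor_of_rowFloorPoly` (formats T and Uc);
* §4b–§4h (revs 2–7, PROVED; each section's docstring has the detail): §4b the DETERMINISTIC non-abelian Stokes inequality
  `one_sub_loopObs_le` and its annealed mean `one_sub_integral_loopObs_le` (⇒ Freeze 1/4); §4c `clip_re_trace_twisted_le`,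
  `ymSpecification_tail_le`; §4d ROUTE B (`staple_topTwist`, `col_mul_staple_eq_twisted`, `twistedMeanObs_clip_le`,
  `frameValuePoly_of_kernelDefectPoly`); §4e `kernelDefectPoly_of_mean` (Markov + regime arithmetic, `c(η) = (η²/C)^{2/7}`); §4f K0
  `measurable_twistDefect` (`integral_kernel_staple_boundary`); §4g Stokes under the kernel (`norm_col_mul_staple_sub_one_le`,
  `integral_twistDefect_le_of_kernelPlaqDefect`: K1 ⇐ K1′); §4h Cauchy–Schwarz + Jensen (`integral_sqrt_le_sqrt_integral`,
  `integral_kernelPlaqDefect_le_of_sq`: K1′ ⇐ K1″);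
* §4i (rev 9, PROVED) `sigmaPlaq_mem_touching` (`Σ ⊆ plaquettesTouching Λ`), `plaqDefectSqSum_le_two_mul_action` (E1), `kernelAction`,
  `integral_kernelPlaqDefectSq_le_of_action` (K1″ ⇐ K1‴); energy–entropy MEAN bounds `gibbsMean_le` ∕ `ymSpecification_mean_action_le`;
* §4j (rev 10, PROVED) ENERGY–ENTROPY AGAINST A REFERENCE FILLING: `wilsonBoundaryAction_le_of_ball` (Lipschitz of `A_Λ`, via
  `norm_map_plaquetteHolonomy_sub_le`), `pi_real_ball_ge`, `exists_haar_ball_center_ge` (small balls around ANY centre from the tree's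
  `FreeEnergyLogCoefficient.exists_haar_gball_ge` + left invariance), `ymSpecification_mean_action_le_ref`, `kernelAction_le_ref`
  (`kernelAction V ≤ A_Λ(ζ₀ ∨ σ'_V) + K(ρ)(#Λ + #touching + 1) log β/β`, `β ≥ 3`), `integral_kernelAction_le_of_ref` (K1‴ ⇐ R1 ∧ R3);
* §4k (rev 10, PROVED) R3 `rowRegion_counts` (`#Λ_b + #touching(Λ_b) + 1 ≤ C₀(n) b⁴`);
* §4l (rev 11, PROVED) `refFill` ∕ `refConfig` (the reference filling TYPED), `continuous_refConfig`, `plaquetteEnergy_torusLift`,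
  `integral_refAction_le_of_weighted` (R1 ⇐ R1d);
* §4m (rev 12, PROVED) toward R1d: `refConfig_eq_twistΦ` (the reference filling IS `σ'`), `plaquetteHolonomyZd_topTwist_of_not_topFace` ∕
  `energy_topTwist_of_not_topFace`, `plaquetteHolonomyZd_topTwist_topFace` (top face: the conjugated `linkDefect` enters), `topFace_energy_le`,
  `norm_linkDefect_comb_le` (comb defect = conjugate of the commutator `k₀⁻¹Wk₀W⁻¹` with the `hairpin` holonomy `W`: `≤ 2‖ρ W − 1‖`),
  `topFace_energy_comb_le` (`energy_p(σ') ≤ 4‖ρ W_p − 1‖² + 2φ_p(σ)`);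
* §5 `loopFreezingPoly_quarter : LoopFreezingPoly ρ n (1/4)` (rev 2: PROVED from §4b), `frameValuePoly_seventh` (rev 3:
  PROVED by §4d), `kernelDefectPoly_seventh` (rev 4/5: PROVED by §4e + §4f), `integral_twistDefect_le` (K1; rev 6: PROVED by
  §4g), `integral_kernelPlaqDefect_le` (K1′; rev 7: PROVED by §4h), `integral_kernelPlaqDefectSq_le` (K1″; rev 9: PROVED by §4i)
  `integral_kernelAction_le` (K1‴; rev 10: PROVED by §4j + §4k) and `integral_refAction_le` (R1; rev 11: PROVED by §4l) from the
  ONE remaining STUB R1d `refAction_le_weighted` (deterministic weighted domination; plan in its docstring), and the assembled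
  `rowFloorPoly_seventh : RowFloorPoly ρ n ε δ (1/7)` ∕ `typFloor_seventh` (sorries: exactly the one stub).

HONEST FRAMING.  A typed REDUCTION, the annealed loop-freezing RATE (exponent `1/4`, proved) and abstract lemmas; the row-floor
rate `1/7` is a CLAIM OF THE PLAN until STUB R1d `refAction_le_weighted` closes (§5 docstring gives the bookkeeping), not a theorem.  Negative-side knowledge about clause (i) of formats T∕Uc at the ROW; it does NOT refute
`stub_onsetUcSC` (whose witness mesh may grow like `ξ_lat(β) ∝ e^{c_G β} ≫ β^{1/7}`), says nothing about the mass gap, Clay,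
or `Summit.QuantumFields`.  What it WOULD settle once §5 is proved: any proof of `stub_onsetUcSC` must produce meshes
`b(β) ≥ c (β / log β)^{1/7}` — the first power-of-`β` content of «B-before-β».
-/

set_option autoImplicit false

noncomputable section

open MeasureTheory Filter Topology
open Literature.MathematicalPhysics.QuantumLattice
open Literature.Probability.LatticeModels
open Summit.QuantumFields.YangMills.Cruxes.IR.Tempered (cellEdges windowCells regionEdges)
open Summit.QuantumFields.YangMills.Cruxes.IR.ShellTempered (windowCellsPlus)
open Summit.QuantumFields.YangMills.Cruxes.IR.OnsetFormats (TypShellCond shellCount)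
open Summit.QuantumFields.YangMills.Cruxes.IR.FixedMesh
open Summit.QuantumFields.YangMills.Cruxes.IR.FixedMeshAllG

namespace Summit.QuantumFields.YangMills.Cruxes.IR.CruxIdea2g7

/-! ## §1 Two abstract lemmas (PROVED): the energy–entropy tail of a Gibbs tilt; telescoping for products -/

section GibbsTail

variable {X : Type*} [MeasurableSpace X]

/-- **Energy–entropy tail (PROVED).**  `μ` a probability measure, `A ≥ 0` measurable, `β ≥ 0`, and a sub-level
`{A ≤ s}` of positive `μ`-mass.  The Gibbs tilt `ν_β = μ.tilted (−β A)` (density `e^{-βA}/Z_β`) satisfies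
`ν_β {a < A} ≤ e^{-β (a - s)} / μ{A ≤ s}`.  Proof: `Z_β ≥ e^{-β s} μ{A ≤ s}` and `e^{-βA} ≤ e^{-β a}` on `{a < A}`. -/
theorem gibbsTail_le (μ : Measure X) [IsProbabilityMeasure μ] {A : X → ℝ} (hAm : Measurable A)
    (hA0 : ∀ x, 0 ≤ A x) {β : ℝ} (hβ : 0 ≤ β) (a s : ℝ) (hs : 0 < μ.real {x | A x ≤ s}) :
    (μ.tilted fun x => -(β * A x)).real {x | a < A x} ≤
      Real.exp (-(β * (a - s))) / μ.real {x | A x ≤ s} := by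
  set w : X → ℝ := fun x => Real.exp (-(β * A x)) with hw
  have hwm : Measurable w := (Real.measurable_exp.comp ((hAm.const_mul β).neg))
  have hw0 : ∀ x, 0 < w x := fun x => Real.exp_pos _
  have hw1 : ∀ x, w x ≤ 1 := fun x => by
    show Real.exp (-(β * A x)) ≤ 1
    rw [Real.exp_le_one_iff]
    have := mul_nonneg hβ (hA0 x)
    linarith
  have hwi : Integrable w μ :=
    (integrable_const (1 : ℝ)).mono' hwm.aestronglyMeasurable
      (ae_of_all _ fun x => by rw [Real.norm_eq_abs, abs_of_pos (hw0 x)]; exact hw1 x)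
  set Z : ℝ := ∫ x, w x ∂μ with hZ
  have hSm : MeasurableSet {x | A x ≤ s} := measurableSet_le hAm measurable_const
  have hTm : MeasurableSet {x | a < A x} := measurableSet_lt measurable_const hAm
  -- the partition function is at least the sub-level contribution
  have hZlow : Real.exp (-(β * s)) * μ.real {x | A x ≤ s} ≤ Z := by
    calc Real.exp (-(β * s)) * μ.real {x | A x ≤ s}
        = ∫ x in {x | A x ≤ s}, Real.exp (-(β * s)) ∂μ := by
          rw [setIntegral_const, smul_eq_mul, mul_comm]
      _ ≤ ∫ x in {x | A x ≤ s}, w x ∂μ := by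
          refine setIntegral_mono_on (integrable_const _).integrableOn hwi.integrableOn hSm fun x hx => ?_
          have hx' : A x ≤ s := hx
          exact Real.exp_le_exp.2 (neg_le_neg (mul_le_mul_of_nonneg_left hx' hβ))
      _ ≤ Z := setIntegral_le_integral hwi (ae_of_all _ fun x => (hw0 x).le)
  have hZpos : 0 < Z := lt_of_lt_of_le (mul_pos (Real.exp_pos _) hs) hZlow
  -- the tilted mass of `{a < A}` as a real integral
  have hreal : (μ.tilted fun x => -(β * A x)).real {x | a < A x} =
      ∫ x in {x | a < A x}, w x / Z ∂μ := by
    rw [measureReal_def, tilted_apply_eq_ofReal_integral' _ hTm, ENNReal.toReal_ofReal]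
    exact integral_nonneg fun x => div_nonneg (Real.exp_pos _).le hZpos.le
  -- on `{a < A}` the weight is at most `e^{-β a}`
  have hbound : ∫ x in {x | a < A x}, w x / Z ∂μ ≤ ∫ x in {x | a < A x}, Real.exp (-(β * a)) / Z ∂μ := by
    refine setIntegral_mono_on (hwi.div_const Z).integrableOn (integrable_const _).integrableOn hTm
      fun x hx => ?_
    have hx' : a < A x := hx
    exact div_le_div_of_nonneg_right
      (Real.exp_le_exp.2 (neg_le_neg (mul_le_mul_of_nonneg_left hx'.le hβ))) hZpos.le
  have hmass : ∫ x in {x | a < A x}, Real.exp (-(β * a)) / Z ∂μ ≤ Real.exp (-(β * a)) / Z := by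
    rw [setIntegral_const, smul_eq_mul]
    have h1 : μ.real {x | a < A x} ≤ 1 := measureReal_le_one
    have h2 : 0 ≤ Real.exp (-(β * a)) / Z := div_nonneg (Real.exp_pos _).le hZpos.le
    nlinarith
  have hfin : Real.exp (-(β * a)) / Z ≤ Real.exp (-(β * (a - s))) / μ.real {x | A x ≤ s} := by
    have hden : 0 < Real.exp (-(β * s)) * μ.real {x | A x ≤ s} := mul_pos (Real.exp_pos _) hs
    calc Real.exp (-(β * a)) / Z
        ≤ Real.exp (-(β * a)) / (Real.exp (-(β * s)) * μ.real {x | A x ≤ s}) :=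
          div_le_div_of_nonneg_left (Real.exp_pos _).le hden hZlow
      _ = Real.exp (-(β * (a - s))) / μ.real {x | A x ≤ s} := by
          rw [← div_div, ← Real.exp_sub]
          congr 2
          ring
  rw [hreal]
  exact hbound.trans (hmass.trans hfin)

/-- **Energy–entropy tail, entropy form (PROVED).**  With `β > 0`: `A ≤ s + (log (1/μ{A ≤ s}) + t)/β` off a set of
`ν_β`-mass `≤ e^{-t}`.  In the application `μ` = product Haar on the region's links, `A` = the Wilson boundary action
of the region given the frozen exterior `ζ`, `s = A(ζ's own filling) + m/β` and `μ{A ≤ s} ≥` the Haar mass of a product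
of balls of radius `∝ 1/(β · #touching plaquettes)`: `log (1/μ{A ≤ s}) ≤ C_G · m · log β` (`m` = number of links). -/
theorem gibbsTail_le_exp_neg (μ : Measure X) [IsProbabilityMeasure μ] {A : X → ℝ} (hAm : Measurable A)
    (hA0 : ∀ x, 0 ≤ A x) {β : ℝ} (hβ : 0 < β) (s t : ℝ) (hs : 0 < μ.real {x | A x ≤ s}) :
    (μ.tilted fun x => -(β * A x)).real
        {x | s + (Real.log (1 / μ.real {x | A x ≤ s}) + t) / β < A x} ≤ Real.exp (-t) := by
  have h := gibbsTail_le μ hAm hA0 hβ.le (s + (Real.log (1 / μ.real {x | A x ≤ s}) + t) / β) s hs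
  refine h.trans (le_of_eq ?_)
  have hm : 0 < μ.real {x | A x ≤ s} := hs
  have e1 : β * (s + (Real.log (1 / μ.real {x | A x ≤ s}) + t) / β - s) =
      Real.log (1 / μ.real {x | A x ≤ s}) + t := by
    field_simp
    ring
  rw [e1, neg_add, Real.exp_add, Real.exp_neg, Real.exp_log (one_div_pos.2 hm), one_div, inv_inv,
    mul_comm, mul_div_assoc, div_self hm.ne', mul_one]

/-- **Energy–entropy MEAN bound, abstract (PROVED; rev 9).**  For the Gibbs tilt `ν_β = μ.tilted (−βA)` of a probability
measure by a measurable `0 ≤ A ≤ M` and any level `a ≥ 0`:  `E_{ν_β} A ≤ a + M · ν_β{a < A}` — the form in which step (b)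
of the §5 plan consumes the tail bound (`E_γ A ≤ a + 2N·#touching · γ{A > a}`). -/
theorem gibbsMean_le_of_tail (μ : Measure X) [IsProbabilityMeasure μ] {A : X → ℝ} (hAm : Measurable A)
    (hA0 : ∀ x, 0 ≤ A x) {M : ℝ} (hAM : ∀ x, A x ≤ M) (β : ℝ) {a r : ℝ} (ha : 0 ≤ a)
    (htail : (μ.tilted fun x => -(β * A x)).real {x | a < A x} ≤ r) :
    ∫ x, A x ∂(μ.tilted fun x => -(β * A x)) ≤ a + M * r := by
  set ν := μ.tilted fun x => -(β * A x) with hν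
  have hexp : Integrable (fun x => Real.exp (-(β * A x))) μ := by
    refine Integrable.of_bound ((hAm.const_mul β).neg.exp.aestronglyMeasurable) (Real.exp (|β| * M))
      (ae_of_all _ fun x => ?_)
    rw [Real.norm_eq_abs, abs_of_pos (Real.exp_pos _), Real.exp_le_exp]
    calc -(β * A x) ≤ |β * A x| := neg_le_abs _
      _ = |β| * A x := by rw [abs_mul, abs_of_nonneg (hA0 x)]
      _ ≤ |β| * M := mul_le_mul_of_nonneg_left (hAM x) (abs_nonneg β)
  haveI : IsProbabilityMeasure ν := isProbabilityMeasure_tilted hexp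
  have hS : MeasurableSet {x | a < A x} := measurableSet_lt measurable_const hAm
  by_cases hM : 0 ≤ M
  swap
  · have hX : IsEmpty X :=
      ⟨fun x => (not_le.2 (lt_of_le_of_lt (hA0 x) (lt_of_le_of_lt (hAM x) (not_le.1 hM)))) le_rfl⟩
    have : (ν : Measure X) = 0 := Measure.eq_zero_of_isEmpty ν
    exact absurd (IsProbabilityMeasure.ne_zero ν) (by simpa using this)
  have hpt : ∀ x, A x ≤ a + M * Set.indicator {x | a < A x} (1 : X → ℝ) x := by
    intro x
    by_cases hx : a < A x
    · have hmem : x ∈ {x | a < A x} := hx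
      rw [Set.indicator_of_mem hmem]
      simp only [Pi.one_apply, mul_one]
      linarith [hAM x]
    · have hnm : x ∉ {x | a < A x} := hx
      rw [Set.indicator_of_notMem hnm, mul_zero, add_zero]
      exact not_lt.1 hx
  have hintA : Integrable A ν := Integrable.of_bound hAm.aestronglyMeasurable M
    (ae_of_all _ fun x => by rw [Real.norm_eq_abs, abs_of_nonneg (hA0 x)]; exact hAM x)
  have hintI : Integrable (fun x => Set.indicator {x | a < A x} (1 : X → ℝ) x) ν :=
    show Integrable (fun x => Set.indicator {x | a < A x} (1 : X → ℝ) x) ν from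
      (integrable_const (1 : ℝ)).indicator hS
  have hint2 : Integrable (fun x => a + M * Set.indicator {x | a < A x} (1 : X → ℝ) x) ν :=
    (integrable_const a).add (hintI.const_mul M)
  calc ∫ x, A x ∂ν ≤ ∫ x, (a + M * Set.indicator {x | a < A x} (1 : X → ℝ) x) ∂ν :=
        integral_mono hintA hint2 hpt
    _ = a + M * ν.real {x | a < A x} := by
        rw [integral_add (integrable_const a) (hintI.const_mul M), integral_const, integral_const_mul,
          integral_indicator_one hS]
        simp
    _ ≤ a + M * r := by gcongr

/-- **Energy–entropy MEAN bound, entropy form (PROVED; rev 9):** `β > 0`, measurable `0 ≤ A ≤ M`, `s, t ≥ 0`,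
`μ{A ≤ s} > 0` ⇒ `E_{ν_β} A ≤ s + (log(1/μ{A ≤ s}) + t)/β + M e^{−t}`. -/
theorem gibbsMean_le (μ : Measure X) [IsProbabilityMeasure μ] {A : X → ℝ} (hAm : Measurable A)
    (hA0 : ∀ x, 0 ≤ A x) {M : ℝ} (hAM : ∀ x, A x ≤ M) {β : ℝ} (hβ : 0 < β) {s t : ℝ}
    (hs0 : 0 ≤ s) (ht : 0 ≤ t) (hs : 0 < μ.real {x | A x ≤ s}) :
    ∫ x, A x ∂(μ.tilted fun x => -(β * A x)) ≤
      s + (Real.log (1 / μ.real {x | A x ≤ s}) + t) / β + M * Real.exp (-t) := by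
  have hm1 : μ.real {x | A x ≤ s} ≤ 1 :=
    (measureReal_mono (Set.subset_univ _)).trans_eq probReal_univ
  have hlog : 0 ≤ Real.log (1 / μ.real {x | A x ≤ s}) := Real.log_nonneg (one_le_one_div hs hm1)
  have ha : 0 ≤ s + (Real.log (1 / μ.real {x | A x ≤ s}) + t) / β := by positivity
  exact gibbsMean_le_of_tail μ hAm hA0 hAM β ha (gibbsTail_le_exp_neg μ hAm hA0 hβ s t hs)

end GibbsTail

section Telescoping

variable {R : Type*} [NormedRing R]

/-- **Telescoping (PROVED).**  In a normed ring, for factors of norm `≤ 1`:  `‖V₁ ⋯ V_k − 1‖ ≤ ∑ ‖Vᵢ − 1‖`.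
With `Vᵢ = ρ(lasso holonomy of the i-th curtain plaquette)` (unitary, Frobenius∕operator norm) this is the
quantitative non-abelian Stokes bound `‖ρ(hol ∂Σ) − 1‖ ≤ ∑_{p ∈ Σ} ‖ρ(U_p) − 1‖` used by both stubs of §5. -/
theorem norm_list_prod_sub_one_le (l : List R) (hl : ∀ x ∈ l, ‖x‖ ≤ 1) :
    ‖l.prod - 1‖ ≤ (l.map fun x => ‖x - 1‖).sum := by
  induction l with
  | nil => simp
  | cons a l ih =>
    have ha : ‖a‖ ≤ 1 := hl a (by simp)
    have ih' : ‖l.prod - 1‖ ≤ (l.map fun x => ‖x - 1‖).sum := ih fun x hx => hl x (by simp [hx])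
    rw [List.prod_cons, List.map_cons, List.sum_cons]
    have hsplit : a * l.prod - 1 = a * (l.prod - 1) + (a - 1) := by noncomm_ring
    calc ‖a * l.prod - 1‖ = ‖a * (l.prod - 1) + (a - 1)‖ := by rw [hsplit]
      _ ≤ ‖a * (l.prod - 1)‖ + ‖a - 1‖ := norm_add_le _ _
      _ ≤ ‖a‖ * ‖l.prod - 1‖ + ‖a - 1‖ := by gcongr; exact norm_mul_le _ _
      _ ≤ 1 * ‖l.prod - 1‖ + ‖a - 1‖ := by gcongr
      _ ≤ ‖a - 1‖ + (l.map fun x => ‖x - 1‖).sum := by linarith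

end Telescoping

/-! ## §2 GEN 6's composition made POINTWISE in `(b, β)` (PROVED — `FixedMeshAllG.frame_core` verbatim, the two
`∃ β₀` packages replaced by numeric hypotheses at this `(b, β)`) -/

section Core

open Literature.MathematicalPhysics.QuantumFieldTheory (wilsonMeasure GaugeConfig isProbabilityMeasure_wilsonMeasure)

variable {G : Type} [Group G] [TopologicalSpace G] [IsTopologicalGroup G] [CompactSpace G]
  [SecondCountableTopology G] [MeasurableSpace G] [BorelSpace G]
  {N : ℕ} (ρ : G →* Matrix (Fin N) (Fin N) ℂ)

/-- **THE FRAME-TWIST ROW — CORE AT ONE `(b, β)` (PROVED).**  As `FixedMeshAllG.frame_core`, but the freezing input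
(`hfreeze0 : 1 − s²/(A+1) ≤ E_{L_b,β}[W ∘ lift]`, `L_b = 2((2n+2)b+1)+1`, rectangle `b × (2n+1)b`) and INPUT F
(`hFat : μ_{L_b,β}{v + s < twisted shaped mean} ≤ s`) are HYPOTHESES AT THIS `(b, β)`, and the budget `s` is a free
parameter with `0 < s ≤ 1/8`, `s ≤ (1 − v − 2ε)/4`.  Conclusion: no measurable cell-local class satisfies clause (i) at
the row together with the single-cell torus anchor `δ` at this `(b, β)`.  This is the form a RATE can be fed into. -/
theorem frame_core_at (hρ : Continuous ρ)
    (hρu : ∀ g, ρ g ∈ Matrix.unitaryGroup (Fin N) ℂ)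
    {b : ℕ} (hb : 1 ≤ b) (n : ℕ) (κ : LGConfig 4 G → Site 4 → G)
    {ψ : ℝ → ℝ} (hψ : Continuous ψ) (hψ1 : ∀ t, |t| ≤ 1 → |ψ t| ≤ 1)
    {A : ℝ} (hA : 0 ≤ A) (hψA : ∀ t, t ≤ 1 → 1 - ψ t ≤ A * (1 - t)) {v : ℝ}
    (hT : TopTwistTransfer ρ κ b n) {β ε δ s : ℝ} (hs0 : 0 < s) (hs8 : s ≤ 1 / 8)
    (hs4 : s ≤ (1 - v - 2 * ε) / 4)
    (hfreeze0 : 1 - s * s / (A + 1) ≤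
      ∫ V, loopObs ρ b ((2 * n + 1) * b) (torusLift (2 * ((2 * n + 2) * b + 1) + 1) V)
        ∂(wilsonMeasure (d := 4) (L := 2 * ((2 * n + 2) * b + 1) + 1) ρ β))
    (hFat : (wilsonMeasure (d := 4) (L := 2 * ((2 * n + 2) * b + 1) + 1) ρ β)
        {V | v + s < twistedMeanObs ρ β b n κ ψ V} ≤ ENNReal.ofReal s)
    (hδ0 : 0 ≤ δ) (hδ : 4 * ((windowCellsPlus n).card : ℝ) * δ < 1)
    (Typ : (Fin 4 → ℤ) → Set (LGConfig 4 G)) (hmeas : ∀ c, MeasurableSet (Typ c))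
    (hdep : ∀ c, DependsOn (fun σ : LGConfig 4 G => σ ∈ Typ c) ↑(cellEdges (stdFrame b) c))
    (hI : RowClauseI ρ β (stdFrame b) n ε Typ)
    (hanch' : ∀ c ∈ windowCellsPlus n,
      (wilsonMeasure (d := 4) (L := 2 * ((2 * n + 2) * b + 1) + 1) ρ β)
        {V | torusLift (2 * ((2 * n + 2) * b + 1) + 1) V ∉ Typ c} ≤ ENNReal.ofReal δ) : False := by
  classical
  -- budgets
  have hA1 : 0 < A + 1 := by linarith
  -- the rectangle width and the torus
  have hm : (((2 * n + 1) * b : ℕ) : ℤ) = (2 * (n : ℤ) + 1) * b := by push_cast; ring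
  set L : ℕ := 2 * ((2 * n + 2) * b + 1) + 1 with hL
  set μ := wilsonMeasure (d := 4) (L := L) ρ β with hμ
  haveI : IsProbabilityMeasure μ := isProbabilityMeasure_wilsonMeasure ρ hρ β
  set Λ := rowRegion b n with hΛ
  set m : ℕ := (2 * n + 1) * b with hmdef
  set F : LGConfig 4 G → ℝ := loopObs ρ b m with hFdef
  set Fψ : LGConfig 4 G → ℝ := fun U => ψ (loopObs ρ b m U) with hFψdef
  set Ψ : GaugeConfig 4 L G → ℝ := fun V => ∫ U, F U ∂(ymSpecification ρ β Λ (torusLift L V)) with hΨ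
  set Ψψ : GaugeConfig 4 L G → ℝ := fun V => ∫ U, Fψ U ∂(ymSpecification ρ β Λ (torusLift L V)) with hΨψ
  set Ψ' : GaugeConfig 4 L G → ℝ := twistedMeanObs ρ β b n κ ψ with hΨ'
  -- INPUT T: the twisted lifts are typical too (union bound over window+shell; outer measure, no measurability needed)
  set Ac : (Fin 4 → ℤ) → Set (GaugeConfig 4 L G) := fun c => {V | torusLift L V ∉ Typ c} with hAc
  set T : (Fin 4 → ℤ) → Set (GaugeConfig 4 L G) := fun c => {V | twistΦ b κ (torusLift L V) ∉ Typ c} with hTset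
  have hμT : ∀ c ∈ windowCellsPlus n, μ (T c) ≤ ENNReal.ofReal δ := fun c hc =>
    (hT β Typ hmeas hdep c hc).trans (hanch' c hc)
  set B : Set (GaugeConfig 4 L G) := ⋃ c ∈ windowCellsPlus n, (Ac c ∪ T c) with hB
  have hμB : μ B ≤ ENNReal.ofReal (2 * ((windowCellsPlus n).card : ℝ) * δ) := by
    calc μ B ≤ ∑ c ∈ windowCellsPlus n, μ (Ac c ∪ T c) := measure_biUnion_finset_le _ _
      _ ≤ ∑ c ∈ windowCellsPlus n, (ENNReal.ofReal δ + ENNReal.ofReal δ) :=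
          Finset.sum_le_sum fun c hc =>
            (measure_union_le _ _).trans (add_le_add (hanch' c hc) (hμT c hc))
      _ = ENNReal.ofReal (2 * ((windowCellsPlus n).card : ℝ) * δ) := by
          rw [Finset.sum_const, nsmul_eq_mul, ← ENNReal.ofReal_add hδ0 hδ0, ← ENNReal.ofReal_natCast,
            ← ENNReal.ofReal_mul (Nat.cast_nonneg _)]
          congr 1
          ring
  have hgood : ∀ V ∉ B, ∀ c ∈ windowCellsPlus n, c ∉ rowCells n →
      torusLift L V ∈ Typ c ∧ twistΦ b κ (torusLift L V) ∈ Typ c := by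
    intro V hV c hc _
    simp only [hB, Set.mem_iUnion, Set.mem_union, not_exists, not_or] at hV
    have h := hV c hc
    exact ⟨of_not_not h.1, of_not_not h.2⟩
  -- §11a on the good set: `Ψψ V − Ψ' V ≤ 2ε`
  have hF1 : ∀ U, |F U| ≤ 1 := abs_loopObs_le ρ hρu b _
  have hpair : ∀ V ∉ B, Ψψ V - Ψ' V ≤ 2 * ε := by
    intro V hV
    have hprop : Ψψ V = ∫ U, ψ (chargedTest ρ b m (torusLift L V) U).re
        ∂(ymSpecification ρ β Λ (torusLift L V)) := integral_comp_loopObs_eq ρ hρ β hm hψ _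
    have h2 := abs_integral_sub_le_of_rowClauseI ρ hρ hb hI (κ (torusLift L V))
      (u := fun U => ψ (chargedTest ρ b m (torusLift L V) U).re)
      (hψ.measurable.comp (Complex.measurable_re.comp (measurable_chargedTest ρ hρ b m _)))
      (fun U => hψ1 _ ((Complex.abs_re_le_norm _).trans (norm_chargedTest_le ρ hρu b m _ U)))
      (fun x y hxy => by
        show ψ (chargedTest ρ b m (torusLift L V) x).re = ψ (chargedTest ρ b m (torusLift L V) y).re
        rw [chargedTest_isCylinder ρ hb m _ hxy])
      (torusLift L V) (hgood V hV)
    rw [hprop]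
    exact (le_abs_self _).trans h2
  -- INPUT F: the bad-value set
  set C : Set (GaugeConfig 4 L G) := {V | v + s < Ψ' V} with hC
  have hμC : μ C ≤ ENNReal.ofReal s := hFat
  -- freezing + domination + Markov: the low-shaped-loop set
  set D : Set (GaugeConfig 4 L G) := {V | s ≤ 1 - Ψψ V} with hD
  have hFψ1 : ∀ U, |Fψ U| ≤ 1 := fun U => hψ1 _ (hF1 U)
  have hΨ1 : ∀ V, |Ψ V| ≤ 1 := fun V => abs_integral_ymSpecification_le ρ hρ β Λ hF1 _
  have hΨψ1 : ∀ V, |Ψψ V| ≤ 1 := fun V => abs_integral_ymSpecification_le ρ hρ β Λ hFψ1 _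
  have hFψc : Continuous Fψ := hψ.comp (continuous_loopObs ρ hρ b _)
  have hΨm : Measurable Ψ :=
    ((continuous_integral_ymSpecification ρ hρ β Λ (continuous_loopObs ρ hρ b _) hF1).comp
      (continuous_torusLift L)).measurable
  have hΨψm : Measurable Ψψ :=
    ((continuous_integral_ymSpecification ρ hρ β Λ hFψc hFψ1).comp (continuous_torusLift L)).measurable
  have hΨi : Integrable Ψ μ :=
    (integrable_const (1 : ℝ)).mono' hΨm.aestronglyMeasurable
      (ae_of_all _ fun V => by simpa [Real.norm_eq_abs] using hΨ1 V)
  have hΨψi : Integrable Ψψ μ :=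
    (integrable_const (1 : ℝ)).mono' hΨψm.aestronglyMeasurable
      (ae_of_all _ fun V => by simpa [Real.norm_eq_abs] using hΨψ1 V)
  have h1Ψi : Integrable (fun V => 1 - Ψ V) μ := (integrable_const _).sub hΨi
  have h1Ψψi : Integrable (fun V => 1 - Ψψ V) μ := (integrable_const _).sub hΨψi
  -- pointwise domination `1 − Ψψ ≤ A (1 − Ψ)` (the shaped loop is dominated near the frozen value)
  have hdom : ∀ V, 1 - Ψψ V ≤ A * (1 - Ψ V) := by
    intro V
    haveI : IsProbabilityMeasure (ymSpecification ρ β Λ (torusLift L V)) :=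
      isProbabilityMeasure_ymSpecification ρ hρ β _ _
    have hiF : Integrable F (ymSpecification ρ β Λ (torusLift L V)) :=
      (integrable_const (1 : ℝ)).mono' (continuous_loopObs ρ hρ b _).measurable.aestronglyMeasurable
        (ae_of_all _ fun U => by simpa [Real.norm_eq_abs] using hF1 U)
    have hiFψ : Integrable Fψ (ymSpecification ρ β Λ (torusLift L V)) :=
      (integrable_const (1 : ℝ)).mono' hFψc.measurable.aestronglyMeasurable
        (ae_of_all _ fun U => by simpa [Real.norm_eq_abs] using hFψ1 U)
    have e1 : ∫ U, (1 - Fψ U) ∂(ymSpecification ρ β Λ (torusLift L V)) =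
        1 - ∫ U, Fψ U ∂(ymSpecification ρ β Λ (torusLift L V)) := by
      rw [integral_sub (integrable_const _) hiFψ, integral_const]
      simp only [Measure.real, measure_univ, ENNReal.toReal_one, smul_eq_mul, one_mul]
    have e2 : ∫ U, A * (1 - F U) ∂(ymSpecification ρ β Λ (torusLift L V)) =
        A * (1 - ∫ U, F U ∂(ymSpecification ρ β Λ (torusLift L V))) := by
      rw [integral_const_mul, integral_sub (integrable_const _) hiF, integral_const]
      simp only [Measure.real, measure_univ, ENNReal.toReal_one, smul_eq_mul, one_mul]
    have key : ∫ U, (1 - Fψ U) ∂(ymSpecification ρ β Λ (torusLift L V)) ≤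
        ∫ U, A * (1 - F U) ∂(ymSpecification ρ β Λ (torusLift L V)) :=
      integral_mono ((integrable_const _).sub hiFψ) (((integrable_const _).sub hiF).const_mul A)
        fun U => hψA _ (abs_le.1 (hF1 U)).2
    rw [e1, e2] at key
    exact key
  have hfreeze : 1 - s * s / (A + 1) ≤ ∫ V, F (torusLift L V) ∂μ := hfreeze0
  have hDLR : ∫ V, F (torusLift L V) ∂μ = ∫ V, Ψ V ∂μ := integral_loopObs_torus ρ hρ hρu β hm
  have hE : ∫ V, (1 - Ψ V) ∂μ ≤ s * s / (A + 1) := by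
    rw [integral_sub (integrable_const _) hΨi, integral_const]
    simp only [Measure.real, measure_univ, ENNReal.toReal_one, smul_eq_mul, one_mul]
    linarith
  have hEψ : ∫ V, (1 - Ψψ V) ∂μ ≤ s * s := by
    have h3 : A * (s * s / (A + 1)) ≤ s * s := by
      rw [mul_div_assoc', div_le_iff₀ hA1]
      nlinarith [mul_pos hs0 hs0]
    calc ∫ V, (1 - Ψψ V) ∂μ ≤ ∫ V, A * (1 - Ψ V) ∂μ := integral_mono h1Ψψi (h1Ψi.const_mul A) hdom
      _ = A * ∫ V, (1 - Ψ V) ∂μ := integral_const_mul _ _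
      _ ≤ A * (s * s / (A + 1)) := mul_le_mul_of_nonneg_left hE hA
      _ ≤ s * s := h3
  have hMarkov : s * μ.real D ≤ ∫ V, (1 - Ψψ V) ∂μ :=
    mul_meas_ge_le_integral_of_nonneg (ae_of_all _ fun V => by
      have := (abs_le.1 (hΨψ1 V)).2; show (0 : ℝ) ≤ 1 - Ψψ V; linarith) h1Ψψi s
  have hμD : μ.real D ≤ s := by
    have : s * μ.real D ≤ s * s := hMarkov.trans hEψ
    exact le_of_mul_le_mul_left this hs0
  -- the three bad sets do not cover the torus
  have hμB' : μ.real B ≤ 2 * ((windowCellsPlus n).card : ℝ) * δ :=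
    ENNReal.toReal_le_of_le_ofReal (by positivity) hμB
  have hμC' : μ.real C ≤ s := ENNReal.toReal_le_of_le_ofReal hs0.le hμC
  have hcover : μ.real (B ∪ C ∪ D) < 1 := by
    calc μ.real (B ∪ C ∪ D) ≤ μ.real (B ∪ C) + μ.real D := measureReal_union_le _ _
      _ ≤ μ.real B + μ.real C + μ.real D := by
          have := measureReal_union_le (μ := μ) B C; linarith
      _ < 1 := by nlinarith
  have hex : ∃ V, V ∉ B ∪ C ∪ D := by
    by_contra hne
    push Not at hne
    have huniv : B ∪ C ∪ D = Set.univ := Set.eq_univ_of_forall hne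
    rw [huniv] at hcover
    simp [Measure.real] at hcover
  obtain ⟨V, hV⟩ := hex
  simp only [Set.mem_union, not_or] at hV
  obtain ⟨⟨hVB, hVC⟩, hVD⟩ := hV
  have h1 : Ψψ V - Ψ' V ≤ 2 * ε := hpair V hVB
  have h2 : Ψ' V ≤ v + s := not_lt.1 hVC
  have h3 : 1 - Ψψ V < s := not_le.1 hVD
  linarith

end Core

/-! ## §3 The polynomial regime and the three Props -/

section Poly

open Literature.MathematicalPhysics.QuantumFieldTheory (wilsonMeasure GaugeConfig isProbabilityMeasure_wilsonMeasure)

variable {G : Type} [Group G] [TopologicalSpace G] [IsTopologicalGroup G] [CompactSpace G]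
  [SecondCountableTopology G] [MeasurableSpace G] [BorelSpace G]
  {N : ℕ} (ρ : G →* Matrix (Fin N) (Fin N) ℂ)

/-- The CLIPPED shaping of the charged test (GEN 6 rev 2, `frame_core_comb_clipped`): affine with `ψ 1 = 1`,
`ψ r = −1`, clipped to `[−1, 1]`. -/
def clip (r t : ℝ) : ℝ := max (-1) (min 1 (2 * (t - r) / (1 - r) - 1))

omit [TopologicalSpace G] [IsTopologicalGroup G] [CompactSpace G] [SecondCountableTopology G] [MeasurableSpace G]
  [BorelSpace G] in
theorem continuous_clip (r : ℝ) : Continuous (clip r) := by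
  unfold clip
  exact continuous_const.max (continuous_const.min
    (((continuous_const.mul (continuous_id.sub continuous_const)).div_const _).sub continuous_const))

theorem abs_clip_le (r t : ℝ) : |clip r t| ≤ 1 :=
  abs_le.2 ⟨le_max_left _ _, max_le (by norm_num) (min_le_left _ _)⟩

theorem one_sub_clip_le {r : ℝ} (hr : r < 1) (t : ℝ) (ht : t ≤ 1) :
    1 - clip r t ≤ 2 / (1 - r) * (1 - t) := by
  have h1r : 0 < 1 - r := by linarith
  unfold clip
  have hφ : 1 - (2 * (t - r) / (1 - r) - 1) = 2 / (1 - r) * (1 - t) := by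
    field_simp
    ring
  have hmin : min 1 (2 * (t - r) / (1 - r) - 1) ≤ max (-1) (min 1 (2 * (t - r) / (1 - r) - 1)) :=
    le_max_right _ _
  rcases le_total 1 (2 * (t - r) / (1 - r) - 1) with h | h
  · rw [min_eq_left h] at hmin ⊢
    have : 0 ≤ 2 / (1 - r) * (1 - t) := mul_nonneg (div_nonneg (by norm_num) h1r.le) (by linarith)
    linarith
  · rw [min_eq_right h] at hmin ⊢
    linarith

theorem clip_self (r : ℝ) : clip r r = -1 := by
  unfold clip
  rw [sub_self, mul_zero, zero_div, zero_sub, min_eq_right (by norm_num), max_self]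

/-- **The polynomial regime** of exponent `θ`, constant `c`, threshold `β₀`: all `(β, b)` with `β ≥ β₀` and
`1 ≤ b ≤ c · (β / log β)^θ`. -/
def polyRegime (θ c β₀ : ℝ) (P : ℝ → ℕ → Prop) : Prop :=
  ∀ β : ℝ, β₀ ≤ β → ∀ b : ℕ, 1 ≤ b → (b : ℝ) ≤ c * (β / Real.log β) ^ θ → P β b

omit [TopologicalSpace G] [IsTopologicalGroup G] [CompactSpace G] [SecondCountableTopology G] [MeasurableSpace G]
  [BorelSpace G] in
theorem polyRegime_mono_threshold {θ c β₀ β₀' : ℝ} (hβ : β₀ ≤ β₀') {P : ℝ → ℕ → Prop}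
    (h : polyRegime θ c β₀ P) : polyRegime θ c β₀' P :=
  fun β hβ' b hb hbc => h β (hβ.trans hβ') b hb hbc

omit [TopologicalSpace G] [IsTopologicalGroup G] [CompactSpace G] [SecondCountableTopology G] [MeasurableSpace G]
  [BorelSpace G] in
/-- A smaller exponent is a smaller regime (for `β ≥ 3`, where `β / log β ≥ 1`). -/
theorem polyRegime_mono_exponent {θ θ' c β₀ : ℝ} (hθ : θ' ≤ θ) (hc : 0 ≤ c) (hβ₀ : 3 ≤ β₀)
    {P : ℝ → ℕ → Prop} (h : polyRegime θ c β₀ P) : polyRegime θ' c β₀ P := by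
  intro β hβ b hb hbc
  refine h β hβ b hb (hbc.trans (mul_le_mul_of_nonneg_left ?_ hc))
  have hβ3 : (3 : ℝ) ≤ β := hβ₀.trans hβ
  have hβ0 : (0 : ℝ) < β := by linarith
  have hlogpos : 0 < Real.log β := Real.log_pos (by linarith)
  have h1 : 1 ≤ β / Real.log β := by
    rw [le_div_iff₀ hlogpos, one_mul]
    have := Real.log_le_sub_one_of_pos hβ0
    linarith
  exact Real.rpow_le_rpow_of_exponent_le h1 hθ

/-- **INPUT Freeze_poly — annealed rectangle-loop freezing along the regime.**  For every `η > 0` there are `c > 0`,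
`β₀` with `E_{L_b,β}[W_{b × (2n+1)b} ∘ lift] ≥ 1 − η` for all `(β, b)` in `polyRegime θ c β₀` (torus side
`L_b = 2((2n+2)b+1)+1`).  GEN 6 used the `∃ β₀(b)` form (`FixedMesh.torusLoopFreezing`). -/
def LoopFreezingPoly (n : ℕ) (θ : ℝ) : Prop :=
  ∀ η : ℝ, 0 < η → ∃ c : ℝ, 0 < c ∧ ∃ β₀ : ℝ, polyRegime θ c β₀ fun β b =>
    1 - η ≤ ∫ V, loopObs ρ b ((2 * n + 1) * b) (torusLift (2 * ((2 * n + 2) * b + 1) + 1) V)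
      ∂(wilsonMeasure (d := 4) (L := 2 * ((2 * n + 2) * b + 1) + 1) ρ β)

/-- **INPUT F_poly — the comb-twisted mean of the CLIPPED charged test along the regime.**  For every `η > 0` there are
`c > 0`, `β₀` with `μ_{L_b,β}{V | −1 + η < twistedMeanObs ρ β b n (comb_b k₀) (clip r) V} ≤ η`, `r = Re χ_ρ(k₀)/N`, for all
`(β, b)` in `polyRegime θ c β₀`.  GEN 6 used the `∃ β₀(b)` form (`FixedMeshAllG.frameValueBoundObs_comb`, value
`clip r r = −1`). -/
def FrameValuePoly (n : ℕ) (k₀ : G) (θ : ℝ) : Prop :=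
  ∀ η : ℝ, 0 < η → ∃ c : ℝ, 0 < c ∧ ∃ β₀ : ℝ, polyRegime θ c β₀ fun β b =>
    (wilsonMeasure (d := 4) (L := 2 * ((2 * n + 2) * b + 1) + 1) ρ β)
        {V | -1 + η < twistedMeanObs ρ β b n (comb b ((2 * n + 2) * b + 1) k₀)
          (clip ((ρ k₀).trace.re / N)) V} ≤ ENNReal.ofReal η

/-- **THE TARGET — a polynomial ROW FLOOR of exponent `θ`.**  `∃ c > 0, ∃ β₀, ∀ β ≥ β₀, ∀ b, 1 ≤ b ≤ c (β/log β)^θ →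
¬ TypShellCond ρ β b n ε δ`: clause (i) of the registered format T fails at EVERY mesh below the polynomial floor,
i.e. `b⋆_T(β) > c (β / log β)^θ` eventually (`typFloor_of_rowFloorPoly`). -/
def RowFloorPoly (n : ℕ) (ε δ θ : ℝ) : Prop :=
  ∃ c : ℝ, 0 < c ∧ ∃ β₀ : ℝ, polyRegime θ c β₀ fun β b => ¬ TypShellCond ρ β b n ε δ

omit [SecondCountableTopology G] in
theorem loopFreezingPoly_mono {n : ℕ} {θ θ' : ℝ} (hθ : θ' ≤ θ) (h : LoopFreezingPoly ρ n θ) :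
    LoopFreezingPoly ρ n θ' := by
  intro η hη
  obtain ⟨c, hc, β₀, h⟩ := h η hη
  exact ⟨c, hc, max β₀ 3, polyRegime_mono_exponent hθ hc.le (le_max_right _ _)
    (polyRegime_mono_threshold (le_max_left _ _) h)⟩

omit [SecondCountableTopology G] in
theorem frameValuePoly_mono {n : ℕ} {k₀ : G} {θ θ' : ℝ} (hθ : θ' ≤ θ) (h : FrameValuePoly ρ n k₀ θ) :
    FrameValuePoly ρ n k₀ θ' := by
  intro η hη
  obtain ⟨c, hc, β₀, h⟩ := h η hη
  exact ⟨c, hc, max β₀ 3, polyRegime_mono_exponent hθ hc.le (le_max_right _ _)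
    (polyRegime_mono_threshold (le_max_left _ _) h)⟩

omit [SecondCountableTopology G] in
theorem rowFloorPoly_mono {n : ℕ} {ε δ θ θ' : ℝ} (hθ : θ' ≤ θ) (h : RowFloorPoly ρ n ε δ θ) :
    RowFloorPoly ρ n ε δ θ' := by
  obtain ⟨c, hc, β₀, h⟩ := h
  exact ⟨c, hc, max β₀ 3, polyRegime_mono_exponent hθ hc.le (le_max_right _ _)
    (polyRegime_mono_threshold (le_max_left _ _) h)⟩

/-! ## §4 The reduction (PROVED): Freeze_poly ∧ F_poly ⇒ the polynomial row floor; format consequences -/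

/-- **REDUCTION (PROVED).**  For every compact `G`, continuous faithful unitary `ρ`, `N ≥ 1`, `k₀ ≠ 1`, window `n`,
budgets `ε < 1`, `0 ≤ δ`, `4·#windowCellsPlus(n)·δ < 1`, and every exponent `θ`:
`LoopFreezingPoly ρ n θ → FrameValuePoly ρ n k₀ θ → RowFloorPoly ρ n ε δ θ`.
Proof: `frame_core_at` with the comb twist (INPUT T = the landed `topTwistTransfer_comb`, uniform in `b` as it stands),
the clipped test (`A = 2/(1−r)`, `v = −1`), budget `s = min ((2 − 2ε)/4) (1/8)`, constants `c = min c₁ c₂`,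
`β₀ = max β₁ β₂ ⊔ 1`. -/
theorem rowFloorPoly_of_inputs (hρ : Continuous ρ) (hρi : Function.Injective ρ)
    (hρu : ∀ g, ρ g ∈ Matrix.unitaryGroup (Fin N) ℂ) (hN : 1 ≤ N) {k₀ : G} (hk₀ : k₀ ≠ 1)
    (n : ℕ) {ε δ : ℝ} (hε : ε < 1) (hδ0 : 0 ≤ δ) (hδ : 4 * ((windowCellsPlus n).card : ℝ) * δ < 1)
    {θ : ℝ} (hFr : LoopFreezingPoly ρ n θ) (hF : FrameValuePoly ρ n k₀ θ) :
    RowFloorPoly ρ n ε δ θ := by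
  obtain ⟨r, hrdef⟩ : ∃ r : ℝ, (ρ k₀).trace.re / N = r := ⟨_, rfl⟩
  have hr : r < 1 := hrdef ▸ re_trace_div_lt_one ρ hρi hρu hN hk₀
  have h1r : 0 < 1 - r := by linarith
  -- budgets (value `v = -1`, domination constant `A = 2/(1-r)`)
  set s : ℝ := min ((1 - (-1) - 2 * ε) / 4) (1 / 8) with hs
  have hs0 : 0 < s := lt_min (by linarith) (by norm_num)
  have hs8 : s ≤ 1 / 8 := min_le_right _ _
  have hs4 : s ≤ (1 - (-1) - 2 * ε) / 4 := min_le_left _ _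
  have hA0 : 0 ≤ 2 / (1 - r) := div_nonneg (by norm_num) h1r.le
  have hA1 : 0 < 2 / (1 - r) + 1 := by linarith
  have hss : 0 < s * s / (2 / (1 - r) + 1) := div_pos (mul_pos hs0 hs0) hA1
  obtain ⟨c₁, hc₁, β₁, h₁⟩ := hFr (s * s / (2 / (1 - r) + 1)) hss
  obtain ⟨c₂, hc₂, β₂, h₂⟩ := hF s hs0
  refine ⟨min c₁ c₂, lt_min hc₁ hc₂, max (max β₁ β₂) 1, ?_⟩
  intro β hβ b hb hbc
  have hβ1 : β₁ ≤ β := ((le_max_left _ _).trans (le_max_left _ _)).trans hβ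
  have hβ2 : β₂ ≤ β := ((le_max_right _ _).trans (le_max_left _ _)).trans hβ
  have hβone : (1 : ℝ) ≤ β := (le_max_right _ _).trans hβ
  have hx : 0 ≤ (β / Real.log β) ^ θ :=
    Real.rpow_nonneg (div_nonneg (by linarith) (Real.log_nonneg hβone)) θ
  have hb1 : (b : ℝ) ≤ c₁ * (β / Real.log β) ^ θ :=
    hbc.trans (mul_le_mul_of_nonneg_right (min_le_left _ _) hx)
  have hb2 : (b : ℝ) ≤ c₂ * (β / Real.log β) ^ θ :=
    hbc.trans (mul_le_mul_of_nonneg_right (min_le_right _ _) hx)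
  have hfreeze0 := h₁ β hβ1 b hb hb1
  have hFat := h₂ β hβ2 b hb hb2
  simp only [hrdef] at hFat
  intro hTyp
  obtain ⟨Typ, hmeas, hdep, hI, hanch⟩ := clauseI_of_typShellCond hTyp
  exact frame_core_at ρ hρ hρu hb n (comb b ((2 * n + 2) * b + 1) k₀) (continuous_clip r)
    (fun t _ => abs_clip_le r t) hA0 (one_sub_clip_le hr) (topTwistTransfer_comb ρ hb n k₀) hs0 hs8 hs4
    hfreeze0 hFat hδ0 hδ Typ hmeas hdep (rowClauseI_of_clauseI hI) fun c' hc' =>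
    hanch ((2 * n + 2) * b + 1) (by nlinarith) c' (stdFrame_windowCellsPlus_bounds hc')

omit [SecondCountableTopology G] in
/-- **Format T consequence (PROVED):** every mesh of the registered format T exceeds the floor beyond `β₀`. -/
theorem typFloor_of_rowFloorPoly {n : ℕ} {ε δ θ : ℝ} (h : RowFloorPoly ρ n ε δ θ) :
    ∃ c : ℝ, 0 < c ∧ ∃ β₀ : ℝ, ∀ β : ℝ, β₀ ≤ β → ∀ b : ℕ, 1 ≤ b → TypShellCond ρ β b n ε δ →
      c * (β / Real.log β) ^ θ < b := by
  obtain ⟨c, hc, β₀, h⟩ := h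
  exact ⟨c, hc, β₀, fun β hβ b hb hT => lt_of_not_ge fun hle => h β hβ b hb hle hT⟩

omit [SecondCountableTopology G] in
/-- **Format Uc consequence (PROVED):** every mesh of the slot's format Uc (`AfPincerUc.TypShellCondUKPc`, which implies
the registered T by `AfPincerUc.typShellCond_of_UKPc`) exceeds the floor beyond `β₀`; in particular every witness
mesh `b(β)` that a proof of `stub_onsetUcSC` produces for `(n, ε, δ)` lies above `c (β / log β)^θ`. -/
theorem ukpcFloor_of_rowFloorPoly {n : ℕ} {ε δ θ : ℝ} (h : RowFloorPoly ρ n ε δ θ) :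
    ∃ c : ℝ, 0 < c ∧ ∃ β₀ : ℝ, ∀ β : ℝ, β₀ ≤ β → ∀ b : ℕ, 1 ≤ b →
      AfPincerUc.TypShellCondUKPc ρ β b n ε δ → c * (β / Real.log β) ^ θ < b := by
  obtain ⟨c, hc, β₀, h⟩ := typFloor_of_rowFloorPoly ρ h
  exact ⟨c, hc, β₀, fun β hβ b hb hU => h β hβ b hb (AfPincerUc.typShellCond_of_UKPc hU)⟩

omit [SecondCountableTopology G] in
/-- **Onset form (PROVED):** whenever the slot's format Uc holds at some mesh, its onset `mixOnsetUc` exceeds the floor. -/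
theorem mixOnsetUc_floor_of_rowFloorPoly {n : ℕ} {ε δ θ : ℝ} (h : RowFloorPoly ρ n ε δ θ) :
    ∃ c : ℝ, 0 < c ∧ ∃ β₀ : ℝ, ∀ β : ℝ, β₀ ≤ β →
      (AfPincerUc.fmtSet (fun β' b => AfPincerUc.TypShellCondUKPc ρ β' b n ε δ) β).Nonempty →
        c * (β / Real.log β) ^ θ < AfPincerUc.mixOnsetUc ρ β n ε δ := by
  obtain ⟨c, hc, β₀, h⟩ := ukpcFloor_of_rowFloorPoly ρ h
  refine ⟨c, hc, β₀, fun β hβ hne => ?_⟩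
  have hmem := Nat.sInf_mem hne
  exact h β hβ _ hmem.1 hmem.2

end Poly

/-! ## §3b (PROVED) Hygiene: for `θ > 0` the floor is NOT vacuous — it contains every fixed mesh eventually (ctriage-2 O-FTR-4) -/

section Hygiene

/-- `β / log β → ∞`. -/
theorem tendsto_div_log_atTop' : Tendsto (fun β : ℝ => β / Real.log β) atTop atTop := by
  have h0 : Tendsto (fun β : ℝ => Real.log β / β) atTop (𝓝 0) := by
    have := Real.tendsto_pow_log_div_mul_add_atTop 1 0 1 one_ne_zero
    simpa using this
  have hpos : ∀ᶠ β : ℝ in atTop, 0 < Real.log β / β := by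
    filter_upwards [eventually_gt_atTop 1] with β hβ
    exact div_pos (Real.log_pos hβ) (by linarith)
  have h1 : Tendsto (fun β : ℝ => Real.log β / β) atTop (𝓝[>] 0) :=
    tendsto_nhdsWithin_iff.2 ⟨h0, hpos.mono fun β hβ => hβ⟩
  have h2 := tendsto_inv_nhdsGT_zero.comp h1
  refine h2.congr' ?_
  filter_upwards with β
  simp [inv_div]

/-- For `θ > 0`, `c > 0` the polynomial regime eventually contains ANY fixed bound `B`: `B ≤ c (β / log β)^θ` for `β ≥ β₂`.
(For `θ ≤ 0` the three Props of §3 are trivially inhabited — `c := 1/2`, `β₀ := 3` empties the regime — which is why every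
statement of this file is at `θ = 1/4` or `θ = 1/7`.) -/
theorem polyRegime_eventually_ge {θ c : ℝ} (hθ : 0 < θ) (hc : 0 < c) (B : ℝ) :
    ∃ β₂ : ℝ, ∀ β : ℝ, β₂ ≤ β → B ≤ c * (β / Real.log β) ^ θ := by
  have h := ((tendsto_rpow_atTop hθ).comp tendsto_div_log_atTop').const_mul_atTop hc
  obtain ⟨β₂, hβ₂⟩ := Filter.eventually_atTop.1 (h.eventually_ge_atTop B)
  exact ⟨β₂, fun β hβ => by simpa using hβ₂ β hβ⟩

variable {G : Type} [Group G] [TopologicalSpace G] [IsTopologicalGroup G] [CompactSpace G]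
  [MeasurableSpace G] [BorelSpace G] {N : ℕ} (ρ : G →* Matrix (Fin N) (Fin N) ℂ)

/-- **Non-vacuity (PROVED): a polynomial row floor of exponent `θ > 0` implies the FIXED-MESH negative at every mesh**
(the shape of GEN 6's landed `FixedMeshAllG.not_typShellCond_fixedMesh_allG`): `RowFloorPoly ρ n ε δ θ → ∀ b ≥ 1, ∃ β₂,
∀ β ≥ β₂, ¬ TypShellCond ρ β b n ε δ`.  So `RowFloorPoly ρ n ε δ (1/7)` is strictly contentful. -/
theorem fixedMesh_of_rowFloorPoly {n : ℕ} {ε δ θ : ℝ} (hθ : 0 < θ) (h : RowFloorPoly ρ n ε δ θ) (b : ℕ)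
    (hb : 1 ≤ b) : ∃ β₂ : ℝ, ∀ β : ℝ, β₂ ≤ β → ¬ TypShellCond ρ β b n ε δ := by
  obtain ⟨c, hc, β₀, hreg⟩ := h
  obtain ⟨β₂, hβ₂⟩ := polyRegime_eventually_ge hθ hc (b : ℝ)
  exact ⟨max β₀ β₂, fun β hβ =>
    hreg β ((le_max_left _ _).trans hβ) b hb (hβ₂ β ((le_max_right _ _).trans hβ))⟩

end Hygiene

/-! ## §4b QUANTITATIVE (deterministic) non-abelian Stokes and the annealed loop-freezing RATE (PROVED)

The two inductions of `FixedMesh.strip_eq_one` ∕ `rect_eq_one` (there: flat plaquettes ⇒ loop `= 1`) redone with the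
Frobenius defect `d(X) = ‖ρ(X) − 1‖_F` (`d(XY) ≤ d(X) + d(Y)`, conjugation invariant, `d² = 2(N − Re tr ρ)`), giving for
EVERY configuration `1 − W_{b,m}(U) ≤ ((b+1)m/N) · Σ_{s<m} Σ_{t≤b} (N − Re tr ρ(U_{(t,s)}))` over the planar spanning
surface of the `(b+1) × m` rectangle (`one_sub_loopObs_le`); integrated on the odd torus against the tree's volume-uniform
plaquette moment bound `AfOnset.exists_plaquetteCost_moments_le` (`⟨φ_q⟩ ≤ K(1 + log β)/β`, S2 seat's helper from the
chessboard estimate) this is `one_sub_integral_loopObs_le`, and §5's `loopFreezingPoly_quarter` follows by arithmetic. -/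

section QuantStokes

variable {G : Type} [Group G] {N : ℕ} (ρ : G →* Matrix (Fin N) (Fin N) ℂ)

/-- The `(0,1)`-plaquette holonomy based at `site2 t s`. -/
def plaq (U : LGConfig 4 G) (t s : ℤ) : G := plaquetteHolonomyZd U (site2 t s) 0 1

/-- Boundary holonomy of the one-plaquette-high strip `[0,A] × [M,M+1]`. -/
def stripHol (U : LGConfig 4 G) (M A : ℕ) : G :=
  upT U M A * U (site2 (A : ℤ) M, 1) * (upT U ((M : ℤ) + 1) A)⁻¹ * (U (site2 0 (M : ℤ), 1))⁻¹

/-- Boundary holonomy of the rectangle `[0,A] × [0,M]` based at the origin. -/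
def rectHol (U : LGConfig 4 G) (A M : ℕ) : G :=
  upT U 0 A * rightT U (A : ℤ) M * (upT U (M : ℤ) A)⁻¹ * (rightT U 0 M)⁻¹

/-- The link above a plaquette in terms of the other three links and the plaquette holonomy. -/
theorem link_eq_of_plaq (U : LGConfig 4 G) (t s : ℤ) :
    U (site2 (t + 1) s, 1) = (U (site2 t s, 0))⁻¹ * plaq U t s * U (site2 t s, 1) * U (site2 t (s + 1), 0) := by
  rw [plaq, plaquetteHolonomyZd, site2_add_single_zero, site2_add_single_one]
  group

@[simp] theorem stripHol_zero (U : LGConfig 4 G) (M : ℕ) : stripHol U M 0 = 1 := by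
  simp [stripHol]

/-- **Strip recursion**: adding one plaquette multiplies the strip holonomy by a conjugate of that plaquette. -/
theorem stripHol_succ (U : LGConfig 4 G) (M A : ℕ) :
    stripHol U M (A + 1) = (upT U M A * plaq U A M * (upT U M A)⁻¹) * stripHol U M A := by
  simp only [stripHol]
  rw [upT_succ, upT_succ]
  push_cast
  rw [link_eq_of_plaq U (A : ℤ) (M : ℤ)]
  group

@[simp] theorem rectHol_zero (U : LGConfig 4 G) (A : ℕ) : rectHol U A 0 = 1 := by
  simp [rectHol]

/-- **Rectangle recursion**: adding one strip multiplies the rectangle holonomy by a conjugate of the strip holonomy. -/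
theorem rectHol_succ (U : LGConfig 4 G) (A M : ℕ) :
    rectHol U A (M + 1) = rectHol U A M * (rightT U 0 M * stripHol U M A * (rightT U 0 M)⁻¹) := by
  simp only [rectHol, stripHol]
  rw [rightT_succ, rightT_succ]
  push_cast
  group

/-- The rectangle loop `col · staple` is a conjugate of `rectHol U (b+1) m`. -/
theorem col_mul_staple_eq_conj_rectHol {b : ℕ} (hb : 1 ≤ b) (m : ℕ) (U : LGConfig 4 G) :
    col b U * staple b m U = (U (site2 0 0, 0))⁻¹ * rectHol U (b + 1) m * U (site2 0 0, 0) := by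
  have hcol : col b U = (U (site2 0 0, 0))⁻¹ * upT U 0 (b + 1) := by
    rw [← mul_col_eq_upT hb U]; group
  rw [hcol, staple_eq_transport, rectHol]
  push_cast
  group

end QuantStokes

section Frobenius

open scoped Matrix Matrix.Norms.Frobenius

variable {G : Type} [Group G] {N : ℕ} (ρ : G →* Matrix (Fin N) (Fin N) ℂ)

theorem norm_map_mul_sub_one_le (hρu : ∀ g, ρ g ∈ Matrix.unitaryGroup (Fin N) ℂ) (g h : G) :
    ‖ρ (g * h) - 1‖ ≤ ‖ρ g - 1‖ + ‖ρ h - 1‖ := by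
  have hsplit : ρ (g * h) - 1 = ρ g * (ρ h - 1) + (ρ g - 1) := by rw [map_mul]; noncomm_ring
  rw [hsplit]
  refine (norm_add_le _ _).trans ?_
  rw [Matrix.frobenius_norm_unitaryGroup_mul ⟨ρ g, hρu g⟩ (ρ h - 1)]
  linarith

theorem norm_map_inv_sub_one (hρu : ∀ g, ρ g ∈ Matrix.unitaryGroup (Fin N) ℂ) (g : G) :
    ‖ρ g⁻¹ - 1‖ = ‖ρ g - 1‖ := by
  have h : ρ g⁻¹ - 1 = ρ g⁻¹ * (1 - ρ g) := by
    rw [mul_sub, mul_one, ← map_mul, inv_mul_cancel, map_one]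
  rw [h, Matrix.frobenius_norm_unitaryGroup_mul ⟨ρ g⁻¹, hρu g⁻¹⟩, norm_sub_rev]

theorem norm_map_conj_sub_one (hρu : ∀ g, ρ g ∈ Matrix.unitaryGroup (Fin N) ℂ) (k g : G) :
    ‖ρ (k * g * k⁻¹) - 1‖ = ‖ρ g - 1‖ := by
  have h : ρ (k * g * k⁻¹) - 1 = ρ k * (ρ g - 1) * ρ k⁻¹ := by
    rw [map_mul, map_mul, mul_sub, sub_mul, mul_one, mul_assoc (ρ k) (ρ g), ← map_mul, ← map_mul,
      ← map_mul, mul_inv_cancel, map_one]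
  rw [h, Matrix.frobenius_norm_mul_unitaryGroup _ ⟨ρ k⁻¹, hρu k⁻¹⟩,
    Matrix.frobenius_norm_unitaryGroup_mul ⟨ρ k, hρu k⟩]

/-- **Quantitative strip Stokes**: `‖ρ(strip) − 1‖ ≤ Σ_{t<A} ‖ρ(U_{(t,M)}) − 1‖`. -/
theorem norm_stripHol_sub_one_le (hρu : ∀ g, ρ g ∈ Matrix.unitaryGroup (Fin N) ℂ) (U : LGConfig 4 G)
    (M : ℕ) : ∀ A : ℕ,
    ‖ρ (stripHol U M A) - 1‖ ≤ ∑ t ∈ Finset.range A, ‖ρ (plaq U t M) - 1‖ := by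
  intro A
  induction A with
  | zero => simp
  | succ A ih =>
    rw [stripHol_succ, Finset.sum_range_succ]
    refine (norm_map_mul_sub_one_le ρ hρu _ _).trans ?_
    rw [norm_map_conj_sub_one ρ hρu]
    linarith

/-- **Quantitative planar Stokes**: `‖ρ(∂ rectangle) − 1‖ ≤ Σ_{s<M} Σ_{t<A} ‖ρ(U_{(t,s)}) − 1‖`. -/
theorem norm_rectHol_sub_one_le (hρu : ∀ g, ρ g ∈ Matrix.unitaryGroup (Fin N) ℂ) (U : LGConfig 4 G)
    (A : ℕ) : ∀ M : ℕ,
    ‖ρ (rectHol U A M) - 1‖ ≤ ∑ s ∈ Finset.range M, ∑ t ∈ Finset.range A, ‖ρ (plaq U t s) - 1‖ := by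
  intro M
  induction M with
  | zero => simp
  | succ M ih =>
    rw [rectHol_succ, Finset.sum_range_succ]
    refine (norm_map_mul_sub_one_le ρ hρu _ _).trans ?_
    rw [norm_map_conj_sub_one ρ hρu]
    have := norm_stripHol_sub_one_le ρ hρu U M A
    linarith

/-- `N − Re tr ρ(g) = ‖ρ g − 1‖²/2` for unitary `ρ g` (Frobenius norm). -/
theorem sub_re_trace_eq_norm_sq (hρu : ∀ g, ρ g ∈ Matrix.unitaryGroup (Fin N) ℂ) (g : G) :
    (N : ℝ) - (ρ g).trace.re = ‖ρ g - 1‖ ^ 2 / 2 := by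
  have hU : (ρ g)ᴴ * ρ g = 1 := Matrix.mem_unitaryGroup_iff'.1 (hρu g)
  have h1 : ‖ρ g - 1‖ ^ 2 = RCLike.re (Matrix.trace ((ρ g - 1)ᴴ * (ρ g - 1))) :=
    Matrix.frobenius_norm_sq_eq_re_trace _
  have h2 : (ρ g - 1)ᴴ * (ρ g - 1) = 2 • (1 : Matrix (Fin N) (Fin N) ℂ) - ρ g - (ρ g)ᴴ := by
    rw [Matrix.conjTranspose_sub, Matrix.conjTranspose_one, sub_mul, mul_sub, mul_sub, hU, one_mul,
      mul_one, one_mul, two_smul]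
    abel
  rw [h1, h2]
  simp only [Matrix.trace_sub, Matrix.trace_smul, Matrix.trace_one, Fintype.card_fin, map_sub,
    Matrix.trace_conjTranspose, RCLike.star_def, RCLike.conj_re]
  simp only [RCLike.re_to_complex, nsmul_eq_mul, Complex.mul_re]
  norm_num
  ring

/-- **DETERMINISTIC STOKES INEQUALITY (instance-free statement).**  For unitary `ρ`, `N ≥ 1`, `b ≥ 1`:
`1 − W_{b,m}(U) ≤ ((b+1) m / N) · Σ_{s<m} Σ_{t<b+1} (N − Re tr ρ(U_{(t,s)}))` — the rectangle loop deficit is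
controlled by the plaquette costs of its planar spanning surface, configuration by configuration. -/
theorem one_sub_loopObs_le (hρu : ∀ g, ρ g ∈ Matrix.unitaryGroup (Fin N) ℂ) (hN : 1 ≤ N) {b : ℕ}
    (hb : 1 ≤ b) (m : ℕ) (U : LGConfig 4 G) :
    1 - loopObs ρ b m U ≤ ((b + 1 : ℕ) * m / N : ℝ) *
      ∑ s ∈ Finset.range m, ∑ t ∈ Finset.range (b + 1), ((N : ℝ) - (ρ (plaq U t s)).trace.re) := by
  have hN0 : (0 : ℝ) < N := by exact_mod_cast hN
  have hloop : loopObs ρ b m U = (ρ (col b U * staple b m U)).trace.re / N := by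
    simp [loopObs, chargedTest, Complex.div_natCast_re]
  -- the loop deficit as a norm square
  have hdef : 1 - loopObs ρ b m U = ‖ρ (col b U * staple b m U) - 1‖ ^ 2 / 2 / N := by
    rw [hloop, ← sub_re_trace_eq_norm_sq ρ hρu]
    field_simp
  -- Stokes bound on the norm
  have hconj : ‖ρ (col b U * staple b m U) - 1‖ = ‖ρ (rectHol U (b + 1) m) - 1‖ := by
    rw [col_mul_staple_eq_conj_rectHol hb m U]
    have := norm_map_conj_sub_one ρ hρu (U (site2 0 0, 0))⁻¹ (rectHol U (b + 1) m)
    rwa [inv_inv] at this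
  set D : ℝ := ∑ s ∈ Finset.range m, ∑ t ∈ Finset.range (b + 1), ‖ρ (plaq U t s) - 1‖ with hD
  have hnorm : ‖ρ (col b U * staple b m U) - 1‖ ≤ D := hconj ▸ norm_rectHol_sub_one_le ρ hρu U (b + 1) m
  -- Cauchy–Schwarz over the surface
  have hCS : D ^ 2 ≤ ((b + 1 : ℕ) * m : ℝ) *
      ∑ s ∈ Finset.range m, ∑ t ∈ Finset.range (b + 1), ‖ρ (plaq U t s) - 1‖ ^ 2 := by
    have h := sq_sum_le_card_mul_sum_sq (s := Finset.range m ×ˢ Finset.range (b + 1))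
      (f := fun p : ℕ × ℕ => ‖ρ (plaq U p.2 p.1) - 1‖)
    rw [Finset.sum_product, Finset.sum_product, Finset.card_product, Finset.card_range,
      Finset.card_range] at h
    push_cast at h ⊢
    rw [hD]
    linarith
  have hsq : ∑ s ∈ Finset.range m, ∑ t ∈ Finset.range (b + 1), ‖ρ (plaq U t s) - 1‖ ^ 2 =
      2 * ∑ s ∈ Finset.range m, ∑ t ∈ Finset.range (b + 1), ((N : ℝ) - (ρ (plaq U t s)).trace.re) := by
    rw [Finset.mul_sum]
    refine Finset.sum_congr rfl fun s _ => ?_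
    rw [Finset.mul_sum]
    refine Finset.sum_congr rfl fun t _ => ?_
    rw [sub_re_trace_eq_norm_sq ρ hρu]
    ring
  rw [hdef]
  have h0 : 0 ≤ ‖ρ (col b U * staple b m U) - 1‖ := norm_nonneg _
  have h1 : ‖ρ (col b U * staple b m U) - 1‖ ^ 2 ≤ D ^ 2 := pow_le_pow_left₀ h0 hnorm 2
  rw [hsq] at hCS
  have h2 : ‖ρ (col b U * staple b m U) - 1‖ ^ 2 / 2 / N ≤ D ^ 2 / 2 / N := by
    gcongr
  refine h2.trans ?_
  rw [div_div, div_le_iff₀ (by positivity)]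
  have hN1 : (N : ℝ) ≠ 0 := hN0.ne'
  calc D ^ 2 ≤ _ := hCS
    _ = _ := by field_simp

end Frobenius

section FreezeAssembly

open Literature.MathematicalPhysics.QuantumFieldTheory (wilsonMeasure GaugeConfig isProbabilityMeasure_wilsonMeasure
  LatticeRep plaquetteCost Plaquette)
open Summit.QuantumFields.YangMills.Theorems.TunedSequenceExists.Negative.Freezing (plaquetteHolonomyZd_torusLift')

variable {G : Type} [Group G] [TopologicalSpace G] [IsTopologicalGroup G] [CompactSpace G]
  [SecondCountableTopology G] [MeasurableSpace G] [BorelSpace G]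
  {N : ℕ} (ρ : G →* Matrix (Fin N) (Fin N) ℂ)

/-- The `(0,1)` torus plaquette under the base point `site2 t s`. -/
def torusPlaq (L : ℕ) (t s : ℤ) : Plaquette 4 L :=
  (Torus.proj L (site2 t s), ⟨((0 : Fin 4), (1 : Fin 4)), by decide⟩)

omit [TopologicalSpace G] [IsTopologicalGroup G] [CompactSpace G] [SecondCountableTopology G] [MeasurableSpace G]
  [BorelSpace G] in
/-- The lifted plaquette cost IS the torus plaquette cost. -/
theorem plaqCost_torusLift (L : ℕ) (V : GaugeConfig 4 L G) (t s : ℤ) :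
    (N : ℝ) - (ρ (plaq (torusLift L V) t s)).trace.re = plaquetteCost ρ V (torusPlaq L t s) := by
  simp only [plaq, plaquetteHolonomyZd_torusLift', plaquetteCost, torusPlaq]

/-- **The ANNEALED MEAN of the loop deficit** on the odd torus: `1 − E[W_{b,m} ∘ lift] ≤ ((b+1)m)²/N · K(1+log β)/β`. -/
theorem one_sub_integral_loopObs_le (hρ : Continuous ρ) (hρi : Function.Injective ρ)
    (hρu : ∀ g, ρ g ∈ Matrix.unitaryGroup (Fin N) ℂ) (hN : 1 ≤ N) :
    ∃ K : ℝ, 0 ≤ K ∧ ∀ (L : ℕ), 1 ≤ L → ∀ β : ℝ, 1 ≤ β → ∀ {b : ℕ}, 1 ≤ b → ∀ m : ℕ,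
      1 - ∫ V, loopObs ρ b m (torusLift (2 * L + 1) V) ∂(wilsonMeasure (d := 4) (L := 2 * L + 1) ρ β) ≤
        ((b + 1 : ℕ) * m : ℝ) ^ 2 / N * (K * (1 + Real.log β) / β) := by
  set r : LatticeRep G := ⟨N, ρ, hρ, hρi, hρu⟩ with hr
  obtain ⟨K, hK0, hmom⟩ := AfOnset.exists_plaquetteCost_moments_le r
  refine ⟨K, hK0, fun L hL β hβ b hb m => ?_⟩
  set S : ℕ := 2 * L + 1 with hS
  set μ := wilsonMeasure (d := 4) (L := S) ρ β with hμ
  haveI : IsProbabilityMeasure μ := isProbabilityMeasure_wilsonMeasure ρ hρ β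
  have hN0 : (0 : ℝ) < N := by exact_mod_cast hN
  -- the summands
  set φ : ℤ → ℤ → GaugeConfig 4 S G → ℝ := fun t s V => (N : ℝ) - (ρ (plaq (torusLift S V) t s)).trace.re with hφ
  have hφcont : ∀ t s, Continuous (φ t s) := by
    intro t s
    simp only [hφ, plaq]
    exact continuous_const.sub ((continuous_plaquetteObs ρ hρ (site2 t s) 0 1).comp (continuous_torusLift S))
  have hφint : ∀ t s, Integrable (φ t s) μ := by
    intro t s
    refine Integrable.of_bound (hφcont t s).measurable.aestronglyMeasurable (2 * N) (ae_of_all _ fun V => ?_)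
    have h := abs_le.1 (abs_plaquetteObs_le_holds ρ hρu (site2 t s) 0 1 (torusLift S V))
    simp only [hφ, plaq, Real.norm_eq_abs]
    rw [abs_le]
    simp only [plaquetteObs] at h
    constructor <;> linarith [h.1, h.2]
  have hφmean : ∀ t s, ∫ V, φ t s V ∂μ ≤ K * (1 + Real.log β) / β := by
    intro t s
    have h := (hmom L hL β hβ (torusPlaq S t s)).1
    have heq : ∫ V, φ t s V ∂μ = ∫ V, plaquetteCost r.ρ V (torusPlaq S t s) ∂μ :=
      integral_congr_ae (ae_of_all _ fun V => plaqCost_torusLift ρ S V t s)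
    rw [heq]
    exact h
  -- the loop observable
  have hWint : Integrable (fun V : GaugeConfig 4 S G => loopObs ρ b m (torusLift S V)) μ := by
    refine Integrable.of_bound
      (((continuous_loopObs ρ hρ b m).comp (continuous_torusLift S)).measurable.aestronglyMeasurable) 1
      (ae_of_all _ fun V => ?_)
    rw [Real.norm_eq_abs]
    exact abs_loopObs_le ρ hρu b m _
  -- pointwise Stokes
  set A : ℝ := ((b + 1 : ℕ) * m : ℝ) with hA
  have hpt : ∀ V : GaugeConfig 4 S G, 1 - loopObs ρ b m (torusLift S V) ≤
      A / N * ∑ s ∈ Finset.range m, ∑ t ∈ Finset.range (b + 1), φ t s V := by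
    intro V
    have h := one_sub_loopObs_le ρ hρu hN hb m (torusLift S V)
    simpa [hφ, hA] using h
  -- integrate
  have hsumint : Integrable (fun V => A / N * ∑ s ∈ Finset.range m, ∑ t ∈ Finset.range (b + 1), φ t s V) μ := by
    refine Integrable.const_mul ?_ _
    refine integrable_finsetSum (Finset.range m) fun s _ => ?_
    exact integrable_finsetSum (Finset.range (b + 1)) fun t _ => hφint t s
  have h1 : 1 - ∫ V, loopObs ρ b m (torusLift S V) ∂μ = ∫ V, (1 - loopObs ρ b m (torusLift S V)) ∂μ := by
    rw [integral_sub (integrable_const _) hWint, integral_const, smul_eq_mul, mul_one]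
    simp
  rw [h1]
  calc ∫ V, (1 - loopObs ρ b m (torusLift S V)) ∂μ
      ≤ ∫ V, A / N * ∑ s ∈ Finset.range m, ∑ t ∈ Finset.range (b + 1), φ t s V ∂μ :=
        integral_mono ((integrable_const _).sub hWint) hsumint hpt
    _ = A / N * ∑ s ∈ Finset.range m, ∑ t ∈ Finset.range (b + 1), ∫ V, φ t s V ∂μ := by
        rw [integral_const_mul]
        congr 1
        rw [integral_finsetSum (Finset.range m) fun s _ =>
          integrable_finsetSum (Finset.range (b + 1)) fun t _ => hφint t s]
        refine Finset.sum_congr rfl fun s _ => ?_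
        rw [integral_finsetSum (Finset.range (b + 1)) fun t _ => hφint t s]
    _ ≤ A / N * ∑ s ∈ Finset.range m, ∑ t ∈ Finset.range (b + 1), K * (1 + Real.log β) / β := by
        gcongr with s _ t _
        exact hφmean t s
    _ = A ^ 2 / N * (K * (1 + Real.log β) / β) := by
        rw [Finset.sum_const, Finset.sum_const, Finset.card_range, Finset.card_range, nsmul_eq_mul, nsmul_eq_mul,
          hA]
        push_cast
        ring

end FreezeAssembly

/-! ## §4c PROVED pieces of the F_poly plan: step (3) (pointwise algebra of the clipped twisted test) and the
## energy–entropy tail for the Yang–Mills DLR kernel (step (4), measure side)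

`clip_re_trace_twisted_le`: for unitary `ρ`, `r = Re χ_ρ(k₀)/N < 1`, EVERY `H` and conjugator `g`,
`clip r (Re tr ρ(H · g k₀⁻¹ g⁻¹)/N) ≤ −1 + (2/((1−r)√N)) ‖ρ(H) − 1‖_F` (so the twisted clipped test exceeds `−1` only
through the Frobenius defect of the physical rectangle holonomy, which §4b's Stokes bounds by plaquette defects);
`ymSpecification_tail_le`: `γ_Λ(·|η){a < A} ≤ e^{−β(a−s)}/μ_{Λ,η}{A ≤ s}` for the kernel `ymSpecification ρ β Λ η`
(definitionally the tilt of glued product Haar `μ_{Λ,η}` by `−β A`, `A = wilsonBoundaryAction ρ Λ ≥ 0`). -/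

section FrobeniusTrace

open scoped Matrix Matrix.Norms.Frobenius

variable {N : ℕ}

/-- `|Re tr T| ≤ √N ‖T‖_F` (Cauchy–Schwarz against the identity, via the discriminant of `‖T − t·1‖²`). -/
theorem abs_re_trace_le_sqrt_mul_norm (T : Matrix (Fin N) (Fin N) ℂ) :
    |T.trace.re| ≤ Real.sqrt N * ‖T‖ := by
  -- expansion of `‖T − t•1‖²`
  have hexp : ∀ t : ℝ, ‖T - (t : ℂ) • (1 : Matrix (Fin N) (Fin N) ℂ)‖ ^ 2 =
      ‖T‖ ^ 2 - 2 * t * T.trace.re + t ^ 2 * N := by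
    intro t
    have h1 := Matrix.frobenius_norm_sq_eq_re_trace (T - (t : ℂ) • (1 : Matrix (Fin N) (Fin N) ℂ))
    have h0 := Matrix.frobenius_norm_sq_eq_re_trace T
    rw [h1]
    simp only [Matrix.conjTranspose_sub, Matrix.conjTranspose_smul, Matrix.conjTranspose_one, sub_mul, mul_sub,
      Matrix.smul_mul, Matrix.mul_smul, one_mul, mul_one, Matrix.trace_sub, Matrix.trace_smul, Matrix.trace_one,
      map_sub, smul_eq_mul, Fintype.card_fin, RCLike.star_def, Complex.conj_ofReal]
    rw [h0]
    simp only [RCLike.re_to_complex, Complex.mul_re, Complex.ofReal_re, Complex.ofReal_im, Complex.natCast_re,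
      Complex.natCast_im, Matrix.trace_conjTranspose, RCLike.star_def, Complex.conj_re, Complex.conj_im]
    ring
  by_cases hN : N = 0
  · subst hN
    simp [Matrix.trace]
  have hNpos : (0 : ℝ) < N := by exact_mod_cast Nat.pos_of_ne_zero hN
  -- discriminant at `t = Re tr T / N`
  have hkey : (T.trace.re) ^ 2 ≤ N * ‖T‖ ^ 2 := by
    have h := sq_nonneg ‖T - ((T.trace.re / N : ℝ) : ℂ) • (1 : Matrix (Fin N) (Fin N) ℂ)‖
    rw [hexp] at h
    have e : ‖T‖ ^ 2 - 2 * (T.trace.re / N) * T.trace.re + (T.trace.re / N) ^ 2 * N =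
        (N * ‖T‖ ^ 2 - T.trace.re ^ 2) / N := by field_simp; ring
    rw [e] at h
    have := (div_nonneg_iff.1 h)
    rcases this with ⟨h1, _⟩ | ⟨_, h2⟩
    · linarith
    · exfalso; linarith
  have h2 : |T.trace.re| ^ 2 ≤ (Real.sqrt N * ‖T‖) ^ 2 := by
    rw [sq_abs, mul_pow, Real.sq_sqrt hNpos.le]; exact hkey
  exact (pow_le_pow_iff_left₀ (abs_nonneg _) (by positivity) two_ne_zero).1 h2

end FrobeniusTrace

section ClipAlgebra

open scoped Matrix Matrix.Norms.Frobenius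

variable {G : Type} [Group G] {N : ℕ} (ρ : G →* Matrix (Fin N) (Fin N) ℂ)

/-- `Re tr ρ(k⁻¹) = Re tr ρ(k)` for unitary `ρ`. -/
theorem re_trace_map_inv (hρu : ∀ g, ρ g ∈ Matrix.unitaryGroup (Fin N) ℂ) (k : G) :
    (ρ k⁻¹).trace.re = (ρ k).trace.re := by
  have h1 : ρ k * star (ρ k) = 1 := Matrix.mem_unitaryGroup_iff.1 (hρu k)
  have hinv : ρ k⁻¹ * ρ k = 1 := by rw [← map_mul, inv_mul_cancel, map_one]
  have h : ρ k⁻¹ = (ρ k)ᴴ := by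
    rw [← Matrix.star_eq_conjTranspose]
    calc ρ k⁻¹ = ρ k⁻¹ * (ρ k * star (ρ k)) := by rw [h1, mul_one]
      _ = star (ρ k) := by rw [← mul_assoc, hinv, one_mul]
  rw [h, Matrix.trace_conjTranspose, RCLike.star_def, Complex.conj_re]

/-- `Re tr ρ(g k g⁻¹) = Re tr ρ(k)`. -/
theorem re_trace_map_conj (g k : G) : (ρ (g * k * g⁻¹)).trace.re = (ρ k).trace.re := by
  rw [map_mul, map_mul, Matrix.trace_mul_cycle, ← map_mul, inv_mul_cancel, map_one, one_mul]

/-- **The loop-times-conjugate-twist deviation**: `|Re tr ρ(H · g k₀⁻¹ g⁻¹)/N − Re tr ρ(k₀)/N| ≤ ‖ρ(H) − 1‖_F / √N`. -/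
theorem abs_re_trace_mul_conj_sub_le (hρu : ∀ g, ρ g ∈ Matrix.unitaryGroup (Fin N) ℂ) (hN : 1 ≤ N)
    (H g k₀ : G) :
    |(ρ (H * (g * k₀⁻¹ * g⁻¹))).trace.re / N - (ρ k₀).trace.re / N| ≤ ‖ρ H - 1‖ / Real.sqrt N := by
  have hN0 : (0 : ℝ) < N := by exact_mod_cast hN
  have hsq : 0 < Real.sqrt N := Real.sqrt_pos.2 hN0
  set k' : G := g * k₀⁻¹ * g⁻¹ with hk'
  have hr : (ρ k').trace.re = (ρ k₀).trace.re := by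
    rw [hk', re_trace_map_conj ρ, re_trace_map_inv ρ hρu]
  have hdiff : (ρ (H * k')).trace.re - (ρ k').trace.re = ((ρ H - 1) * ρ k').trace.re := by
    rw [map_mul, sub_mul, one_mul, Matrix.trace_sub, Complex.sub_re]
  have hb : |((ρ H - 1) * ρ k').trace.re| ≤ Real.sqrt N * ‖ρ H - 1‖ := by
    refine (abs_re_trace_le_sqrt_mul_norm _).trans ?_
    rw [Matrix.frobenius_norm_mul_unitaryGroup _ ⟨ρ k', hρu k'⟩]
  rw [← sub_div, ← hr, hdiff, abs_div, abs_of_pos hN0, div_le_div_iff₀ hN0 hsq]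
  calc |((ρ H - 1) * ρ k').trace.re| * Real.sqrt N ≤ Real.sqrt N * ‖ρ H - 1‖ * Real.sqrt N := by gcongr
    _ = ‖ρ H - 1‖ * N := by rw [mul_comm (Real.sqrt N), mul_assoc, Real.mul_self_sqrt hN0.le]

/-- `clip r` sits at most `2|t − r|/(1 − r)` above its twisted value `−1`. -/
theorem clip_le_neg_one_add {r : ℝ} (hr : r < 1) (t : ℝ) : clip r t ≤ -1 + 2 * |t - r| / (1 - r) := by
  have h1r : 0 < 1 - r := by linarith
  have habs : 0 ≤ 2 * |t - r| / (1 - r) := by positivity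
  unfold clip
  refine max_le (by linarith) ((min_le_right _ _).trans ?_)
  have : 2 * (t - r) / (1 - r) ≤ 2 * |t - r| / (1 - r) := by
    gcongr; exact le_abs_self _
  linarith

/-- **STEP (3) of the F_poly plan, pointwise and deterministic (PROVED).**  For unitary `ρ`, `N ≥ 1`, a twist `k₀` with
`r = Re χ_ρ(k₀)/N < 1`, any `H` (the physical rectangle holonomy in the un-twisted gauge) and any conjugator `g`:
`clip r (Re tr ρ(H · g k₀⁻¹ g⁻¹)/N) ≤ −1 + (2/((1−r)√N)) ‖ρ(H) − 1‖_F`.  (GEN 6's zero-temperature identity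
`chargedTest_re_eq_of_minimiser_comb` is the case `ρ(H) = 1`.) -/
theorem clip_re_trace_twisted_le (hρu : ∀ g, ρ g ∈ Matrix.unitaryGroup (Fin N) ℂ) (hN : 1 ≤ N) {k₀ : G}
    (hr : (ρ k₀).trace.re / N < 1) (H g : G) :
    clip ((ρ k₀).trace.re / N) ((ρ (H * (g * k₀⁻¹ * g⁻¹))).trace.re / N) ≤
      -1 + 2 / ((1 - (ρ k₀).trace.re / N) * Real.sqrt N) * ‖ρ H - 1‖ := by
  have hN0 : (0 : ℝ) < N := by exact_mod_cast hN
  have hsq : 0 < Real.sqrt N := Real.sqrt_pos.2 hN0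
  have h1r : 0 < 1 - (ρ k₀).trace.re / N := by linarith
  have hne : (N : ℝ) - (ρ k₀).trace.re ≠ 0 := by
    intro h0
    have : 1 - (ρ k₀).trace.re / N = ((N : ℝ) - (ρ k₀).trace.re) / N := by field_simp
    rw [this, h0, zero_div] at h1r
    exact lt_irrefl _ h1r
  refine (clip_le_neg_one_add hr _).trans ?_
  have hdev := abs_re_trace_mul_conj_sub_le ρ hρu hN H g k₀
  have : 2 * |(ρ (H * (g * k₀⁻¹ * g⁻¹))).trace.re / N - (ρ k₀).trace.re / N| / (1 - (ρ k₀).trace.re / N) ≤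
      2 / ((1 - (ρ k₀).trace.re / N) * Real.sqrt N) * ‖ρ H - 1‖ := by
    rw [div_le_iff₀ h1r]
    calc 2 * |(ρ (H * (g * k₀⁻¹ * g⁻¹))).trace.re / N - (ρ k₀).trace.re / N|
        ≤ 2 * (‖ρ H - 1‖ / Real.sqrt N) := by gcongr
      _ = 2 / ((1 - (ρ k₀).trace.re / N) * Real.sqrt N) * ‖ρ H - 1‖ * (1 - (ρ k₀).trace.re / N) := by
          field_simp
  linarith

end ClipAlgebra

section YMSpecTail

open Literature.MathematicalPhysics.QuantumFieldTheory (haarProbability)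

variable {G : Type} [Group G] [TopologicalSpace G] [IsTopologicalGroup G] [CompactSpace G]
  [SecondCountableTopology G] [MeasurableSpace G] [BorelSpace G]
  {d N : ℕ} (ρ : G →* Matrix (Fin N) (Fin N) ℂ)

omit [TopologicalSpace G] [IsTopologicalGroup G] [CompactSpace G] [SecondCountableTopology G] [MeasurableSpace G]
  [BorelSpace G] in
/-- The boundary Wilson action is non-negative for unitary `ρ`. -/
theorem wilsonBoundaryAction_nonneg (hρu : ∀ g, ρ g ∈ Matrix.unitaryGroup (Fin N) ℂ) (Λ : Finset (ZdEdge d))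
    (U : LGConfig d G) : 0 ≤ wilsonBoundaryAction ρ Λ U :=
  Finset.sum_nonneg fun p _ => by
    have := (abs_le.1 (abs_plaquetteObs_le_holds ρ hρu p.1 p.2.1.1 p.2.1.2 U)).2
    linarith

/-- **The energy–entropy tail FOR THE YANG–MILLS DLR KERNEL (PROVED).**  `ymSpecification ρ β Λ η` is, by definition, the
Gibbs tilt of the glued product Haar measure `μ_{Λ,η}` by `−β · wilsonBoundaryAction ρ Λ`; hence for every `a`, `s` with
`μ_{Λ,η}{A ≤ s} > 0`:  `γ_Λ(· | η){a < A} ≤ e^{−β(a−s)} / μ_{Λ,η}{A ≤ s}`. -/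
theorem ymSpecification_tail_le (hρ : Continuous ρ) (hρu : ∀ g, ρ g ∈ Matrix.unitaryGroup (Fin N) ℂ) {β : ℝ}
    (hβ : 0 ≤ β) (Λ : Finset (ZdEdge d)) (η : LGConfig d G) (a s : ℝ)
    (hs : 0 < ((Measure.pi fun _ : ↥Λ => haarProbability G).map (glueWith Λ · η)).real
      {U | wilsonBoundaryAction ρ Λ U ≤ s}) :
    (ymSpecification ρ β Λ η).real {U | a < wilsonBoundaryAction ρ Λ U} ≤
      Real.exp (-(β * (a - s))) /
        ((Measure.pi fun _ : ↥Λ => haarProbability G).map (glueWith Λ · η)).real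
          {U | wilsonBoundaryAction ρ Λ U ≤ s} := by
  haveI : IsProbabilityMeasure ((Measure.pi fun _ : ↥Λ => haarProbability G).map (glueWith Λ · η)) :=
    Measure.isProbabilityMeasure_map (measurable_glueWith Λ η).aemeasurable
  have h := gibbsTail_le ((Measure.pi fun _ : ↥Λ => haarProbability G).map (glueWith Λ · η))
    (continuous_wilsonBoundaryAction ρ hρ Λ).measurable (wilsonBoundaryAction_nonneg ρ hρu Λ) hβ a s hs
  have e : ymSpecification ρ β Λ η =
      ((Measure.pi fun _ : ↥Λ => haarProbability G).map (glueWith Λ · η)).tilted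
        fun U => -(β * wilsonBoundaryAction ρ Λ U) := by
    simp only [ymSpecification, neg_mul]
  rw [e]
  exact h

omit [TopologicalSpace G] [IsTopologicalGroup G] [CompactSpace G] [SecondCountableTopology G] [MeasurableSpace G]
  [BorelSpace G] in
/-- The boundary Wilson action is at most `2N · #(plaquettes touching Λ)` (unitary `ρ`; rev 9). -/
theorem wilsonBoundaryAction_le_card (hρu : ∀ g, ρ g ∈ Matrix.unitaryGroup (Fin N) ℂ) (Λ : Finset (ZdEdge d))
    (U : LGConfig d G) : wilsonBoundaryAction ρ Λ U ≤ 2 * N * (plaquettesTouching Λ).card := by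
  unfold wilsonBoundaryAction
  have h : ∀ p ∈ plaquettesTouching Λ, ((N : ℝ) - plaquetteObs ρ p.1 p.2.1.1 p.2.1.2 U) ≤ 2 * N :=
    fun p _ => by
      have := (abs_le.1 (abs_plaquetteObs_le_holds ρ hρu p.1 p.2.1.1 p.2.1.2 U)).1
      linarith
  calc ∑ p ∈ plaquettesTouching Λ, ((N : ℝ) - plaquetteObs ρ p.1 p.2.1.1 p.2.1.2 U)
      ≤ ∑ _p ∈ plaquettesTouching Λ, (2 * (N : ℝ)) := Finset.sum_le_sum h
    _ = 2 * N * (plaquettesTouching Λ).card := by rw [Finset.sum_const, nsmul_eq_mul]; ring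

/-- **The energy–entropy MEAN bound FOR THE YANG–MILLS DLR KERNEL (PROVED; rev 9)** — the tool of step (b) of the §5 plan:
for `β > 0`, `s, t ≥ 0` and reference mass `π_{Λ,η}{A ≤ s} > 0` (`π_{Λ,η}` = glued product Haar, `A = wilsonBoundaryAction ρ Λ`):
`E_{γ_Λ(·|η)} A ≤ s + (log(1/π_{Λ,η}{A ≤ s}) + t)/β + 2N·#touching(Λ) · e^{−t}`. -/
theorem ymSpecification_mean_action_le (hρ : Continuous ρ) (hρu : ∀ g, ρ g ∈ Matrix.unitaryGroup (Fin N) ℂ) {β : ℝ}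
    (hβ : 0 < β) (Λ : Finset (ZdEdge d)) (η : LGConfig d G) {s t : ℝ} (hs0 : 0 ≤ s) (ht : 0 ≤ t)
    (hs : 0 < ((Measure.pi fun _ : ↥Λ => haarProbability G).map (glueWith Λ · η)).real
      {U | wilsonBoundaryAction ρ Λ U ≤ s}) :
    ∫ U, wilsonBoundaryAction ρ Λ U ∂(ymSpecification ρ β Λ η) ≤
      s + (Real.log (1 / ((Measure.pi fun _ : ↥Λ => haarProbability G).map (glueWith Λ · η)).real
            {U | wilsonBoundaryAction ρ Λ U ≤ s}) + t) / β +
        2 * N * (plaquettesTouching Λ).card * Real.exp (-t) := by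
  haveI : IsProbabilityMeasure ((Measure.pi fun _ : ↥Λ => haarProbability G).map (glueWith Λ · η)) :=
    Measure.isProbabilityMeasure_map (measurable_glueWith Λ η).aemeasurable
  have h := gibbsMean_le ((Measure.pi fun _ : ↥Λ => haarProbability G).map (glueWith Λ · η))
    (continuous_wilsonBoundaryAction ρ hρ Λ).measurable (wilsonBoundaryAction_nonneg ρ hρu Λ)
    (wilsonBoundaryAction_le_card ρ hρu Λ) hβ hs0 ht hs
  have e : ymSpecification ρ β Λ η =
      ((Measure.pi fun _ : ↥Λ => haarProbability G).map (glueWith Λ · η)).tilted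
        fun U => -(β * wilsonBoundaryAction ρ Λ U) := by
    simp only [ymSpecification, neg_mul]
  rw [e]
  exact h

end YMSpecTail

/-! ## §4d ROUTE B (PROVED): F_poly reduces to the kernel-mean of the PHYSICAL rectangle defect in the twisted world

The observation (new in rev 3): the layer twist `σ' = topTwist_b(k) σ` touches exactly ONE link of the staple — the
down-run link `((b, m, 0, 0), 0)`, multiplied on the right by `k(b+1, m, 0, 0)⁻¹` — so
`staple(σ') = T · k_r · T⁻¹ · staple(σ)` (`T` = top run, `k_r = k(b+1,m,0,0)`), and for the comb twist
`k_r = s⁻¹ k₀ s` is a conjugate of `k₀`.  Hence, for EVERY `σ` and `U` (no flatness, no comb coherence, no defect):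
`col U · staple σ = H'(U) · g k₀⁻¹ g⁻¹` with `H'(U) = col U · staple(σ')` THE PHYSICAL HOLONOMY OF THE GLUED
CONFIGURATION `U ∨ σ'` around the rectangle.  With §4c this gives, pointwise in `V`,
`twistedMeanObs(V) ≤ −1 + C_r · E_{γ_Λ(·|σ'_V)} ‖ρ(H'(U)) − 1‖_F`, `C_r = 2/((1−r)√N)`: INPUT F_poly follows from a
tail bound on the kernel-mean `twistDefect` of a GAUGE-INVARIANT physical quantity (`KernelDefectPoly`), by set
inclusion (no measurability of `V ↦ twistedMeanObs V` needed).  The kernel gauge-covariance step (2) of the rev-2 plan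
is thereby UNNECESSARY. -/

section RouteB

open scoped Matrix Matrix.Norms.Frobenius
open Literature.MathematicalPhysics.QuantumFieldTheory (wilsonMeasure GaugeConfig isProbabilityMeasure_wilsonMeasure)
open Summit.QuantumFields.YangMills.Theorems.TunedSequenceExists.Negative.Freezing (integrable_of_continuous)

variable {G : Type} [Group G] [TopologicalSpace G] [IsTopologicalGroup G] [CompactSpace G]
  [SecondCountableTopology G] [MeasurableSpace G] [BorelSpace G]
  {N : ℕ} (ρ : G →* Matrix (Fin N) (Fin N) ℂ)

/-- The top run of the staple: `m` forward links in direction `1` at height `b + 1`. -/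
def topRun (b m : ℕ) (U : LGConfig 4 G) : G :=
  ((List.range m).map fun s : ℕ => U (site2 ((b : ℤ) + 1) s, 1)).prod

omit [TopologicalSpace G] [IsTopologicalGroup G] [CompactSpace G] [SecondCountableTopology G] [MeasurableSpace G]
  [BorelSpace G] in
theorem staple_eq_topRun_mul (b m : ℕ) (U : LGConfig 4 G) :
    staple b m U = topRun b m U * (((((List.range (b + 1)).reverse).map fun t : ℕ => (U (site2 t m, 0))⁻¹).prod *
      ((((List.range m).reverse).map fun s : ℕ => (U (site2 0 s, 1))⁻¹).prod * U (site2 0 0, 0)))) := rfl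

omit [TopologicalSpace G] [IsTopologicalGroup G] [CompactSpace G] [SecondCountableTopology G] [MeasurableSpace G]
  [BorelSpace G] in
/-- The layer twist off height `b`. -/
theorem topTwist_site2_of_ne {b : ℕ} (k : Site 4 → G) (U : LGConfig 4 G) {t : ℤ} (ht : t ≠ (b : ℤ)) (s : ℤ)
    (i : Fin 4) : topTwist b k U (site2 t s, i) = U (site2 t s, i) :=
  topTwist_apply_of_ne k U ht

omit [TopologicalSpace G] [IsTopologicalGroup G] [CompactSpace G] [SecondCountableTopology G] [MeasurableSpace G]
  [BorelSpace G] in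
/-- The layer twist on the time link at height `b`. -/
theorem topTwist_site2_height {b : ℕ} (k : Site 4 → G) (U : LGConfig 4 G) (s : ℤ) :
    topTwist b k U (site2 (b : ℤ) s, 0) = U (site2 (b : ℤ) s, 0) * (k (site2 ((b : ℤ) + 1) s))⁻¹ := by
  unfold topTwist
  rw [if_pos ⟨rfl, rfl⟩, site2_add_single_zero]

omit [TopologicalSpace G] [IsTopologicalGroup G] [CompactSpace G] [SecondCountableTopology G] [MeasurableSpace G]
  [BorelSpace G] in
/-- **The twist seen by the staple (PROVED).**  `staple(topTwist_b(k) U) = T · k(b+1, m) · T⁻¹ · staple(U)`, `T` the top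
run: of the staple's links only the down-run link at height `b` is twisted (`1 ≤ b` keeps the closing link untwisted). -/
theorem staple_topTwist {b : ℕ} (hb : 1 ≤ b) (m : ℕ) (k : Site 4 → G) (U : LGConfig 4 G) :
    staple b m (topTwist b k U) =
      topRun b m U * k (site2 ((b : ℤ) + 1) m) * (topRun b m U)⁻¹ * staple b m U := by
  have hb0 : (0 : ℤ) ≠ (b : ℤ) := by
    have : (1 : ℤ) ≤ b := by exact_mod_cast hb
    omega
  have hb1 : (b : ℤ) + 1 ≠ (b : ℤ) := by omega
  have htop : topRun b m (topTwist b k U) = topRun b m U := by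
    unfold topRun
    simp only [topTwist_site2_of_ne k U hb1]
  have hrest : ((List.range b).reverse.map fun t : ℕ => (topTwist b k U (site2 t m, 0))⁻¹) =
      (List.range b).reverse.map fun t : ℕ => (U (site2 t m, 0))⁻¹ := by
    refine List.map_congr_left fun t ht => ?_
    have htb : (t : ℤ) ≠ (b : ℤ) := by
      have := List.mem_range.1 (List.mem_reverse.1 ht)
      omega
    rw [topTwist_site2_of_ne k U htb]
  have hdown : ((List.range (b + 1)).reverse.map fun t : ℕ => (topTwist b k U (site2 t m, 0))⁻¹).prod =
      k (site2 ((b : ℤ) + 1) m) * ((List.range (b + 1)).reverse.map fun t : ℕ => (U (site2 t m, 0))⁻¹).prod := by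
    rw [List.range_succ, List.reverse_append, List.reverse_singleton, List.singleton_append, List.map_cons,
      List.map_cons, List.prod_cons, List.prod_cons, hrest, topTwist_site2_height, mul_inv_rev, inv_inv, mul_assoc]
  have hbot : ((List.range m).reverse.map fun s : ℕ => (topTwist b k U (site2 0 s, 1))⁻¹) =
      (List.range m).reverse.map fun s : ℕ => (U (site2 0 s, 1))⁻¹ := by
    simp only [topTwist_site2_of_ne k U hb0]
  rw [staple_eq_topRun_mul, staple_eq_topRun_mul, htop, hdown, hbot, topTwist_site2_of_ne k U hb0]
  group

omit [TopologicalSpace G] [IsTopologicalGroup G] [CompactSpace G] [SecondCountableTopology G] [MeasurableSpace G]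
  [BorelSpace G] in
/-- **ROUTE B IDENTITY (PROVED, every `σ`, `U`, no flatness).**  The `σ`-adapted charged holonomy is the PHYSICAL
rectangle holonomy of the glued configuration `U ∨ σ'` in the comb-twisted world, times a conjugate of `k₀⁻¹`:
`col U · staple σ = (col U · staple σ') · g k₀⁻¹ g⁻¹`, `σ' = topTwist_b(comb_b k₀ σ) σ`. -/
theorem col_mul_staple_eq_twisted {b : ℕ} (hb : 1 ≤ b) (R m : ℕ) (k₀ : G) (σ U : LGConfig 4 G) :
    ∃ g : G, col b U * staple b m σ =
      col b U * staple b m (topTwist b (comb b R k₀ σ) σ) * (g * k₀⁻¹ * g⁻¹) := by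
  refine ⟨(staple b m (topTwist b (comb b R k₀ σ) σ))⁻¹ * topRun b m σ *
    (stair b R σ (site2 ((b : ℤ) + 1) m))⁻¹, ?_⟩
  rw [staple_topTwist hb m (comb b R k₀ σ) σ]
  simp only [comb]
  group

omit [TopologicalSpace G] [IsTopologicalGroup G] [CompactSpace G] [SecondCountableTopology G] [MeasurableSpace G]
  [BorelSpace G] in
/-- **Pointwise consequence (PROVED):** `clip r (Re g_σ(U)) ≤ −1 + C_r ‖ρ(col U · staple σ') − 1‖_F`. -/
theorem clip_chargedTest_re_le (hρu : ∀ g, ρ g ∈ Matrix.unitaryGroup (Fin N) ℂ) (hN : 1 ≤ N) {k₀ : G}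
    (hr : (ρ k₀).trace.re / N < 1) {b : ℕ} (hb : 1 ≤ b) (R m : ℕ) (σ U : LGConfig 4 G) :
    clip ((ρ k₀).trace.re / N) (chargedTest ρ b m σ U).re ≤
      -1 + 2 / ((1 - (ρ k₀).trace.re / N) * Real.sqrt N) *
        ‖ρ (col b U * staple b m (topTwist b (comb b R k₀ σ) σ)) - 1‖ := by
  obtain ⟨g, hg⟩ := col_mul_staple_eq_twisted hb R m k₀ σ U
  have hre : (chargedTest ρ b m σ U).re =
      (ρ (col b U * staple b m (topTwist b (comb b R k₀ σ) σ) * (g * k₀⁻¹ * g⁻¹))).trace.re / N := by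
    rw [chargedTest, hg, Complex.div_natCast_re]
  rw [hre]
  exact clip_re_trace_twisted_le ρ hρu hN hr _ g

/-- The kernel-mean of the PHYSICAL rectangle defect in the comb-twisted world (the quantity Route B reduces F_poly to). -/
def twistDefect (β : ℝ) (b n : ℕ) (k₀ : G) (V : GaugeConfig 4 (2 * ((2 * n + 2) * b + 1) + 1) G) : ℝ :=
  ∫ U, ‖ρ (col b U * staple b ((2 * n + 1) * b)
      (twistΦ b (comb b ((2 * n + 2) * b + 1) k₀) (torusLift (2 * ((2 * n + 2) * b + 1) + 1) V))) - 1‖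
    ∂(ymSpecification ρ β (rowRegion b n)
        (twistΦ b (comb b ((2 * n + 2) * b + 1) k₀) (torusLift (2 * ((2 * n + 2) * b + 1) + 1) V)))

/-- **The twisted mean is controlled by the twist defect (PROVED):**
`twistedMeanObs(V) ≤ −1 + C_r · twistDefect(V)`, `C_r = 2/((1−r)√N)`, for EVERY torus sample `V`. -/
theorem twistedMeanObs_clip_le (hρ : Continuous ρ) (hρu : ∀ g, ρ g ∈ Matrix.unitaryGroup (Fin N) ℂ) (hN : 1 ≤ N)
    {k₀ : G} (hr : (ρ k₀).trace.re / N < 1) {b : ℕ} (hb : 1 ≤ b) (n : ℕ) (β : ℝ)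
    (V : GaugeConfig 4 (2 * ((2 * n + 2) * b + 1) + 1) G) :
    twistedMeanObs ρ β b n (comb b ((2 * n + 2) * b + 1) k₀) (clip ((ρ k₀).trace.re / N)) V ≤
      -1 + 2 / ((1 - (ρ k₀).trace.re / N) * Real.sqrt N) * twistDefect ρ β b n k₀ V := by
  unfold twistedMeanObs twistDefect
  set m : ℕ := (2 * n + 1) * b with hm
  set σ : LGConfig 4 G := torusLift (2 * ((2 * n + 2) * b + 1) + 1) V with hσ
  set σ' : LGConfig 4 G := twistΦ b (comb b ((2 * n + 2) * b + 1) k₀) σ with hσ'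
  set γ := ymSpecification ρ β (rowRegion b n) σ' with hγ
  set C : ℝ := 2 / ((1 - (ρ k₀).trace.re / N) * Real.sqrt N) with hC
  haveI : IsProbabilityMeasure γ := isProbabilityMeasure_ymSpecification ρ hρ β _ _
  have hint1 : Integrable (fun U => clip ((ρ k₀).trace.re / N) (chargedTest ρ b m σ U).re) γ :=
    integrable_of_continuous γ
      ((continuous_clip _).comp (Complex.continuous_re.comp (continuous_chargedTest ρ hρ _ _ σ)))
  have hcontD : Continuous fun U : LGConfig 4 G => ‖ρ (col b U * staple b m σ') - 1‖ :=
    ((hρ.comp ((continuous_col b).mul continuous_const)).sub continuous_const).norm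
  have hintD : Integrable (fun U : LGConfig 4 G => ‖ρ (col b U * staple b m σ') - 1‖) γ :=
    integrable_of_continuous γ hcontD
  have hint2 : Integrable (fun U : LGConfig 4 G => -1 + C * ‖ρ (col b U * staple b m σ') - 1‖) γ :=
    (integrable_const _).add (hintD.const_mul C)
  have hpt : ∀ U : LGConfig 4 G,
      clip ((ρ k₀).trace.re / N) (chargedTest ρ b m σ U).re ≤ -1 + C * ‖ρ (col b U * staple b m σ') - 1‖ :=
    fun U => clip_chargedTest_re_le ρ hρu hN hr hb ((2 * n + 2) * b + 1) m σ U
  calc ∫ U, clip ((ρ k₀).trace.re / N) (chargedTest ρ b m σ U).re ∂γ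
      ≤ ∫ U, (-1 + C * ‖ρ (col b U * staple b m σ') - 1‖) ∂γ := integral_mono hint1 hint2 hpt
    _ = -1 + C * ∫ U, ‖ρ (col b U * staple b m σ') - 1‖ ∂γ := by
        rw [integral_add (integrable_const _) (hintD.const_mul C), integral_const, integral_const_mul, smul_eq_mul]
        simp

/-- **INPUT K_poly — the twist-defect tail along the regime** (what Route B reduces F_poly to): for every `η > 0` there
are `c > 0`, `β₀` with `μ_{L_b,β}{V | η < twistDefect(V)} ≤ η` for all `(β, b)` in `polyRegime θ c β₀`. -/
def KernelDefectPoly (n : ℕ) (k₀ : G) (θ : ℝ) : Prop :=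
  ∀ η : ℝ, 0 < η → ∃ c : ℝ, 0 < c ∧ ∃ β₀ : ℝ, polyRegime θ c β₀ fun β b =>
    (wilsonMeasure (d := 4) (L := 2 * ((2 * n + 2) * b + 1) + 1) ρ β)
        {V | η < twistDefect ρ β b n k₀ V} ≤ ENNReal.ofReal η

/-- **F_poly from K_poly (PROVED):** by `twistedMeanObs_clip_le` and set inclusion,
`{−1 + η < twistedMeanObs} ⊆ {min η (η/C_r) < twistDefect}`. -/
theorem frameValuePoly_of_kernelDefectPoly (hρ : Continuous ρ) (hρu : ∀ g, ρ g ∈ Matrix.unitaryGroup (Fin N) ℂ)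
    (hN : 1 ≤ N) {k₀ : G} (hr : (ρ k₀).trace.re / N < 1) {n : ℕ} {θ : ℝ}
    (h : KernelDefectPoly ρ n k₀ θ) : FrameValuePoly ρ n k₀ θ := by
  intro η hη
  have hN0 : (0 : ℝ) < N := by exact_mod_cast hN
  have h1r : 0 < 1 - (ρ k₀).trace.re / N := by linarith
  set C : ℝ := 2 / ((1 - (ρ k₀).trace.re / N) * Real.sqrt N) with hC
  have hCpos : 0 < C := div_pos two_pos (mul_pos h1r (Real.sqrt_pos.2 hN0))
  set η₁ : ℝ := min η (η / C) with hη₁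
  have hη₁pos : 0 < η₁ := lt_min hη (div_pos hη hCpos)
  obtain ⟨c, hc, β₀, hreg⟩ := h η₁ hη₁pos
  refine ⟨c, hc, β₀, fun β hβ b hb hbc => ?_⟩
  have hK := hreg β hβ b hb hbc
  refine le_trans (measure_mono fun V hV => ?_) (hK.trans (ENNReal.ofReal_le_ofReal (min_le_left _ _)))
  simp only [Set.mem_setOf_eq] at hV ⊢
  have hle := twistedMeanObs_clip_le ρ hρ hρu hN hr hb n β V
  have h1 : η < C * twistDefect ρ β b n k₀ V := by linarith
  have h2 : η / C < twistDefect ρ β b n k₀ V := by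
    rw [div_lt_iff₀ hCpos]; linarith
  exact lt_of_le_of_lt (min_le_right _ _) h2

end RouteB

/-! ## §4e (PROVED) K_poly from an in-mean bound + measurability (Markov and the regime arithmetic) -/

section Markov

open scoped Matrix Matrix.Norms.Frobenius
open Literature.MathematicalPhysics.QuantumFieldTheory (wilsonMeasure GaugeConfig isProbabilityMeasure_wilsonMeasure)
open Summit.QuantumFields.YangMills.Theorems.TunedSequenceExists.Negative.Freezing (re_trace_le_of_mem_unitaryGroup)

variable {G : Type} [Group G] [TopologicalSpace G] [IsTopologicalGroup G] [CompactSpace G]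
  [SecondCountableTopology G] [MeasurableSpace G] [BorelSpace G]
  {N : ℕ} (ρ : G →* Matrix (Fin N) (Fin N) ℂ)

omit [TopologicalSpace G] [IsTopologicalGroup G] [CompactSpace G] [SecondCountableTopology G] [MeasurableSpace G]
  [BorelSpace G] in
/-- `‖ρ g − 1‖_F ≤ 2√N` for unitary `ρ`. -/
theorem norm_map_sub_one_le (hρu : ∀ g, ρ g ∈ Matrix.unitaryGroup (Fin N) ℂ) (g : G) :
    ‖ρ g - 1‖ ≤ 2 * Real.sqrt N := by
  have hneg : -(ρ g) ∈ Matrix.unitaryGroup (Fin N) ℂ := by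
    have h := SetLike.coe_mem (-(⟨ρ g, hρu g⟩ : Matrix.unitaryGroup (Fin N) ℂ))
    rw [Unitary.coe_neg] at h
    exact h
  have h2 : -(ρ g).trace.re ≤ N := by
    have := re_trace_le_of_mem_unitaryGroup hneg
    simpa [Matrix.trace_neg] using this
  have h1 := sub_re_trace_eq_norm_sq ρ hρu g
  have h3 : ‖ρ g - 1‖ ^ 2 ≤ (2 * Real.sqrt N) ^ 2 := by
    rw [mul_pow, Real.sq_sqrt (Nat.cast_nonneg _)]
    nlinarith
  calc ‖ρ g - 1‖ = Real.sqrt (‖ρ g - 1‖ ^ 2) := (Real.sqrt_sq (norm_nonneg _)).symm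
    _ ≤ Real.sqrt ((2 * Real.sqrt N) ^ 2) := Real.sqrt_le_sqrt h3
    _ = 2 * Real.sqrt N := Real.sqrt_sq (by positivity)

omit [SecondCountableTopology G] in
theorem twistDefect_nonneg (β : ℝ) (b n : ℕ) (k₀ : G) (V : GaugeConfig 4 (2 * ((2 * n + 2) * b + 1) + 1) G) :
    0 ≤ twistDefect ρ β b n k₀ V :=
  integral_nonneg fun _ => norm_nonneg _

theorem twistDefect_le (hρ : Continuous ρ) (hρu : ∀ g, ρ g ∈ Matrix.unitaryGroup (Fin N) ℂ) (β : ℝ) (b n : ℕ)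
    (k₀ : G) (V : GaugeConfig 4 (2 * ((2 * n + 2) * b + 1) + 1) G) :
    twistDefect ρ β b n k₀ V ≤ 2 * Real.sqrt N := by
  unfold twistDefect
  haveI := isProbabilityMeasure_ymSpecification ρ hρ β (rowRegion b n)
    (twistΦ b (comb b ((2 * n + 2) * b + 1) k₀) (torusLift (2 * ((2 * n + 2) * b + 1) + 1) V))
  refine (integral_mono_of_nonneg (ae_of_all _ fun _ => norm_nonneg _) (integrable_const (2 * Real.sqrt N))
    (ae_of_all _ fun U => norm_map_sub_one_le ρ hρu _)).trans ?_
  simp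

/-- **K_poly from an in-mean bound (PROVED): Markov + the regime arithmetic.**  If `V ↦ twistDefect V` is measurable
and `E_{L_b,β} twistDefect ≤ C b^{7/2} √(log β / β)` for `β ≥ β₁`, `b ≥ 1`, then `KernelDefectPoly ρ n k₀ (1/7)` with
`c(η) = (η²/C)^{2/7}`, `β₀ = max β₁ 3`. -/
theorem kernelDefectPoly_of_mean (hρ : Continuous ρ) (hρu : ∀ g, ρ g ∈ Matrix.unitaryGroup (Fin N) ℂ) {n : ℕ}
    {k₀ : G} (hmeas : ∀ (β : ℝ) (b : ℕ), Measurable (twistDefect ρ β b n k₀))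
    (hmean : ∃ C : ℝ, 0 < C ∧ ∃ β₁ : ℝ, ∀ β : ℝ, β₁ ≤ β → ∀ b : ℕ, 1 ≤ b →
      ∫ V, twistDefect ρ β b n k₀ V ∂(wilsonMeasure (d := 4) (L := 2 * ((2 * n + 2) * b + 1) + 1) ρ β) ≤
        C * (b : ℝ) ^ (7 / 2 : ℝ) * Real.sqrt (Real.log β / β)) :
    KernelDefectPoly ρ n k₀ (1 / 7) := by
  intro η hη
  obtain ⟨C, hC, β₁, hmean⟩ := hmean
  have hq0 : 0 ≤ η ^ 2 / C := div_nonneg (sq_nonneg _) hC.le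
  refine ⟨(η ^ 2 / C) ^ (2 / 7 : ℝ), Real.rpow_pos_of_pos (div_pos (pow_pos hη 2) hC) _, max β₁ 3,
    fun β hβ b hb hbc => ?_⟩
  set c : ℝ := (η ^ 2 / C) ^ (2 / 7 : ℝ) with hc
  set μ := wilsonMeasure (d := 4) (L := 2 * ((2 * n + 2) * b + 1) + 1) ρ β with hμ
  haveI : IsProbabilityMeasure μ := isProbabilityMeasure_wilsonMeasure ρ hρ β
  have hβ1 : β₁ ≤ β := (le_max_left _ _).trans hβ
  have hβ3 : (3 : ℝ) ≤ β := (le_max_right _ _).trans hβ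
  have hβ0 : (0 : ℝ) < β := by linarith
  have hlog : 0 < Real.log β := Real.log_pos (by linarith)
  have hX0 : 0 ≤ β / Real.log β := by positivity
  have hc0 : 0 ≤ c := Real.rpow_nonneg hq0 _
  -- the regime arithmetic: `C b^{7/2} √(log β/β) ≤ η²`
  have h1 : (b : ℝ) ^ (7 / 2 : ℝ) ≤ (c * (β / Real.log β) ^ (1 / 7 : ℝ)) ^ (7 / 2 : ℝ) :=
    Real.rpow_le_rpow (Nat.cast_nonneg _) hbc (by norm_num)
  have h2 : (c * (β / Real.log β) ^ (1 / 7 : ℝ)) ^ (7 / 2 : ℝ) =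
      c ^ (7 / 2 : ℝ) * Real.sqrt (β / Real.log β) := by
    rw [Real.mul_rpow hc0 (Real.rpow_nonneg hX0 _), ← Real.rpow_mul hX0, Real.sqrt_eq_rpow]
    norm_num
  have h3 : c ^ (7 / 2 : ℝ) = η ^ 2 / C := by
    rw [hc, ← Real.rpow_mul hq0]
    norm_num
  have h4 : Real.sqrt (β / Real.log β) * Real.sqrt (Real.log β / β) = 1 := by
    rw [← Real.sqrt_mul hX0, show β / Real.log β * (Real.log β / β) = 1 by field_simp, Real.sqrt_one]
  have key : C * (b : ℝ) ^ (7 / 2 : ℝ) * Real.sqrt (Real.log β / β) ≤ η ^ 2 := by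
    have hs0 : 0 ≤ Real.sqrt (Real.log β / β) := Real.sqrt_nonneg _
    calc C * (b : ℝ) ^ (7 / 2 : ℝ) * Real.sqrt (Real.log β / β)
        ≤ C * (c ^ (7 / 2 : ℝ) * Real.sqrt (β / Real.log β)) * Real.sqrt (Real.log β / β) := by
          rw [← h2]; gcongr
      _ = C * c ^ (7 / 2 : ℝ) * (Real.sqrt (β / Real.log β) * Real.sqrt (Real.log β / β)) := by ring
      _ = η ^ 2 := by rw [h4, h3, mul_one]; field_simp
  -- Markov
  have hint : Integrable (twistDefect ρ β b n k₀) μ :=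
    Integrable.of_bound (hmeas β b).aestronglyMeasurable (2 * Real.sqrt N) (ae_of_all _ fun V => by
      rw [Real.norm_eq_abs, abs_of_nonneg (twistDefect_nonneg ρ β b n k₀ V)]
      exact twistDefect_le ρ hρ hρu β b n k₀ V)
  have hmarkov := mul_meas_ge_le_integral_of_nonneg (ae_of_all _ fun V => twistDefect_nonneg ρ β b n k₀ V) hint η
  have hm := hmean β hβ1 b hb
  have hreal : μ.real {V | η < twistDefect ρ β b n k₀ V} ≤ η := by
    have hsub : {V | η < twistDefect ρ β b n k₀ V} ⊆ {V | η ≤ twistDefect ρ β b n k₀ V} := fun V hV => by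
      simp only [Set.mem_setOf_eq] at hV ⊢
      exact hV.le
    refine (measureReal_mono hsub).trans ?_
    have hle : η * μ.real {V | η ≤ twistDefect ρ β b n k₀ V} ≤ η ^ 2 := hmarkov.trans (hm.trans key)
    by_contra hcon
    push Not at hcon
    nlinarith [hη, hcon, hle]
  calc μ {V | η < twistDefect ρ β b n k₀ V} = ENNReal.ofReal (μ.real {V | η < twistDefect ρ β b n k₀ V}) :=
        (ofReal_measureReal (measure_ne_top μ _)).symm
    _ ≤ ENNReal.ofReal η := ENNReal.ofReal_le_ofReal hreal

end Markov

/-! ## §4f (PROVED) K0: the twist defect is continuous in the torus sample -/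

section K0

open scoped Matrix Matrix.Norms.Frobenius
open Literature.MathematicalPhysics.QuantumFieldTheory (wilsonMeasure GaugeConfig isProbabilityMeasure_wilsonMeasure)

variable {G : Type} [Group G] [TopologicalSpace G] [IsTopologicalGroup G] [CompactSpace G]
  [SecondCountableTopology G] [MeasurableSpace G] [BorelSpace G]
  {N : ℕ} (ρ : G →* Matrix (Fin N) (Fin N) ℂ)

/-- Under the kernel `γ_Λ(·|η)`, `Λ = rowRegion b n`, the staple of the boundary condition equals the staple of the
sample (the staple reads only links OFF the row, `FixedMesh.staple_eq_of_eq_off_row`). -/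
theorem integral_kernel_staple_boundary (hρ : Continuous ρ) (β : ℝ) {b n m : ℕ}
    (hm : (m : ℤ) = (2 * (n : ℤ) + 1) * b) (η : LGConfig 4 G) :
    ∫ U, ‖ρ (col b U * staple b m η) - 1‖ ∂(ymSpecification ρ β (rowRegion b n) η) =
      ∫ U, ‖ρ (col b U * staple b m U) - 1‖ ∂(ymSpecification ρ β (rowRegion b n) η) := by
  have hF1 : Continuous fun U : LGConfig 4 G => ‖ρ (col b U * staple b m η) - 1‖ :=
    ((hρ.comp ((continuous_col b).mul continuous_const)).sub continuous_const).norm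
  have hF2 : Continuous fun U : LGConfig 4 G => ‖ρ (col b U * staple b m U) - 1‖ :=
    ((hρ.comp ((continuous_col b).mul (continuous_staple b _))).sub continuous_const).norm
  rw [integral_ymSpecification ρ hρ β (rowRegion b n) hF1.measurable,
    integral_ymSpecification ρ hρ β (rowRegion b n) hF2.measurable]
  refine congrArg (· / _) (integral_congr_ae (ae_of_all _ fun ζ => ?_))
  have hst : staple b m (glueWith (rowRegion b n) ζ η) = staple b m η :=
    staple_eq_of_eq_off_row hm fun e he => glueWith_apply_not_mem (rowRegion b n) ζ η he
  simp only [hst]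

/-- `twistDefect` is the kernel mean of the FIXED continuous integrand `U ↦ ‖ρ(col U · staple U) − 1‖_F`. -/
theorem twistDefect_eq_integral_self (hρ : Continuous ρ) (β : ℝ) (b n : ℕ) (k₀ : G)
    (V : GaugeConfig 4 (2 * ((2 * n + 2) * b + 1) + 1) G) :
    twistDefect ρ β b n k₀ V =
      ∫ U, ‖ρ (col b U * staple b ((2 * n + 1) * b) U) - 1‖
        ∂(ymSpecification ρ β (rowRegion b n)
          (twistΦ b (comb b ((2 * n + 2) * b + 1) k₀) (torusLift (2 * ((2 * n + 2) * b + 1) + 1) V))) := by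
  have hm : (((2 * n + 1) * b : ℕ) : ℤ) = (2 * (n : ℤ) + 1) * b := by push_cast; ring
  exact integral_kernel_staple_boundary ρ hρ β hm _

/-- **K0 (PROVED): `V ↦ twistDefect V` is continuous**, as the composite of the continuous boundary map
`V ↦ topTwist(comb)(torusLift V)` (`FixedMeshAllG.continuous_twist_comb`, `continuous_torusLift`) with the kernel mean of a
fixed bounded continuous integrand (`continuous_integral_ymSpecification`), by `twistDefect_eq_integral_self`. -/
theorem continuous_twistDefect (hρ : Continuous ρ) (hρu : ∀ g, ρ g ∈ Matrix.unitaryGroup (Fin N) ℂ) (β : ℝ)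
    (b n : ℕ) (k₀ : G) : Continuous (twistDefect ρ β b n k₀) := by
  have hF2 : Continuous fun U : LGConfig 4 G => ‖ρ (col b U * staple b ((2 * n + 1) * b) U) - 1‖ :=
    ((hρ.comp ((continuous_col b).mul (continuous_staple b _))).sub continuous_const).norm
  have hker := continuous_integral_ymSpecification ρ hρ β (rowRegion b n) hF2 (C := 2 * Real.sqrt N)
    (fun U => by rw [abs_of_nonneg (norm_nonneg _)]; exact norm_map_sub_one_le ρ hρu _)
  have hbd : Continuous fun V : GaugeConfig 4 (2 * ((2 * n + 2) * b + 1) + 1) G =>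
      twistΦ b (comb b ((2 * n + 2) * b + 1) k₀) (torusLift (2 * ((2 * n + 2) * b + 1) + 1) V) :=
    (continuous_twist_comb b _ k₀).comp (continuous_torusLift _)
  have h := hker.comp hbd
  refine h.congr fun V => ?_
  simp only [Function.comp]
  exact (twistDefect_eq_integral_self ρ hρ β b n k₀ V).symm

/-- **K0 (PROVED): measurability of the twist defect.** -/
theorem measurable_twistDefect (hρ : Continuous ρ) (hρu : ∀ g, ρ g ∈ Matrix.unitaryGroup (Fin N) ℂ) (β : ℝ)
    (b n : ℕ) (k₀ : G) : Measurable (twistDefect ρ β b n k₀) :=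
  (continuous_twistDefect ρ hρ hρu β b n k₀).measurable

end K0

/-! ## §4g (PROVED) Stokes under the kernel: K1 reduces to the kernel mean of the film's PLAQUETTE defects -/

section PlaqDefect

open scoped Matrix Matrix.Norms.Frobenius
open Literature.MathematicalPhysics.QuantumFieldTheory (wilsonMeasure GaugeConfig isProbabilityMeasure_wilsonMeasure)
open Summit.QuantumFields.YangMills.Theorems.TunedSequenceExists.Negative.Freezing (integrable_of_continuous)

variable {G : Type} [Group G] [TopologicalSpace G] [IsTopologicalGroup G] [CompactSpace G]
  [SecondCountableTopology G] [MeasurableSpace G] [BorelSpace G]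
  {N : ℕ} (ρ : G →* Matrix (Fin N) (Fin N) ℂ)

/-- The total Frobenius plaquette defect `Σ_{p∈Σ} ‖ρ(U_p) − 1‖_F` of the spanning surface `Σ = [0,b] × [0,m)` of the
row loop (`#Σ = (b+1)·m`). -/
def plaqDefectSum (b m : ℕ) (U : LGConfig 4 G) : ℝ :=
  ∑ s ∈ Finset.range m, ∑ t ∈ Finset.range (b + 1), ‖ρ (plaq U t s) - 1‖

omit [CompactSpace G] [SecondCountableTopology G] [MeasurableSpace G] [BorelSpace G] in
theorem continuous_plaq (t s : ℤ) : Continuous fun U : LGConfig 4 G => plaq U t s := by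
  unfold plaq plaquetteHolonomyZd
  have h : ∀ e : ZdEdge 4, Continuous fun U : LGConfig 4 G => U e := fun e => continuous_apply e
  exact (((h _).mul (h _)).mul (h _).inv).mul (h _).inv

omit [CompactSpace G] [SecondCountableTopology G] [MeasurableSpace G] [BorelSpace G] in
theorem continuous_plaqDefectSum (hρ : Continuous ρ) (b m : ℕ) : Continuous (plaqDefectSum ρ b m) := by
  unfold plaqDefectSum
  exact continuous_finsetSum _ fun s _ => continuous_finsetSum _ fun t _ =>
    ((hρ.comp (continuous_plaq _ _)).sub continuous_const).norm

omit [TopologicalSpace G] [IsTopologicalGroup G] [CompactSpace G] [SecondCountableTopology G] [MeasurableSpace G]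
  [BorelSpace G] in
theorem plaqDefectSum_nonneg (b m : ℕ) (U : LGConfig 4 G) : 0 ≤ plaqDefectSum ρ b m U :=
  Finset.sum_nonneg fun _ _ => Finset.sum_nonneg fun _ _ => norm_nonneg _

omit [TopologicalSpace G] [IsTopologicalGroup G] [CompactSpace G] [SecondCountableTopology G] [MeasurableSpace G]
  [BorelSpace G] in
theorem plaqDefectSum_le (hρu : ∀ g, ρ g ∈ Matrix.unitaryGroup (Fin N) ℂ) (b m : ℕ) (U : LGConfig 4 G) :
    plaqDefectSum ρ b m U ≤ m * ((b + 1) * (2 * Real.sqrt N)) := by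
  unfold plaqDefectSum
  have h1 : ∀ s ∈ Finset.range m, ∑ t ∈ Finset.range (b + 1), ‖ρ (plaq U t s) - 1‖ ≤ (b + 1) * (2 * Real.sqrt N) := by
    intro s _
    have h := Finset.sum_le_card_nsmul (Finset.range (b + 1)) (fun t => ‖ρ (plaq U (t : ℤ) s) - 1‖)
      (2 * Real.sqrt N) fun t _ => norm_map_sub_one_le ρ hρu _
    simpa [Finset.card_range, nsmul_eq_mul] using h
  have h2 := Finset.sum_le_card_nsmul (Finset.range m)
    (fun s => ∑ t ∈ Finset.range (b + 1), ‖ρ (plaq U t s) - 1‖) ((b + 1) * (2 * Real.sqrt N)) h1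
  simpa [Finset.card_range, nsmul_eq_mul] using h2

omit [TopologicalSpace G] [IsTopologicalGroup G] [CompactSpace G] [SecondCountableTopology G] [MeasurableSpace G]
  [BorelSpace G] in
/-- **Deterministic Stokes for the defect (PROVED):** `‖ρ(col U · staple U) − 1‖_F ≤ Σ_{p∈Σ} ‖ρ(U_p) − 1‖_F`. -/
theorem norm_col_mul_staple_sub_one_le (hρu : ∀ g, ρ g ∈ Matrix.unitaryGroup (Fin N) ℂ) {b : ℕ} (hb : 1 ≤ b)
    (m : ℕ) (U : LGConfig 4 G) : ‖ρ (col b U * staple b m U) - 1‖ ≤ plaqDefectSum ρ b m U := by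
  have hconj : ‖ρ (col b U * staple b m U) - 1‖ = ‖ρ (rectHol U (b + 1) m) - 1‖ := by
    rw [col_mul_staple_eq_conj_rectHol hb m U]
    have := norm_map_conj_sub_one ρ hρu (U (site2 0 0, 0))⁻¹ (rectHol U (b + 1) m)
    rwa [inv_inv] at this
  rw [hconj]
  exact norm_rectHol_sub_one_le ρ hρu U (b + 1) m

/-- The kernel mean of the film's plaquette defect with the twisted boundary: `E_{γ_Λ(·|σ')} Σ_{p∈Σ} ‖ρ(U_p) − 1‖_F`,
`σ' = topTwist(comb)(torusLift V)`. -/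
def kernelPlaqDefect (β : ℝ) (b n : ℕ) (k₀ : G) (V : GaugeConfig 4 (2 * ((2 * n + 2) * b + 1) + 1) G) : ℝ :=
  ∫ U, plaqDefectSum ρ b ((2 * n + 1) * b) U
    ∂(ymSpecification ρ β (rowRegion b n)
      (twistΦ b (comb b ((2 * n + 2) * b + 1) k₀) (torusLift (2 * ((2 * n + 2) * b + 1) + 1) V)))

omit [SecondCountableTopology G] in
theorem kernelPlaqDefect_nonneg (β : ℝ) (b n : ℕ) (k₀ : G) (V : GaugeConfig 4 (2 * ((2 * n + 2) * b + 1) + 1) G) :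
    0 ≤ kernelPlaqDefect ρ β b n k₀ V :=
  integral_nonneg fun U => plaqDefectSum_nonneg ρ _ _ U

/-- **K1 ⇐ K1′ pointwise (PROVED): `twistDefect ≤ kernelPlaqDefect`** (Stokes under the kernel). -/
theorem twistDefect_le_kernelPlaqDefect (hρ : Continuous ρ) (hρu : ∀ g, ρ g ∈ Matrix.unitaryGroup (Fin N) ℂ)
    (β : ℝ) {b : ℕ} (hb : 1 ≤ b) (n : ℕ) (k₀ : G) (V : GaugeConfig 4 (2 * ((2 * n + 2) * b + 1) + 1) G) :
    twistDefect ρ β b n k₀ V ≤ kernelPlaqDefect ρ β b n k₀ V := by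
  rw [twistDefect_eq_integral_self ρ hρ β b n k₀ V]
  unfold kernelPlaqDefect
  set γ := ymSpecification ρ β (rowRegion b n)
    (twistΦ b (comb b ((2 * n + 2) * b + 1) k₀) (torusLift (2 * ((2 * n + 2) * b + 1) + 1) V)) with hγ
  haveI : IsProbabilityMeasure γ := isProbabilityMeasure_ymSpecification ρ hρ β _ _
  have hF2 : Continuous fun U : LGConfig 4 G => ‖ρ (col b U * staple b ((2 * n + 1) * b) U) - 1‖ :=
    ((hρ.comp ((continuous_col b).mul (continuous_staple b _))).sub continuous_const).norm
  exact integral_mono (integrable_of_continuous γ hF2) (integrable_of_continuous γ (continuous_plaqDefectSum ρ hρ _ _))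
    fun U => norm_col_mul_staple_sub_one_le ρ hρu hb _ U

/-- `V ↦ kernelPlaqDefect V` is continuous (same argument as `continuous_twistDefect`). -/
theorem continuous_kernelPlaqDefect (hρ : Continuous ρ) (hρu : ∀ g, ρ g ∈ Matrix.unitaryGroup (Fin N) ℂ) (β : ℝ)
    (b n : ℕ) (k₀ : G) : Continuous (kernelPlaqDefect ρ β b n k₀) := by
  have hker := continuous_integral_ymSpecification ρ hρ β (rowRegion b n)
    (continuous_plaqDefectSum ρ hρ b ((2 * n + 1) * b))
    (C := ((2 * n + 1) * b : ℕ) * ((b + 1) * (2 * Real.sqrt N)))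
    (fun U => by rw [abs_of_nonneg (plaqDefectSum_nonneg ρ _ _ U)]; exact plaqDefectSum_le ρ hρu _ _ U)
  have hbd : Continuous fun V : GaugeConfig 4 (2 * ((2 * n + 2) * b + 1) + 1) G =>
      twistΦ b (comb b ((2 * n + 2) * b + 1) k₀) (torusLift (2 * ((2 * n + 2) * b + 1) + 1) V) :=
    (continuous_twist_comb b _ k₀).comp (continuous_torusLift _)
  exact hker.comp hbd

/-- **K1 ⇐ K1′ in mean (PROVED).** -/
theorem integral_twistDefect_le_of_kernelPlaqDefect (hρ : Continuous ρ)
    (hρu : ∀ g, ρ g ∈ Matrix.unitaryGroup (Fin N) ℂ) {n : ℕ} {k₀ : G}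
    (h : ∃ C : ℝ, 0 < C ∧ ∃ β₁ : ℝ, ∀ β : ℝ, β₁ ≤ β → ∀ b : ℕ, 1 ≤ b →
      ∫ V, kernelPlaqDefect ρ β b n k₀ V ∂(wilsonMeasure (d := 4) (L := 2 * ((2 * n + 2) * b + 1) + 1) ρ β) ≤
        C * (b : ℝ) ^ (7 / 2 : ℝ) * Real.sqrt (Real.log β / β)) :
    ∃ C : ℝ, 0 < C ∧ ∃ β₁ : ℝ, ∀ β : ℝ, β₁ ≤ β → ∀ b : ℕ, 1 ≤ b →
      ∫ V, twistDefect ρ β b n k₀ V ∂(wilsonMeasure (d := 4) (L := 2 * ((2 * n + 2) * b + 1) + 1) ρ β) ≤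
        C * (b : ℝ) ^ (7 / 2 : ℝ) * Real.sqrt (Real.log β / β) := by
  obtain ⟨C, hC, β₁, h⟩ := h
  refine ⟨C, hC, β₁, fun β hβ b hb => ?_⟩
  set μ := wilsonMeasure (d := 4) (L := 2 * ((2 * n + 2) * b + 1) + 1) ρ β with hμ
  haveI : IsProbabilityMeasure μ := isProbabilityMeasure_wilsonMeasure ρ hρ β
  refine (integral_mono (integrable_of_continuous μ (continuous_twistDefect ρ hρ hρu β b n k₀))
    (integrable_of_continuous μ (continuous_kernelPlaqDefect ρ hρ hρu β b n k₀))
    fun V => twistDefect_le_kernelPlaqDefect ρ hρ hρu β hb n k₀ V).trans (h β hβ b hb)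

end PlaqDefect

/-! ## §4h (PROVED) Cauchy–Schwarz + Jensen: K1′ reduces to the kernel mean of the film's plaquette ENERGY (K1″, linear in plaquettes) -/

section PlaqEnergy

open scoped Matrix Matrix.Norms.Frobenius
open Literature.MathematicalPhysics.QuantumFieldTheory (wilsonMeasure GaugeConfig isProbabilityMeasure_wilsonMeasure)
open Summit.QuantumFields.YangMills.Theorems.TunedSequenceExists.Negative.Freezing (integrable_of_continuous)

/-- **Jensen for the square root (PROVED by AM–GM, no concavity API):** on a probability space, for `f ≥ 0` integrable,
`∫ √f ≤ √(∫ f)` (for every `t > 0`, `√f ≤ f/(2t) + t/2`; integrate; optimise `t = √(∫ f)`). -/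
theorem integral_sqrt_le_sqrt_integral {X : Type*} [MeasurableSpace X] (μ : Measure X) [IsProbabilityMeasure μ]
    {f : X → ℝ} (hf : ∀ x, 0 ≤ f x) (hfi : Integrable f μ) :
    ∫ x, Real.sqrt (f x) ∂μ ≤ Real.sqrt (∫ x, f x ∂μ) := by
  set I := ∫ x, f x ∂μ with hI
  have hamgm : ∀ t : ℝ, 0 < t → ∫ x, Real.sqrt (f x) ∂μ ≤ I / (2 * t) + t / 2 := by
    intro t ht
    have ht0 : t ≠ 0 := ht.ne'
    have hpt : ∀ x, Real.sqrt (f x) ≤ f x / (2 * t) + t / 2 := by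
      intro x
      obtain ⟨s, hs0, hfx⟩ : ∃ s : ℝ, 0 ≤ s ∧ f x = s ^ 2 :=
        ⟨Real.sqrt (f x), Real.sqrt_nonneg _, (Real.sq_sqrt (hf x)).symm⟩
      rw [hfx, Real.sqrt_sq hs0]
      have hid : s ^ 2 / (2 * t) + t / 2 = s + (s - t) ^ 2 / (2 * t) := by
        field_simp
        ring
      rw [hid]
      exact le_add_of_nonneg_right (div_nonneg (sq_nonneg _) (by positivity))
    have hint2 : Integrable (fun x => f x / (2 * t) + t / 2) μ := (hfi.div_const _).add (integrable_const _)
    calc ∫ x, Real.sqrt (f x) ∂μ ≤ ∫ x, (f x / (2 * t) + t / 2) ∂μ :=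
          integral_mono_of_nonneg (ae_of_all _ fun x => Real.sqrt_nonneg _) hint2 (ae_of_all _ hpt)
      _ = I / (2 * t) + t / 2 := by
          rw [integral_add (hfi.div_const _) (integrable_const _), integral_div, integral_const, hI]
          simp
  by_cases hIpos : 0 < I
  · set s := Real.sqrt I with hs
    have hs0 : 0 < s := Real.sqrt_pos.2 hIpos
    have hss : s * s = I := Real.mul_self_sqrt hIpos.le
    have h := hamgm s hs0
    have hid : I / (2 * s) + s / 2 = s := by
      rw [← hss]
      field_simp
      ring
    linarith [h, hid]
  · push Not at hIpos
    have hle : ∫ x, Real.sqrt (f x) ∂μ ≤ 0 := by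
      by_contra hcon
      push Not at hcon
      have h := hamgm _ hcon
      have hdiv : I / (2 * ∫ x, Real.sqrt (f x) ∂μ) ≤ 0 :=
        div_nonpos_iff.2 (Or.inr ⟨hIpos, by positivity⟩)
      linarith
    exact hle.trans (Real.sqrt_nonneg _)

variable {G : Type} [Group G] [TopologicalSpace G] [IsTopologicalGroup G] [CompactSpace G]
  [SecondCountableTopology G] [MeasurableSpace G] [BorelSpace G]
  {N : ℕ} (ρ : G →* Matrix (Fin N) (Fin N) ℂ)

/-- The total SQUARED Frobenius plaquette defect `Σ_{p∈Σ} ‖ρ(U_p) − 1‖²_F` of the spanning surface `Σ = [0,b] × [0,m)` —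
the film's plaquette ENERGY on `Σ` (`= 2 Σ_p (N − Re tr ρ(U_p))`, `plaqDefectSqSum_eq_two_mul_sum_cost`). -/
def plaqDefectSqSum (b m : ℕ) (U : LGConfig 4 G) : ℝ :=
  ∑ s ∈ Finset.range m, ∑ t ∈ Finset.range (b + 1), ‖ρ (plaq U t s) - 1‖ ^ 2

omit [TopologicalSpace G] [IsTopologicalGroup G] [CompactSpace G] [SecondCountableTopology G] [MeasurableSpace G]
  [BorelSpace G] in
/-- Energy = twice the plaquette cost: `Σ ‖ρ(U_p) − 1‖²_F = 2 Σ (N − Re tr ρ(U_p))` (unitary `ρ`). -/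
theorem plaqDefectSqSum_eq_two_mul_sum_cost (hρu : ∀ g, ρ g ∈ Matrix.unitaryGroup (Fin N) ℂ) (b m : ℕ)
    (U : LGConfig 4 G) : plaqDefectSqSum ρ b m U =
      2 * ∑ s ∈ Finset.range m, ∑ t ∈ Finset.range (b + 1), ((N : ℝ) - (ρ (plaq U t s)).trace.re) := by
  unfold plaqDefectSqSum
  rw [Finset.mul_sum]
  refine Finset.sum_congr rfl fun s _ => ?_
  rw [Finset.mul_sum]
  refine Finset.sum_congr rfl fun t _ => ?_
  rw [sub_re_trace_eq_norm_sq ρ hρu]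
  ring

omit [CompactSpace G] [SecondCountableTopology G] [MeasurableSpace G] [BorelSpace G] in
theorem continuous_plaqDefectSqSum (hρ : Continuous ρ) (b m : ℕ) : Continuous (plaqDefectSqSum ρ b m) := by
  unfold plaqDefectSqSum
  exact continuous_finsetSum _ fun s _ => continuous_finsetSum _ fun t _ =>
    (((hρ.comp (continuous_plaq _ _)).sub continuous_const).norm.pow 2)

omit [TopologicalSpace G] [IsTopologicalGroup G] [CompactSpace G] [SecondCountableTopology G] [MeasurableSpace G]
  [BorelSpace G] in
theorem plaqDefectSqSum_nonneg (b m : ℕ) (U : LGConfig 4 G) : 0 ≤ plaqDefectSqSum ρ b m U :=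
  Finset.sum_nonneg fun _ _ => Finset.sum_nonneg fun _ _ => sq_nonneg _

omit [TopologicalSpace G] [IsTopologicalGroup G] [CompactSpace G] [SecondCountableTopology G] [MeasurableSpace G]
  [BorelSpace G] in
theorem plaqDefectSqSum_le (hρu : ∀ g, ρ g ∈ Matrix.unitaryGroup (Fin N) ℂ) (b m : ℕ) (U : LGConfig 4 G) :
    plaqDefectSqSum ρ b m U ≤ m * ((b + 1) * (2 * Real.sqrt N) ^ 2) := by
  unfold plaqDefectSqSum
  have h1 : ∀ s ∈ Finset.range m, ∑ t ∈ Finset.range (b + 1), ‖ρ (plaq U t s) - 1‖ ^ 2 ≤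
      (b + 1) * (2 * Real.sqrt N) ^ 2 := by
    intro s _
    have h := Finset.sum_le_card_nsmul (Finset.range (b + 1)) (fun t => ‖ρ (plaq U (t : ℤ) s) - 1‖ ^ 2)
      ((2 * Real.sqrt N) ^ 2) fun t _ => pow_le_pow_left₀ (norm_nonneg _) (norm_map_sub_one_le ρ hρu _) 2
    simpa [Finset.card_range, nsmul_eq_mul] using h
  have h2 := Finset.sum_le_card_nsmul (Finset.range m)
    (fun s => ∑ t ∈ Finset.range (b + 1), ‖ρ (plaq U t s) - 1‖ ^ 2) ((b + 1) * (2 * Real.sqrt N) ^ 2) h1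
  simpa [Finset.card_range, nsmul_eq_mul] using h2

omit [TopologicalSpace G] [IsTopologicalGroup G] [CompactSpace G] [SecondCountableTopology G] [MeasurableSpace G]
  [BorelSpace G] in
/-- **Cauchy–Schwarz over the surface (PROVED):** `(Σ_p ‖ρ(U_p) − 1‖)² ≤ #Σ · Σ_p ‖ρ(U_p) − 1‖²`. -/
theorem plaqDefectSum_sq_le (b m : ℕ) (U : LGConfig 4 G) :
    plaqDefectSum ρ b m U ^ 2 ≤ ((b + 1 : ℕ) * m : ℝ) * plaqDefectSqSum ρ b m U := by
  unfold plaqDefectSum plaqDefectSqSum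
  have h := sq_sum_le_card_mul_sum_sq (s := Finset.range m ×ˢ Finset.range (b + 1))
    (f := fun p : ℕ × ℕ => ‖ρ (plaq U p.2 p.1) - 1‖)
  rw [Finset.sum_product, Finset.sum_product, Finset.card_product, Finset.card_range,
    Finset.card_range] at h
  push_cast at h ⊢
  linarith

omit [TopologicalSpace G] [IsTopologicalGroup G] [CompactSpace G] [SecondCountableTopology G] [MeasurableSpace G]
  [BorelSpace G] in
theorem plaqDefectSum_le_sqrt (b m : ℕ) (U : LGConfig 4 G) :
    plaqDefectSum ρ b m U ≤ Real.sqrt (((b + 1 : ℕ) * m : ℝ) * plaqDefectSqSum ρ b m U) :=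
  (le_abs_self _).trans (Real.abs_le_sqrt (plaqDefectSum_sq_le ρ b m U))

/-- The kernel mean of the film's plaquette ENERGY on `Σ` with the twisted boundary:
`E_{γ_Λ(·|σ')} Σ_{p∈Σ} ‖ρ(U_p) − 1‖²_F`, `σ' = topTwist(comb)(torusLift V)`. -/
def kernelPlaqDefectSq (β : ℝ) (b n : ℕ) (k₀ : G) (V : GaugeConfig 4 (2 * ((2 * n + 2) * b + 1) + 1) G) : ℝ :=
  ∫ U, plaqDefectSqSum ρ b ((2 * n + 1) * b) U
    ∂(ymSpecification ρ β (rowRegion b n)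
      (twistΦ b (comb b ((2 * n + 2) * b + 1) k₀) (torusLift (2 * ((2 * n + 2) * b + 1) + 1) V)))

omit [SecondCountableTopology G] in
theorem kernelPlaqDefectSq_nonneg (β : ℝ) (b n : ℕ) (k₀ : G) (V : GaugeConfig 4 (2 * ((2 * n + 2) * b + 1) + 1) G) :
    0 ≤ kernelPlaqDefectSq ρ β b n k₀ V :=
  integral_nonneg fun U => plaqDefectSqSum_nonneg ρ _ _ U

/-- `V ↦ kernelPlaqDefectSq V` is continuous (as `continuous_kernelPlaqDefect`). -/
theorem continuous_kernelPlaqDefectSq (hρ : Continuous ρ) (hρu : ∀ g, ρ g ∈ Matrix.unitaryGroup (Fin N) ℂ) (β : ℝ)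
    (b n : ℕ) (k₀ : G) : Continuous (kernelPlaqDefectSq ρ β b n k₀) := by
  have hker := continuous_integral_ymSpecification ρ hρ β (rowRegion b n)
    (continuous_plaqDefectSqSum ρ hρ b ((2 * n + 1) * b))
    (C := ((2 * n + 1) * b : ℕ) * ((b + 1) * (2 * Real.sqrt N) ^ 2))
    (fun U => by rw [abs_of_nonneg (plaqDefectSqSum_nonneg ρ _ _ U)]; exact plaqDefectSqSum_le ρ hρu _ _ U)
  have hbd : Continuous fun V : GaugeConfig 4 (2 * ((2 * n + 2) * b + 1) + 1) G =>
      twistΦ b (comb b ((2 * n + 2) * b + 1) k₀) (torusLift (2 * ((2 * n + 2) * b + 1) + 1) V) :=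
    (continuous_twist_comb b _ k₀).comp (continuous_torusLift _)
  exact hker.comp hbd

/-- **K1′ ⇐ K1″ pointwise (PROVED):** `kernelPlaqDefect V ≤ √(#Σ · kernelPlaqDefectSq V)` (Cauchy–Schwarz under the
kernel, then Jensen for `√`). -/
theorem kernelPlaqDefect_le_sqrt (hρ : Continuous ρ) (β : ℝ)
    (b n : ℕ) (k₀ : G) (V : GaugeConfig 4 (2 * ((2 * n + 2) * b + 1) + 1) G) :
    kernelPlaqDefect ρ β b n k₀ V ≤
      Real.sqrt (((b + 1 : ℕ) * ((2 * n + 1) * b : ℕ) : ℝ) * kernelPlaqDefectSq ρ β b n k₀ V) := by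
  unfold kernelPlaqDefect kernelPlaqDefectSq
  set γ := ymSpecification ρ β (rowRegion b n)
    (twistΦ b (comb b ((2 * n + 2) * b + 1) k₀) (torusLift (2 * ((2 * n + 2) * b + 1) + 1) V)) with hγ
  haveI : IsProbabilityMeasure γ := isProbabilityMeasure_ymSpecification ρ hρ β _ _
  set M : ℝ := ((b + 1 : ℕ) * ((2 * n + 1) * b : ℕ) : ℝ) with hM
  have hM0 : 0 ≤ M := by positivity
  have hc2 := continuous_plaqDefectSqSum ρ hρ b ((2 * n + 1) * b)
  calc ∫ U, plaqDefectSum ρ b ((2 * n + 1) * b) U ∂γ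
      ≤ ∫ U, Real.sqrt (M * plaqDefectSqSum ρ b ((2 * n + 1) * b) U) ∂γ :=
        integral_mono (integrable_of_continuous γ (continuous_plaqDefectSum ρ hρ _ _))
          (integrable_of_continuous γ (Real.continuous_sqrt.comp (continuous_const.mul hc2)))
          fun U => plaqDefectSum_le_sqrt ρ _ _ U
    _ ≤ Real.sqrt (∫ U, M * plaqDefectSqSum ρ b ((2 * n + 1) * b) U ∂γ) :=
        integral_sqrt_le_sqrt_integral γ (fun U => mul_nonneg hM0 (plaqDefectSqSum_nonneg ρ _ _ U))
          (integrable_of_continuous γ (continuous_const.mul hc2))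
    _ = Real.sqrt (M * ∫ U, plaqDefectSqSum ρ b ((2 * n + 1) * b) U ∂γ) := by rw [integral_const_mul]

/-- **K1′ ⇐ K1″ under `μ` (PROVED):** `E_μ kernelPlaqDefect ≤ √(#Σ · E_μ kernelPlaqDefectSq)` (Jensen for `√` again). -/
theorem integral_kernelPlaqDefect_le_sqrt (hρ : Continuous ρ) (hρu : ∀ g, ρ g ∈ Matrix.unitaryGroup (Fin N) ℂ)
    (β : ℝ) (b n : ℕ) (k₀ : G) :
    ∫ V, kernelPlaqDefect ρ β b n k₀ V ∂(wilsonMeasure (d := 4) (L := 2 * ((2 * n + 2) * b + 1) + 1) ρ β) ≤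
      Real.sqrt (((b + 1 : ℕ) * ((2 * n + 1) * b : ℕ) : ℝ) *
        ∫ V, kernelPlaqDefectSq ρ β b n k₀ V ∂(wilsonMeasure (d := 4) (L := 2 * ((2 * n + 2) * b + 1) + 1) ρ β)) := by
  set μ := wilsonMeasure (d := 4) (L := 2 * ((2 * n + 2) * b + 1) + 1) ρ β with hμ
  haveI : IsProbabilityMeasure μ := isProbabilityMeasure_wilsonMeasure ρ hρ β
  set M : ℝ := ((b + 1 : ℕ) * ((2 * n + 1) * b : ℕ) : ℝ) with hM
  have hM0 : 0 ≤ M := by positivity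
  have hc1 := continuous_kernelPlaqDefect ρ hρ hρu β b n k₀
  have hc2 := continuous_kernelPlaqDefectSq ρ hρ hρu β b n k₀
  calc ∫ V, kernelPlaqDefect ρ β b n k₀ V ∂μ ≤ ∫ V, Real.sqrt (M * kernelPlaqDefectSq ρ β b n k₀ V) ∂μ :=
        integral_mono (integrable_of_continuous μ hc1)
          (integrable_of_continuous μ (Real.continuous_sqrt.comp (continuous_const.mul hc2)))
          fun V => kernelPlaqDefect_le_sqrt ρ hρ β b n k₀ V
    _ ≤ Real.sqrt (∫ V, M * kernelPlaqDefectSq ρ β b n k₀ V ∂μ) :=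
        integral_sqrt_le_sqrt_integral μ (fun V => mul_nonneg hM0 (kernelPlaqDefectSq_nonneg ρ β b n k₀ V))
          (integrable_of_continuous μ (continuous_const.mul hc2))
    _ = Real.sqrt (M * ∫ V, kernelPlaqDefectSq ρ β b n k₀ V ∂μ) := by rw [integral_const_mul]

/-- **K1′ ⇐ K1″ with the rates (PROVED):** a LINEAR plaquette-energy bound `E_μ E_γ Σ_Σ ‖ρ(U_p) − 1‖² ≤ C b⁵ log β/β`
gives the defect bound `E_μ E_γ Σ_Σ ‖ρ(U_p) − 1‖ ≤ √(2(2n+1)C) · b^{7/2} √(log β/β)` (`#Σ = (b+1)(2n+1)b ≤ 2(2n+1)b²`). -/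
theorem integral_kernelPlaqDefect_le_of_sq (hρ : Continuous ρ) (hρu : ∀ g, ρ g ∈ Matrix.unitaryGroup (Fin N) ℂ)
    {n : ℕ} {k₀ : G}
    (h : ∃ C : ℝ, 0 < C ∧ ∃ β₁ : ℝ, ∀ β : ℝ, β₁ ≤ β → ∀ b : ℕ, 1 ≤ b →
      ∫ V, kernelPlaqDefectSq ρ β b n k₀ V ∂(wilsonMeasure (d := 4) (L := 2 * ((2 * n + 2) * b + 1) + 1) ρ β) ≤
        C * (b : ℝ) ^ 5 * (Real.log β / β)) :
    ∃ C : ℝ, 0 < C ∧ ∃ β₁ : ℝ, ∀ β : ℝ, β₁ ≤ β → ∀ b : ℕ, 1 ≤ b →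
      ∫ V, kernelPlaqDefect ρ β b n k₀ V ∂(wilsonMeasure (d := 4) (L := 2 * ((2 * n + 2) * b + 1) + 1) ρ β) ≤
        C * (b : ℝ) ^ (7 / 2 : ℝ) * Real.sqrt (Real.log β / β) := by
  obtain ⟨C, hC, β₁, h⟩ := h
  have h2C : 0 < 2 * (2 * (n : ℝ) + 1) * C := by positivity
  set K : ℝ := Real.sqrt (2 * (2 * (n : ℝ) + 1) * C) with hK
  have hK0 : 0 < K := Real.sqrt_pos.2 h2C
  refine ⟨K, hK0, max β₁ 1, fun β hβ b hb => ?_⟩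
  have hβ1 : β₁ ≤ β := (le_max_left _ _).trans hβ
  have hβone : (1 : ℝ) ≤ β := (le_max_right _ _).trans hβ
  have hL0 : 0 ≤ Real.log β / β := div_nonneg (Real.log_nonneg hβone) (by linarith)
  have hb0 : (0 : ℝ) ≤ b := Nat.cast_nonneg _
  have hb1 : (1 : ℝ) ≤ b := by exact_mod_cast hb
  set μ := wilsonMeasure (d := 4) (L := 2 * ((2 * n + 2) * b + 1) + 1) ρ β with hμ
  set X := ∫ V, kernelPlaqDefectSq ρ β b n k₀ V ∂μ with hX
  have hXle : X ≤ C * (b : ℝ) ^ 5 * (Real.log β / β) := h β hβ1 b hb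
  have hX0 : 0 ≤ X := integral_nonneg fun V => kernelPlaqDefectSq_nonneg ρ β b n k₀ V
  set M : ℝ := ((b + 1 : ℕ) * ((2 * n + 1) * b : ℕ) : ℝ) with hM
  have hMle : M ≤ 2 * (2 * (n : ℝ) + 1) * (b : ℝ) ^ 2 := by
    rw [hM]; push_cast
    nlinarith [mul_nonneg (show (0 : ℝ) ≤ 2 * n + 1 by positivity) hb0, hb1]
  have hstep : ∫ V, kernelPlaqDefect ρ β b n k₀ V ∂μ ≤ Real.sqrt (M * X) :=
    integral_kernelPlaqDefect_le_sqrt ρ hρ hρu β b n k₀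
  have h7 : ((b : ℝ) ^ (7 / 2 : ℝ)) ^ 2 = (b : ℝ) ^ 7 := by
    rw [← Real.rpow_natCast _ 2, ← Real.rpow_natCast _ 7, ← Real.rpow_mul hb0]; norm_num
  have hKsq : K ^ 2 = 2 * (2 * (n : ℝ) + 1) * C := Real.sq_sqrt h2C.le
  have hprod : M * X ≤ (K * (b : ℝ) ^ (7 / 2 : ℝ)) ^ 2 * (Real.log β / β) := by
    calc M * X ≤ (2 * (2 * (n : ℝ) + 1) * (b : ℝ) ^ 2) * (C * (b : ℝ) ^ 5 * (Real.log β / β)) :=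
          mul_le_mul hMle hXle hX0 (by positivity)
      _ = (K * (b : ℝ) ^ (7 / 2 : ℝ)) ^ 2 * (Real.log β / β) := by rw [mul_pow, hKsq, h7]; ring
  have hKb : 0 ≤ K * (b : ℝ) ^ (7 / 2 : ℝ) := mul_nonneg hK0.le (Real.rpow_nonneg hb0 _)
  calc ∫ V, kernelPlaqDefect ρ β b n k₀ V ∂μ ≤ Real.sqrt (M * X) := hstep
    _ ≤ Real.sqrt ((K * (b : ℝ) ^ (7 / 2 : ℝ)) ^ 2 * (Real.log β / β)) := Real.sqrt_le_sqrt hprod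
    _ = K * (b : ℝ) ^ (7 / 2 : ℝ) * Real.sqrt (Real.log β / β) := by
        rw [Real.sqrt_mul (sq_nonneg _), Real.sqrt_sq hKb]

end PlaqEnergy

/-! ## §4i (PROVED; rev 9) Every plaquette of `Σ` touches `Λ`: K1″ reduces to the kernel-mean of the BOUNDARY WILSON ACTION (K1‴) -/

section Action

open scoped Matrix Matrix.Norms.Frobenius
open Literature.MathematicalPhysics.QuantumFieldTheory (wilsonMeasure GaugeConfig isProbabilityMeasure_wilsonMeasure)
open Summit.QuantumFields.YangMills.Theorems.TunedSequenceExists.Negative.Freezing (integrable_of_continuous)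

variable {G : Type} [Group G] [TopologicalSpace G] [IsTopologicalGroup G] [CompactSpace G]
  [SecondCountableTopology G] [MeasurableSpace G] [BorelSpace G]
  {N : ℕ} (ρ : G →* Matrix (Fin N) (Fin N) ℂ)

/-- The `Σ`-plaquette `(t, s)` of the row rectangle as a `ZdPlaquette 4` (base `site2 t s`, plane `(0,1)`). -/
def sigmaPlaq (t s : ℤ) : ZdPlaquette 4 := (site2 t s, ⟨((0 : Fin 4), (1 : Fin 4)), by decide⟩)

theorem sigmaPlaq_inj {t s t' s' : ℤ} (h : sigmaPlaq t s = sigmaPlaq t' s') : t = t' ∧ s = s' := by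
  have h1 := congrArg (fun p : ZdPlaquette 4 => p.1 0) h
  have h2 := congrArg (fun p : ZdPlaquette 4 => p.1 1) h
  simp only [sigmaPlaq, site2_zero, site2_one] at h1 h2
  exact ⟨h1, h2⟩

/-- **Geometry (PROVED):** every edge `(site2 t s, i)` with `1 ≤ t ≤ b`, `0 ≤ s < (2n+1)b` lies in the resampled row region
`Λ = rowRegion b n` (cell `y = (0, ⌊s/b⌋, 0, 0) ∈ rowCells n` of the standard frame). -/
theorem edge_mem_rowRegion {b n : ℕ} (hb : 1 ≤ b) {t : ℤ} (ht : 1 ≤ t ∧ t ≤ b) {s : ℤ}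
    (hs : 0 ≤ s ∧ s < (2 * n + 1) * (b : ℤ)) (i : Fin 4) : (site2 t s, i) ∈ rowRegion b n := by
  have hb0 : (0 : ℤ) < b := by exact_mod_cast hb
  set q : ℤ := s / b with hq
  have hdiv := Int.mul_ediv_add_emod s b
  have hr0 := Int.emod_nonneg s hb0.ne'
  have hrb := Int.emod_lt_of_pos s hb0
  have hq0 : 0 ≤ q := Int.ediv_nonneg hs.1 hb0.le
  have hqn : q < 2 * n + 1 := (Int.ediv_lt_iff_lt_mul hb0).2 (by linarith [hs.2])
  let y : Fin 4 → ℤ := fun k => if k = 1 then q else 0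
  unfold rowRegion regionEdges
  rw [Finset.mem_biUnion]
  refine ⟨y, ?_, ?_⟩
  · refine Finset.mem_filter.2 ⟨?_, by simp [y]⟩
    rw [windowCells, Fintype.mem_piFinset]
    intro k
    rw [Finset.mem_Icc]
    fin_cases k <;> simp [y]
    all_goals omega
  · rw [cellEdges, Finset.mem_product]
    refine ⟨?_, Finset.mem_univ _⟩
    rw [Fintype.mem_piFinset]
    intro k
    rw [Finset.mem_Ico]
    fin_cases k <;> simp [y, site2, stdFrame] <;> (try constructor) <;>
      nlinarith [hdiv, hr0, hrb, hq0, hqn, ht.1, ht.2, hb0]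

/-- `site2 0 s + e₀ = site2 1 s`. -/
theorem site2_zero_add_single (s : ℤ) : site2 0 s + Pi.single (0 : Fin 4) (1 : ℤ) = site2 1 s := by
  funext k
  fin_cases k <;> simp [site2]

/-- **Geometry (PROVED): every plaquette of the spanning surface `Σ = [0,b] × [0,(2n+1)b)` touches `Λ = rowRegion b n`**
(through its spatial edge at height `max t 1`). -/
theorem sigmaPlaq_mem_touching {b n : ℕ} (hb : 1 ≤ b) {t s : ℕ} (ht : t ≤ b) (hs : s < (2 * n + 1) * b) :
    sigmaPlaq t s ∈ plaquettesTouching (rowRegion b n) := by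
  rw [mem_plaquettesTouching_iff]
  have hs' : (0 : ℤ) ≤ (s : ℤ) ∧ (s : ℤ) < (2 * n + 1) * (b : ℤ) := ⟨by positivity, by exact_mod_cast hs⟩
  rcases Nat.eq_zero_or_pos t with rfl | htpos
  · refine ⟨(site2 1 s, (1 : Fin 4)), Finset.mem_inter.2 ⟨?_, ?_⟩⟩
    · simp only [plaquetteEdges, sigmaPlaq, Finset.mem_insert, Finset.mem_singleton, Nat.cast_zero]
      right; left
      rw [site2_zero_add_single]
    · exact edge_mem_rowRegion hb ⟨le_rfl, by exact_mod_cast hb⟩ hs' 1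
  · refine ⟨(site2 t s, (1 : Fin 4)), Finset.mem_inter.2 ⟨?_, ?_⟩⟩
    · simp [plaquetteEdges, sigmaPlaq]
    · exact edge_mem_rowRegion hb ⟨by exact_mod_cast htpos, by exact_mod_cast ht⟩ hs' 1

omit [TopologicalSpace G] [IsTopologicalGroup G] [CompactSpace G] [SecondCountableTopology G] [MeasurableSpace G]
  [BorelSpace G] in
/-- **E1 (PROVED): the film's plaquette energy on `Σ` is dominated by twice the boundary Wilson action of `Λ`,**
`Σ_{p∈Σ} ‖ρ(U_p) − 1‖²_F ≤ 2 · wilsonBoundaryAction ρ (rowRegion b n) U` for every configuration `U`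
(`‖ρ(U_p) − 1‖²_F = 2(N − Re tr ρ(U_p))`, `Σ ⊆ plaquettesTouching Λ`, and every summand of the action is `≥ 0`). -/
theorem plaqDefectSqSum_le_two_mul_action (hρu : ∀ g, ρ g ∈ Matrix.unitaryGroup (Fin N) ℂ) {b : ℕ} (hb : 1 ≤ b)
    (n : ℕ) (U : LGConfig 4 G) :
    plaqDefectSqSum ρ b ((2 * n + 1) * b) U ≤ 2 * wilsonBoundaryAction ρ (rowRegion b n) U := by
  rw [plaqDefectSqSum_eq_two_mul_sum_cost ρ hρu]
  refine mul_le_mul_of_nonneg_left ?_ (by norm_num)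
  unfold wilsonBoundaryAction
  set S := Finset.range ((2 * n + 1) * b) ×ˢ Finset.range (b + 1) with hS
  let g : ℕ × ℕ → ZdPlaquette 4 := fun q => sigmaPlaq q.2 q.1
  have hsub : S.image g ⊆ plaquettesTouching (rowRegion b n) := by
    refine Finset.image_subset_iff.2 fun q hq => ?_
    obtain ⟨hq1, hq2⟩ := Finset.mem_product.1 hq
    exact sigmaPlaq_mem_touching hb (Nat.lt_succ_iff.1 (Finset.mem_range.1 hq2)) (Finset.mem_range.1 hq1)
  have hnn : ∀ p ∈ plaquettesTouching (rowRegion b n), p ∉ S.image g →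
      0 ≤ (N : ℝ) - plaquetteObs ρ p.1 p.2.1.1 p.2.1.2 U := fun p _ _ => by
    have := (abs_le.1 (abs_plaquetteObs_le_holds ρ hρu p.1 p.2.1.1 p.2.1.2 U)).2
    linarith
  have himg : ∑ p ∈ S.image g, ((N : ℝ) - plaquetteObs ρ p.1 p.2.1.1 p.2.1.2 U) =
      ∑ q ∈ S, ((N : ℝ) - plaquetteObs ρ (g q).1 (g q).2.1.1 (g q).2.1.2 U) := by
    refine Finset.sum_image ?_
    intro q _ q' _ hqq
    obtain ⟨h1, h2⟩ := sigmaPlaq_inj hqq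
    exact Prod.ext (by exact_mod_cast h2) (by exact_mod_cast h1)
  calc ∑ s ∈ Finset.range ((2 * n + 1) * b), ∑ t ∈ Finset.range (b + 1), ((N : ℝ) - (ρ (plaq U t s)).trace.re)
      = ∑ q ∈ S, ((N : ℝ) - plaquetteObs ρ (g q).1 (g q).2.1.1 (g q).2.1.2 U) := by
        rw [hS, Finset.sum_product]
        rfl
    _ = ∑ p ∈ S.image g, ((N : ℝ) - plaquetteObs ρ p.1 p.2.1.1 p.2.1.2 U) := himg.symm
    _ ≤ ∑ p ∈ plaquettesTouching (rowRegion b n), ((N : ℝ) - plaquetteObs ρ p.1 p.2.1.1 p.2.1.2 U) :=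
        Finset.sum_le_sum_of_subset_of_nonneg hsub hnn

/-- The kernel-mean BOUNDARY WILSON ACTION of `Λ = rowRegion b n` in the twisted world:
`V ↦ E_{γ_Λ(·|σ'_V)} wilsonBoundaryAction ρ Λ`, `σ'_V = topTwist_b(comb_b k₀ σ) σ`, `σ = lift V`. -/
def kernelAction (β : ℝ) (b n : ℕ) (k₀ : G) (V : GaugeConfig 4 (2 * ((2 * n + 2) * b + 1) + 1) G) : ℝ :=
  ∫ U, wilsonBoundaryAction ρ (rowRegion b n) U
    ∂(ymSpecification ρ β (rowRegion b n)
      (twistΦ b (comb b ((2 * n + 2) * b + 1) k₀) (torusLift (2 * ((2 * n + 2) * b + 1) + 1) V)))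

omit [SecondCountableTopology G] in
theorem kernelAction_nonneg (hρu : ∀ g, ρ g ∈ Matrix.unitaryGroup (Fin N) ℂ) (β : ℝ) (b n : ℕ) (k₀ : G)
    (V : GaugeConfig 4 (2 * ((2 * n + 2) * b + 1) + 1) G) : 0 ≤ kernelAction ρ β b n k₀ V :=
  integral_nonneg fun U => wilsonBoundaryAction_nonneg ρ hρu _ U

/-- `V ↦ kernelAction V` is continuous (as `continuous_kernelPlaqDefectSq`). -/
theorem continuous_kernelAction (hρ : Continuous ρ) (hρu : ∀ g, ρ g ∈ Matrix.unitaryGroup (Fin N) ℂ) (β : ℝ)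
    (b n : ℕ) (k₀ : G) : Continuous (kernelAction ρ β b n k₀) := by
  have hker := continuous_integral_ymSpecification ρ hρ β (rowRegion b n)
    (continuous_wilsonBoundaryAction ρ hρ (rowRegion b n))
    (C := 2 * N * (plaquettesTouching (rowRegion b n)).card)
    (fun U => by
      rw [abs_of_nonneg (wilsonBoundaryAction_nonneg ρ hρu _ U)]
      exact wilsonBoundaryAction_le_card ρ hρu _ U)
  have hbd : Continuous fun V : GaugeConfig 4 (2 * ((2 * n + 2) * b + 1) + 1) G =>
      twistΦ b (comb b ((2 * n + 2) * b + 1) k₀) (torusLift (2 * ((2 * n + 2) * b + 1) + 1) V) :=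
    (continuous_twist_comb b _ k₀).comp (continuous_torusLift _)
  exact hker.comp hbd

/-- **K1″ ⇐ K1‴ pointwise (PROVED):** `kernelPlaqDefectSq V ≤ 2 · kernelAction V`. -/
theorem kernelPlaqDefectSq_le_kernelAction (hρ : Continuous ρ) (hρu : ∀ g, ρ g ∈ Matrix.unitaryGroup (Fin N) ℂ)
    (β : ℝ) {b : ℕ} (hb : 1 ≤ b) (n : ℕ) (k₀ : G) (V : GaugeConfig 4 (2 * ((2 * n + 2) * b + 1) + 1) G) :
    kernelPlaqDefectSq ρ β b n k₀ V ≤ 2 * kernelAction ρ β b n k₀ V := by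
  unfold kernelPlaqDefectSq kernelAction
  set γ := ymSpecification ρ β (rowRegion b n)
    (twistΦ b (comb b ((2 * n + 2) * b + 1) k₀) (torusLift (2 * ((2 * n + 2) * b + 1) + 1) V)) with hγ
  haveI : IsProbabilityMeasure γ := isProbabilityMeasure_ymSpecification ρ hρ β _ _
  rw [← integral_const_mul]
  exact integral_mono (integrable_of_continuous γ (continuous_plaqDefectSqSum ρ hρ _ _))
    ((integrable_of_continuous γ (continuous_wilsonBoundaryAction ρ hρ _)).const_mul 2)
    fun U => plaqDefectSqSum_le_two_mul_action ρ hρu hb n U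

/-- **K1″ ⇐ K1‴ with the rates (PROVED):** an in-mean bound `E_μ E_γ A_Λ ≤ C b⁵ log β/β` on the kernel-mean boundary Wilson
action gives the plaquette-energy bound K1″ with constant `2C`. -/
theorem integral_kernelPlaqDefectSq_le_of_action (hρ : Continuous ρ) (hρu : ∀ g, ρ g ∈ Matrix.unitaryGroup (Fin N) ℂ)
    {n : ℕ} {k₀ : G}
    (h : ∃ C : ℝ, 0 < C ∧ ∃ β₁ : ℝ, ∀ β : ℝ, β₁ ≤ β → ∀ b : ℕ, 1 ≤ b →
      ∫ V, kernelAction ρ β b n k₀ V ∂(wilsonMeasure (d := 4) (L := 2 * ((2 * n + 2) * b + 1) + 1) ρ β) ≤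
        C * (b : ℝ) ^ 5 * (Real.log β / β)) :
    ∃ C : ℝ, 0 < C ∧ ∃ β₁ : ℝ, ∀ β : ℝ, β₁ ≤ β → ∀ b : ℕ, 1 ≤ b →
      ∫ V, kernelPlaqDefectSq ρ β b n k₀ V ∂(wilsonMeasure (d := 4) (L := 2 * ((2 * n + 2) * b + 1) + 1) ρ β) ≤
        C * (b : ℝ) ^ 5 * (Real.log β / β) := by
  obtain ⟨C, hC, β₁, h⟩ := h
  refine ⟨2 * C, by positivity, β₁, fun β hβ b hb => ?_⟩
  set μ := wilsonMeasure (d := 4) (L := 2 * ((2 * n + 2) * b + 1) + 1) ρ β with hμ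
  haveI : IsProbabilityMeasure μ := isProbabilityMeasure_wilsonMeasure ρ hρ β
  calc ∫ V, kernelPlaqDefectSq ρ β b n k₀ V ∂μ ≤ ∫ V, 2 * kernelAction ρ β b n k₀ V ∂μ :=
        integral_mono (integrable_of_continuous μ (continuous_kernelPlaqDefectSq ρ hρ hρu β b n k₀))
          ((integrable_of_continuous μ (continuous_kernelAction ρ hρ hρu β b n k₀)).const_mul 2)
          fun V => kernelPlaqDefectSq_le_kernelAction ρ hρ hρu β hb n k₀ V
    _ = 2 * ∫ V, kernelAction ρ β b n k₀ V ∂μ := integral_const_mul _ _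
    _ ≤ 2 * (C * (b : ℝ) ^ 5 * (Real.log β / β)) := mul_le_mul_of_nonneg_left (h β hβ b hb) (by norm_num)
    _ = 2 * C * (b : ℝ) ^ 5 * (Real.log β / β) := by ring

end Action

/-! ## §4j (PROVED; rev 10) Energy–entropy for the kernel-mean ACTION against a reference filling: Lipschitz bounds of
`A_Λ` in Frobenius balls, product small-ball Haar mass around ANY centre (Chatterjee Cor. 6.3 via the tree's
`FreeEnergyLogCoefficient.exists_haar_gball_ge` + left invariance), and the assembly K1‴ ⇐ R1 ∧ R3 -/

section Lipschitz

open scoped Matrix Matrix.Norms.Frobenius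

variable {G : Type} [Group G] {d N : ℕ} (ρ : G →* Matrix (Fin N) (Fin N) ℂ)

/-- `‖ρ(gh) − ρ(g'h')‖_F ≤ ‖ρ g − ρ g'‖_F + ‖ρ h − ρ h'‖_F` (unitary invariance of the Frobenius norm). -/
theorem norm_map_mul_sub_map_mul_le (hρu : ∀ g, ρ g ∈ Matrix.unitaryGroup (Fin N) ℂ) (g h g' h' : G) :
    ‖ρ (g * h) - ρ (g' * h')‖ ≤ ‖ρ g - ρ g'‖ + ‖ρ h - ρ h'‖ := by
  have hsplit : ρ (g * h) - ρ (g' * h') = ρ g * (ρ h - ρ h') + (ρ g - ρ g') * ρ h' := by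
    rw [map_mul, map_mul]; noncomm_ring
  rw [hsplit]
  refine (norm_add_le _ _).trans ?_
  rw [Matrix.frobenius_norm_unitaryGroup_mul ⟨ρ g, hρu g⟩, Matrix.frobenius_norm_mul_unitaryGroup _ ⟨ρ h', hρu h'⟩]
  linarith

/-- `‖ρ(g⁻¹) − ρ(g'⁻¹)‖_F = ‖ρ g − ρ g'‖_F`. -/
theorem norm_map_inv_sub_map_inv (hρu : ∀ g, ρ g ∈ Matrix.unitaryGroup (Fin N) ℂ) (g g' : G) :
    ‖ρ g⁻¹ - ρ g'⁻¹‖ = ‖ρ g - ρ g'‖ := by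
  have e1 : ρ g⁻¹ * ρ g' * ρ g'⁻¹ = ρ g⁻¹ := by rw [mul_assoc, ← map_mul, mul_inv_cancel, map_one, mul_one]
  have e2 : ρ g⁻¹ * ρ g * ρ g'⁻¹ = ρ g'⁻¹ := by rw [← map_mul, inv_mul_cancel, map_one, one_mul]
  have h : ρ g⁻¹ - ρ g'⁻¹ = ρ g⁻¹ * (ρ g' - ρ g) * ρ g'⁻¹ := by rw [mul_sub, sub_mul, e1, e2]
  rw [h, Matrix.frobenius_norm_mul_unitaryGroup _ ⟨ρ g'⁻¹, hρu g'⁻¹⟩,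
    Matrix.frobenius_norm_unitaryGroup_mul ⟨ρ g⁻¹, hρu g⁻¹⟩, norm_sub_rev]

/-- The total Frobenius deviation of `ρ ∘ U` from `ρ ∘ U'` on the four edges of the plaquette `(x, i, j)`. -/
def plaqEdgeDev (U U' : LGConfig d G) (x : Site d) (i j : Fin d) : ℝ :=
  ‖ρ (U (x, i)) - ρ (U' (x, i))‖ + ‖ρ (U (x + Pi.single i 1, j)) - ρ (U' (x + Pi.single i 1, j))‖ +
    ‖ρ (U (x + Pi.single j 1, i)) - ρ (U' (x + Pi.single j 1, i))‖ + ‖ρ (U (x, j)) - ρ (U' (x, j))‖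

theorem plaqEdgeDev_nonneg (U U' : LGConfig d G) (x : Site d) (i j : Fin d) : 0 ≤ plaqEdgeDev ρ U U' x i j := by
  unfold plaqEdgeDev; positivity

/-- **Telescoping (PROVED):** `‖ρ(U_p) − ρ(U'_p)‖_F ≤` the sum of the four edge deviations. -/
theorem norm_map_plaquetteHolonomy_sub_le (hρu : ∀ g, ρ g ∈ Matrix.unitaryGroup (Fin N) ℂ) (U U' : LGConfig d G)
    (x : Site d) (i j : Fin d) :
    ‖ρ (plaquetteHolonomyZd U x i j) - ρ (plaquetteHolonomyZd U' x i j)‖ ≤ plaqEdgeDev ρ U U' x i j := by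
  unfold plaquetteHolonomyZd plaqEdgeDev
  calc ‖ρ (U (x, i) * U (x + Pi.single i 1, j) * (U (x + Pi.single j 1, i))⁻¹ * (U (x, j))⁻¹) -
        ρ (U' (x, i) * U' (x + Pi.single i 1, j) * (U' (x + Pi.single j 1, i))⁻¹ * (U' (x, j))⁻¹)‖
      ≤ ‖ρ (U (x, i) * U (x + Pi.single i 1, j) * (U (x + Pi.single j 1, i))⁻¹) -
          ρ (U' (x, i) * U' (x + Pi.single i 1, j) * (U' (x + Pi.single j 1, i))⁻¹)‖ +
          ‖ρ (U (x, j))⁻¹ - ρ (U' (x, j))⁻¹‖ := norm_map_mul_sub_map_mul_le ρ hρu _ _ _ _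
    _ ≤ (‖ρ (U (x, i) * U (x + Pi.single i 1, j)) - ρ (U' (x, i) * U' (x + Pi.single i 1, j))‖ +
          ‖ρ (U (x + Pi.single j 1, i))⁻¹ - ρ (U' (x + Pi.single j 1, i))⁻¹‖) +
          ‖ρ (U (x, j))⁻¹ - ρ (U' (x, j))⁻¹‖ := by
        gcongr; exact norm_map_mul_sub_map_mul_le ρ hρu _ _ _ _
    _ ≤ ((‖ρ (U (x, i)) - ρ (U' (x, i))‖ + ‖ρ (U (x + Pi.single i 1, j)) - ρ (U' (x + Pi.single i 1, j))‖) +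
          ‖ρ (U (x + Pi.single j 1, i))⁻¹ - ρ (U' (x + Pi.single j 1, i))⁻¹‖) +
          ‖ρ (U (x, j))⁻¹ - ρ (U' (x, j))⁻¹‖ := by
        gcongr; exact norm_map_mul_sub_map_mul_le ρ hρu _ _ _ _
    _ = _ := by rw [norm_map_inv_sub_map_inv ρ hρu, norm_map_inv_sub_map_inv ρ hρu]

/-- **Lipschitz bound of one plaquette observable (PROVED):** `|obs_p(U) − obs_p(U')| ≤ √N · (edge deviations)`. -/
theorem abs_plaquetteObs_sub_le (hρu : ∀ g, ρ g ∈ Matrix.unitaryGroup (Fin N) ℂ) (U U' : LGConfig d G)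
    (x : Site d) (i j : Fin d) :
    |plaquetteObs ρ x i j U - plaquetteObs ρ x i j U'| ≤ Real.sqrt N * plaqEdgeDev ρ U U' x i j := by
  unfold plaquetteObs
  rw [← Complex.sub_re, ← Matrix.trace_sub]
  exact (abs_re_trace_le_sqrt_mul_norm _).trans
    (mul_le_mul_of_nonneg_left (norm_map_plaquetteHolonomy_sub_le ρ hρu U U' x i j) (Real.sqrt_nonneg _))

/-- **Lipschitz bound of the boundary Wilson action (PROVED):**
`A_Λ(U) ≤ A_Λ(U') + √N · Σ_{p touching Λ} (edge deviations of p)`. -/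
theorem wilsonBoundaryAction_le_add_dev (hρu : ∀ g, ρ g ∈ Matrix.unitaryGroup (Fin N) ℂ) (Λ : Finset (ZdEdge d))
    (U U' : LGConfig d G) :
    wilsonBoundaryAction ρ Λ U ≤ wilsonBoundaryAction ρ Λ U' +
      Real.sqrt N * ∑ p ∈ plaquettesTouching Λ, plaqEdgeDev ρ U U' p.1 p.2.1.1 p.2.1.2 := by
  unfold wilsonBoundaryAction
  rw [Finset.mul_sum, ← Finset.sum_add_distrib]
  refine Finset.sum_le_sum fun p _ => ?_
  have h := (abs_le.1 (abs_plaquetteObs_sub_le ρ hρu U' U p.1 p.2.1.1 p.2.1.2)).2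
  have hsym : plaqEdgeDev ρ U' U p.1 p.2.1.1 p.2.1.2 = plaqEdgeDev ρ U U' p.1 p.2.1.1 p.2.1.2 := by
    unfold plaqEdgeDev; simp only [norm_sub_rev]
  rw [hsym] at h
  linarith

/-- **Small-ball slack (PROVED):** if `ρ ∘ U` is within Frobenius distance `r` of `ρ ∘ U'` on every edge of `Λ` and `U = U'`
off `Λ`, then `A_Λ(U) ≤ A_Λ(U') + 4√N · #touching(Λ) · r`. -/
theorem wilsonBoundaryAction_le_of_ball (hρu : ∀ g, ρ g ∈ Matrix.unitaryGroup (Fin N) ℂ) (Λ : Finset (ZdEdge d))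
    {U U' : LGConfig d G} {r : ℝ} (hr : 0 ≤ r) (hin : ∀ e ∈ Λ, ‖ρ (U e) - ρ (U' e)‖ ≤ r)
    (hout : ∀ e, e ∉ Λ → U e = U' e) :
    wilsonBoundaryAction ρ Λ U ≤ wilsonBoundaryAction ρ Λ U' + 4 * Real.sqrt N * (plaquettesTouching Λ).card * r := by
  have hdev : ∀ e, ‖ρ (U e) - ρ (U' e)‖ ≤ r := fun e => by
    by_cases he : e ∈ Λ
    · exact hin e he
    · rw [hout e he, sub_self, norm_zero]; exact hr
  have hp : ∀ p ∈ plaquettesTouching Λ, plaqEdgeDev ρ U U' p.1 p.2.1.1 p.2.1.2 ≤ 4 * r := fun p _ => by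
    unfold plaqEdgeDev; linarith [hdev (p.1, p.2.1.1), hdev (p.1 + Pi.single p.2.1.1 1, p.2.1.2),
      hdev (p.1 + Pi.single p.2.1.2 1, p.2.1.1), hdev (p.1, p.2.1.2)]
  have hsum : ∑ p ∈ plaquettesTouching Λ, plaqEdgeDev ρ U U' p.1 p.2.1.1 p.2.1.2 ≤
      (plaquettesTouching Λ).card * (4 * r) := by
    have := Finset.sum_le_sum hp
    rwa [Finset.sum_const, nsmul_eq_mul] at this
  have hN : 0 ≤ Real.sqrt N := Real.sqrt_nonneg _
  calc wilsonBoundaryAction ρ Λ U ≤ wilsonBoundaryAction ρ Λ U' +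
        Real.sqrt N * ∑ p ∈ plaquettesTouching Λ, plaqEdgeDev ρ U U' p.1 p.2.1.1 p.2.1.2 :=
        wilsonBoundaryAction_le_add_dev ρ hρu Λ U U'
    _ ≤ wilsonBoundaryAction ρ Λ U' + Real.sqrt N * ((plaquettesTouching Λ).card * (4 * r)) := by gcongr
    _ = wilsonBoundaryAction ρ Λ U' + 4 * Real.sqrt N * (plaquettesTouching Λ).card * r := by ring



end Lipschitz

section Ref

open scoped Matrix Matrix.Norms.Frobenius
open Literature.MathematicalPhysics.QuantumFieldTheory (haarProbability)

variable {G : Type} [Group G] [TopologicalSpace G] [IsTopologicalGroup G] [CompactSpace G]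
  [SecondCountableTopology G] [MeasurableSpace G] [BorelSpace G]
  {d N : ℕ} (ρ : G →* Matrix (Fin N) (Fin N) ℂ)

omit [SecondCountableTopology G] in
/-- Product of uniform small-ball masses (PROVED): `m₀^{#Λ} ≤ (⊗_Λ Haar)(∏_e Ball_r(ζ₀ e))`. -/
theorem pi_real_ball_ge (Λ : Finset (ZdEdge d)) (ζ₀ : ↥Λ → G)
    {r m₀ : ℝ} (hm₀ : 0 ≤ m₀) (hball : ∀ h : G, m₀ ≤ (haarProbability G).real {g | ‖ρ g - ρ h‖ ≤ r}) :
    m₀ ^ Λ.card ≤ (Measure.pi fun _ : ↥Λ => haarProbability G).real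
      (Set.pi Set.univ fun e : ↥Λ => {g | ‖ρ g - ρ (ζ₀ e)‖ ≤ r}) := by
  rw [measureReal_def, Measure.pi_pi, ENNReal.toReal_prod]
  calc m₀ ^ Λ.card = ∏ _e : ↥Λ, m₀ := by rw [Finset.prod_const, Finset.card_univ, Fintype.card_coe]
    _ ≤ ∏ e : ↥Λ, ((haarProbability G) {g | ‖ρ g - ρ (ζ₀ e)‖ ≤ r}).toReal :=
        Finset.prod_le_prod (fun _ _ => hm₀) fun e _ => by rw [← measureReal_def]; exact hball (ζ₀ e)

/-- **Kernel energy bound WITH A REFERENCE FILLING (PROVED):** for every boundary condition `η`, every reference filling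
`ζ₀ : Λ → G`, radius `r ≥ 0` with uniform small-ball Haar mass `m₀ > 0` (`Haar{‖ρ g − ρ h‖_F ≤ r} ≥ m₀` for all `h`) and `t ≥ 0`:
`E_{γ_Λ(·|η)} A_Λ ≤ A_Λ(ζ₀ ∨ η) + 4√N·#touching·r + (#Λ·log(1/m₀) + t)/β + 2N·#touching·e^{−t}`. -/
theorem ymSpecification_mean_action_le_ref (hρ : Continuous ρ)
    (hρu : ∀ g, ρ g ∈ Matrix.unitaryGroup (Fin N) ℂ) {β : ℝ} (hβ : 0 < β)
    (Λ : Finset (ZdEdge d)) (η : LGConfig d G) (ζ₀ : ↥Λ → G) {r m₀ t : ℝ} (hr : 0 ≤ r) (hm₀ : 0 < m₀)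
    (hball : ∀ h : G, m₀ ≤ (haarProbability G).real {g | ‖ρ g - ρ h‖ ≤ r}) (ht : 0 ≤ t) :
    ∫ U, wilsonBoundaryAction ρ Λ U ∂(ymSpecification ρ β Λ η) ≤
      wilsonBoundaryAction ρ Λ (glueWith Λ ζ₀ η) + 4 * Real.sqrt N * (plaquettesTouching Λ).card * r +
        ((Λ.card : ℝ) * Real.log (1 / m₀) + t) / β + 2 * N * (plaquettesTouching Λ).card * Real.exp (-t) := by
  set π := (Measure.pi fun _ : ↥Λ => haarProbability G).map (glueWith Λ · η) with hπ
  set s := wilsonBoundaryAction ρ Λ (glueWith Λ ζ₀ η) + 4 * Real.sqrt N * (plaquettesTouching Λ).card * r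
    with hs_def
  have hs0 : 0 ≤ s := add_nonneg (wilsonBoundaryAction_nonneg ρ hρu Λ _) (by positivity)
  have hball_sub : (Set.pi Set.univ fun e : ↥Λ => {g | ‖ρ g - ρ (ζ₀ e)‖ ≤ r}) ⊆
      (glueWith Λ · η) ⁻¹' {U | wilsonBoundaryAction ρ Λ U ≤ s} := by
    intro ζ hζ
    simp only [Set.mem_preimage, Set.mem_setOf_eq]
    refine wilsonBoundaryAction_le_of_ball ρ hρu Λ hr (fun e he => ?_) (fun e he => ?_)
    · rw [glueWith_apply_mem Λ ζ η he, glueWith_apply_mem Λ ζ₀ η he]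
      exact (Set.mem_univ_pi.1 hζ) ⟨e, he⟩
    · rw [glueWith_apply_not_mem Λ ζ η he, glueWith_apply_not_mem Λ ζ₀ η he]
  have hmass : m₀ ^ Λ.card ≤ π.real {U | wilsonBoundaryAction ρ Λ U ≤ s} := by
    have hmeas : MeasurableSet {U | wilsonBoundaryAction ρ Λ U ≤ s} :=
      measurableSet_le (continuous_wilsonBoundaryAction ρ hρ Λ).measurable measurable_const
    rw [hπ, measureReal_def, Measure.map_apply (measurable_glueWith Λ η) hmeas, ← measureReal_def]
    exact (pi_real_ball_ge ρ Λ ζ₀ hm₀.le hball).trans (measureReal_mono hball_sub)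
  have hpos : 0 < π.real {U | wilsonBoundaryAction ρ Λ U ≤ s} := lt_of_lt_of_le (pow_pos hm₀ _) hmass
  have hmain := ymSpecification_mean_action_le ρ hρ hρu hβ Λ η hs0 ht hpos
  have hlog : Real.log (1 / π.real {U | wilsonBoundaryAction ρ Λ U ≤ s}) ≤ Λ.card * Real.log (1 / m₀) := by
    have h1 : 1 / π.real {U | wilsonBoundaryAction ρ Λ U ≤ s} ≤ 1 / m₀ ^ Λ.card :=
      one_div_le_one_div_of_le (pow_pos hm₀ _) hmass
    calc Real.log (1 / π.real {U | wilsonBoundaryAction ρ Λ U ≤ s}) ≤ Real.log (1 / m₀ ^ Λ.card) :=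
          Real.log_le_log (one_div_pos.2 hpos) h1
      _ = Λ.card * Real.log (1 / m₀) := by rw [← one_div_pow, Real.log_pow]
  have hdiv : (Real.log (1 / π.real {U | wilsonBoundaryAction ρ Λ U ≤ s}) + t) / β ≤
      ((Λ.card : ℝ) * Real.log (1 / m₀) + t) / β := by gcongr
  linarith [hmain, hdiv]


open Summit.QuantumFields.YangMills.Theorems.FreeEnergyLogCoefficient (dimE exists_haar_gball_ge)

omit [SecondCountableTopology G] in
/-- Haar balls around any centre are at least as heavy as the ball around `1` (left invariance + unitary invariance of
the Frobenius norm; PROVED). -/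
theorem haar_ball_one_le_ball (hρu : ∀ g, ρ g ∈ Matrix.unitaryGroup (Fin N) ℂ) (h : G) (r : ℝ) :
    haarProbability G {g | ‖ρ g - 1‖ ≤ r} ≤ haarProbability G {g | ‖ρ g - ρ h‖ ≤ r} := by
  haveI : (haarProbability G).IsMulLeftInvariant := by unfold haarProbability; infer_instance
  have hsub : {g : G | ‖ρ g - 1‖ ≤ r} ⊆ (fun g => h * g) ⁻¹' {g | ‖ρ g - ρ h‖ ≤ r} := by
    intro g hg
    simp only [Set.mem_preimage, Set.mem_setOf_eq] at hg ⊢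
    have e : ρ (h * g) - ρ h = ρ h * (ρ g - 1) := by rw [map_mul, mul_sub, mul_one]
    rw [e, Matrix.frobenius_norm_unitaryGroup_mul ⟨ρ h, hρu h⟩]
    exact hg
  calc haarProbability G {g | ‖ρ g - 1‖ ≤ r} ≤ haarProbability G ((fun g => h * g) ⁻¹' {g | ‖ρ g - ρ h‖ ≤ r}) :=
        measure_mono hsub
    _ = haarProbability G {g | ‖ρ g - ρ h‖ ≤ r} := measure_preimage_mul _ _ _

omit [SecondCountableTopology G] in
/-- **Uniform small-ball Haar mass (PROVED from the tree's `exists_haar_gball_ge`, Chatterjee Cor. 6.3):** for a faithful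
unitary `ρ` there is `C > 0` with `Haar{g | ‖ρ g − ρ h‖_F ≤ δ} ≥ C δ^{dimE ρ}` for all centres `h` and `0 < δ ≤ 1`. -/
theorem exists_haar_ball_center_ge (hρ : Continuous ρ) (hρi : Function.Injective ρ)
    (hρu : ∀ g, ρ g ∈ Matrix.unitaryGroup (Fin N) ℂ) :
    ∃ C : ℝ, 0 < C ∧ ∀ δ : ℝ, 0 < δ → δ ≤ 1 → ∀ h : G,
      C * δ ^ dimE ρ ≤ (haarProbability G).real {g | ‖ρ g - ρ h‖ ≤ δ} := by
  obtain ⟨C, hC, hball⟩ := exists_haar_gball_ge ρ hρ hρi hρu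
  refine ⟨C, hC, fun δ hδ hδ1 h => ?_⟩
  have h1 := (hball δ hδ hδ1).trans (haar_ball_one_le_ball ρ hρu h δ)
  rw [measureReal_def]
  exact (ENNReal.ofReal_le_iff_le_toReal (measure_ne_top _ _)).1 h1



end Ref

section RefAssembly

open scoped Matrix Matrix.Norms.Frobenius
open Literature.MathematicalPhysics.QuantumFieldTheory (haarProbability wilsonMeasure GaugeConfig isProbabilityMeasure_wilsonMeasure)
open Summit.QuantumFields.YangMills.Theorems.TunedSequenceExists.Negative.Freezing (integrable_of_continuous)
open Summit.QuantumFields.YangMills.Theorems.FreeEnergyLogCoefficient (dimE exists_haar_gball_ge)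

variable {G : Type} [Group G] [TopologicalSpace G] [IsTopologicalGroup G] [CompactSpace G]
  [SecondCountableTopology G] [MeasurableSpace G] [BorelSpace G]
  {N : ℕ} (ρ : G →* Matrix (Fin N) (Fin N) ℂ)

/-- `1 ≤ log β` for `β ≥ 3`. -/
theorem one_le_log_of_three_le {β : ℝ} (hβ : 3 ≤ β) : 1 ≤ Real.log β := by
  have hβ0 : 0 < β := by linarith
  rw [Real.le_log_iff_exp_le hβ0]
  have := Real.exp_one_lt_d9
  norm_num at this
  linarith

/-- **The kernel-mean action against a reference filling, with the rates (PROVED):** there is `K = K(ρ)` such that for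
`β ≥ 3` and EVERY `b, V` and every reference filling `ζ₀` of `Λ = rowRegion b n`:
`kernelAction V ≤ A_Λ(ζ₀ ∨ σ'_V) + K · (#Λ + #touching(Λ) + 1) · log β / β`
(`ymSpecification_mean_action_le_ref` at `r = 1/β`, `m₀ = C β^{−dimE ρ}`, `t = log β`). -/
theorem kernelAction_le_ref (hρ : Continuous ρ) (hρi : Function.Injective ρ)
    (hρu : ∀ g, ρ g ∈ Matrix.unitaryGroup (Fin N) ℂ) (n : ℕ) (k₀ : G) :
    ∃ K : ℝ, 0 < K ∧ ∀ β : ℝ, 3 ≤ β → ∀ (b : ℕ) (V : GaugeConfig 4 (2 * ((2 * n + 2) * b + 1) + 1) G)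
      (ζ₀ : ↥(rowRegion b n) → G),
      kernelAction ρ β b n k₀ V ≤
        wilsonBoundaryAction ρ (rowRegion b n) (glueWith (rowRegion b n) ζ₀
          (twistΦ b (comb b ((2 * n + 2) * b + 1) k₀) (torusLift (2 * ((2 * n + 2) * b + 1) + 1) V))) +
        K * ((rowRegion b n).card + (plaquettesTouching (rowRegion b n)).card + 1) * (Real.log β / β) := by
  obtain ⟨C, hC, hball⟩ := exists_haar_ball_center_ge ρ hρ hρi hρu
  refine ⟨4 * Real.sqrt N + 2 * N + dimE ρ + |Real.log C| + 1, by positivity, fun β hβ b V ζ₀ => ?_⟩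
  have hβ0 : 0 < β := by linarith
  have hβ1 : 1 ≤ β := by linarith
  have hlog1 : 1 ≤ Real.log β := one_le_log_of_three_le hβ
  have hL0 : 0 < Real.log β / β := div_pos (by linarith) hβ0
  have hr : (0 : ℝ) ≤ 1 / β := by positivity
  have hδ : (0 : ℝ) < 1 / β := by positivity
  have hδ1 : 1 / β ≤ 1 := by rw [div_le_one hβ0]; exact hβ1
  have hm₀pos : 0 < C * (1 / β) ^ dimE ρ := by positivity
  have hballr : ∀ h : G, C * (1 / β) ^ dimE ρ ≤ (haarProbability G).real {g | ‖ρ g - ρ h‖ ≤ 1 / β} :=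
    fun h => hball _ hδ hδ1 h
  have ht0 : 0 ≤ Real.log β := by linarith
  have key := ymSpecification_mean_action_le_ref ρ hρ hρu hβ0 (rowRegion b n)
    (twistΦ b (comb b ((2 * n + 2) * b + 1) k₀) (torusLift (2 * ((2 * n + 2) * b + 1) + 1) V)) ζ₀ hr hm₀pos hballr ht0
  have hT0 : (0 : ℝ) ≤ (plaquettesTouching (rowRegion b n)).card := by positivity
  have hΛc0 : (0 : ℝ) ≤ (rowRegion b n).card := by positivity
  have hD0 : (0 : ℝ) ≤ dimE ρ := by positivity
  have hexp : Real.exp (-Real.log β) = 1 / β := by rw [Real.exp_neg, Real.exp_log hβ0, one_div]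
  have hlogm : Real.log (1 / (C * (1 / β) ^ dimE ρ)) ≤ ((dimE ρ : ℝ) + |Real.log C|) * Real.log β := by
    have e : Real.log (1 / (C * (1 / β) ^ dimE ρ)) = (dimE ρ : ℝ) * Real.log β - Real.log C := by
      rw [one_div, Real.log_inv, Real.log_mul hC.ne' (pow_ne_zero _ hδ.ne'), Real.log_pow, one_div, Real.log_inv]
      ring
    rw [e]
    have h1 : -Real.log C ≤ |Real.log C| * Real.log β := by
      calc -Real.log C ≤ |Real.log C| := neg_le_abs _
        _ = |Real.log C| * 1 := (mul_one _).symm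
        _ ≤ |Real.log C| * Real.log β := mul_le_mul_of_nonneg_left hlog1 (abs_nonneg _)
    linarith
  have h1β : 1 / β ≤ Real.log β / β := div_le_div_of_nonneg_right hlog1 hβ0.le
  have e1 : 4 * Real.sqrt N * ((plaquettesTouching (rowRegion b n)).card : ℝ) * (1 / β) ≤
      4 * Real.sqrt N * ((plaquettesTouching (rowRegion b n)).card : ℝ) * (Real.log β / β) :=
    mul_le_mul_of_nonneg_left h1β (by positivity)
  have e2 : (((rowRegion b n).card : ℝ) * Real.log (1 / (C * (1 / β) ^ dimE ρ)) + Real.log β) / β ≤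
      (((rowRegion b n).card : ℝ) * ((dimE ρ : ℝ) + |Real.log C|) + 1) * (Real.log β / β) := by
    have h2 : ((rowRegion b n).card : ℝ) * Real.log (1 / (C * (1 / β) ^ dimE ρ)) + Real.log β ≤
        (((rowRegion b n).card : ℝ) * ((dimE ρ : ℝ) + |Real.log C|) + 1) * Real.log β := by
      have := mul_le_mul_of_nonneg_left hlogm hΛc0
      linarith
    calc (((rowRegion b n).card : ℝ) * Real.log (1 / (C * (1 / β) ^ dimE ρ)) + Real.log β) / β
        = (((rowRegion b n).card : ℝ) * Real.log (1 / (C * (1 / β) ^ dimE ρ)) + Real.log β) * (1 / β) := by ring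
      _ ≤ ((((rowRegion b n).card : ℝ) * ((dimE ρ : ℝ) + |Real.log C|) + 1) * Real.log β) * (1 / β) :=
          mul_le_mul_of_nonneg_right h2 (by positivity)
      _ = (((rowRegion b n).card : ℝ) * ((dimE ρ : ℝ) + |Real.log C|) + 1) * (Real.log β / β) := by ring
  have e3 : 2 * N * ((plaquettesTouching (rowRegion b n)).card : ℝ) * Real.exp (-Real.log β) ≤
      2 * N * ((plaquettesTouching (rowRegion b n)).card : ℝ) * (Real.log β / β) := by
    rw [hexp]; exact mul_le_mul_of_nonneg_left h1β (by positivity)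
  have hcoef : 4 * Real.sqrt N * ((plaquettesTouching (rowRegion b n)).card : ℝ) +
      (((rowRegion b n).card : ℝ) * ((dimE ρ : ℝ) + |Real.log C|) + 1) +
      2 * N * ((plaquettesTouching (rowRegion b n)).card : ℝ) ≤
      (4 * Real.sqrt N + 2 * N + dimE ρ + |Real.log C| + 1) *
        (((rowRegion b n).card : ℝ) + (plaquettesTouching (rowRegion b n)).card + 1) := by
    have hN0 : (0 : ℝ) ≤ N := Nat.cast_nonneg N
    have hs0 : (0 : ℝ) ≤ Real.sqrt N := Real.sqrt_nonneg _
    have ha0 : (0 : ℝ) ≤ |Real.log C| := abs_nonneg _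
    nlinarith [mul_nonneg hT0 hD0, mul_nonneg hT0 ha0, mul_nonneg hΛc0 hs0, mul_nonneg hΛc0 hN0,
      mul_nonneg hs0 hΛc0, hT0, hΛc0, hD0]
  have hfin := mul_le_mul_of_nonneg_right hcoef hL0.le
  have hsum : 4 * Real.sqrt N * ((plaquettesTouching (rowRegion b n)).card : ℝ) * (Real.log β / β) +
      (((rowRegion b n).card : ℝ) * ((dimE ρ : ℝ) + |Real.log C|) + 1) * (Real.log β / β) +
      2 * N * ((plaquettesTouching (rowRegion b n)).card : ℝ) * (Real.log β / β) ≤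
      (4 * Real.sqrt N + 2 * N + dimE ρ + |Real.log C| + 1) *
        (((rowRegion b n).card : ℝ) + (plaquettesTouching (rowRegion b n)).card + 1) * (Real.log β / β) := by
    have e : 4 * Real.sqrt N * ((plaquettesTouching (rowRegion b n)).card : ℝ) * (Real.log β / β) +
      (((rowRegion b n).card : ℝ) * ((dimE ρ : ℝ) + |Real.log C|) + 1) * (Real.log β / β) +
      2 * N * ((plaquettesTouching (rowRegion b n)).card : ℝ) * (Real.log β / β) =
      (4 * Real.sqrt N * ((plaquettesTouching (rowRegion b n)).card : ℝ) +
      (((rowRegion b n).card : ℝ) * ((dimE ρ : ℝ) + |Real.log C|) + 1) +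
      2 * N * ((plaquettesTouching (rowRegion b n)).card : ℝ)) * (Real.log β / β) := by ring
    rw [e]; exact hfin
  unfold kernelAction
  linarith [key, e1, e2, e3, hsum]

set_option maxHeartbeats 400000 in
/-- **K1‴ ⇐ (reference-filling energy in μ-mean) ∧ (region counts) (PROVED):** the final assembly — integrate
`kernelAction_le_ref` against `μ_{L_b,β}`. -/
theorem integral_kernelAction_le_of_ref (hρ : Continuous ρ) (hρi : Function.Injective ρ)
    (hρu : ∀ g, ρ g ∈ Matrix.unitaryGroup (Fin N) ℂ) {n : ℕ} {k₀ : G}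
    (hcount : ∃ C₀ : ℝ, ∀ b : ℕ, 1 ≤ b →
      ((rowRegion b n).card : ℝ) + (plaquettesTouching (rowRegion b n)).card + 1 ≤ C₀ * (b : ℝ) ^ 4)
    (href : ∃ C₁ : ℝ, 0 < C₁ ∧ ∃ β₂ : ℝ, ∀ β : ℝ, β₂ ≤ β → ∀ b : ℕ, 1 ≤ b →
      ∃ ζ₀ : GaugeConfig 4 (2 * ((2 * n + 2) * b + 1) + 1) G → (↥(rowRegion b n) → G),
        Measurable (fun V => wilsonBoundaryAction ρ (rowRegion b n) (glueWith (rowRegion b n) (ζ₀ V)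
          (twistΦ b (comb b ((2 * n + 2) * b + 1) k₀) (torusLift (2 * ((2 * n + 2) * b + 1) + 1) V)))) ∧
        ∫ V, wilsonBoundaryAction ρ (rowRegion b n) (glueWith (rowRegion b n) (ζ₀ V)
          (twistΦ b (comb b ((2 * n + 2) * b + 1) k₀) (torusLift (2 * ((2 * n + 2) * b + 1) + 1) V)))
          ∂(wilsonMeasure (d := 4) (L := 2 * ((2 * n + 2) * b + 1) + 1) ρ β) ≤ C₁ * (b : ℝ) ^ 5 * (Real.log β / β)) :
    ∃ C : ℝ, 0 < C ∧ ∃ β₁ : ℝ, ∀ β : ℝ, β₁ ≤ β → ∀ b : ℕ, 1 ≤ b →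
      ∫ V, kernelAction ρ β b n k₀ V ∂(wilsonMeasure (d := 4) (L := 2 * ((2 * n + 2) * b + 1) + 1) ρ β) ≤
        C * (b : ℝ) ^ 5 * (Real.log β / β) := by
  obtain ⟨K, hK, hpt⟩ := kernelAction_le_ref ρ hρ hρi hρu n k₀
  obtain ⟨C₀, hC₀⟩ := hcount
  obtain ⟨C₁, hC₁, β₂, href⟩ := href
  have hC₀1 : 1 ≤ C₀ := by
    have h := hC₀ 1 le_rfl
    have h0 : (0 : ℝ) ≤ ((rowRegion 1 n).card : ℝ) + (plaquettesTouching (rowRegion 1 n)).card := by positivity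
    simp only [Nat.cast_one, one_pow, mul_one] at h
    linarith
  have hC₀0 : 0 ≤ C₀ := by linarith
  refine ⟨C₁ + K * C₀, by positivity, max β₂ 3, fun β hβ b hb => ?_⟩
  have hβ2 : β₂ ≤ β := (le_max_left _ _).trans hβ
  have hβ3 : (3 : ℝ) ≤ β := (le_max_right _ _).trans hβ
  have hβ0 : 0 < β := by linarith
  have hL0 : 0 ≤ Real.log β / β := div_nonneg (by linarith [one_le_log_of_three_le hβ3]) hβ0.le
  obtain ⟨ζ₀, hmeas, hint⟩ := href β hβ2 b hb
  haveI : IsProbabilityMeasure (wilsonMeasure (d := 4) (L := 2 * ((2 * n + 2) * b + 1) + 1) ρ β) :=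
    isProbabilityMeasure_wilsonMeasure ρ hρ β
  have hb1 : (1 : ℝ) ≤ b := by exact_mod_cast hb
  have hKC : 0 ≤ K * C₀ * (Real.log β / β) := mul_nonneg (mul_nonneg hK.le hC₀0) hL0
  have hptV : ∀ V : GaugeConfig 4 (2 * ((2 * n + 2) * b + 1) + 1) G, kernelAction ρ β b n k₀ V ≤
      wilsonBoundaryAction ρ (rowRegion b n) (glueWith (rowRegion b n) (ζ₀ V)
        (twistΦ b (comb b ((2 * n + 2) * b + 1) k₀) (torusLift (2 * ((2 * n + 2) * b + 1) + 1) V))) +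
        K * C₀ * (Real.log β / β) * (b : ℝ) ^ 4 := fun V => by
    have h := hpt β hβ3 b V (ζ₀ V)
    have hc : K * (((rowRegion b n).card : ℝ) + (plaquettesTouching (rowRegion b n)).card + 1) * (Real.log β / β) ≤
        K * (C₀ * (b : ℝ) ^ 4) * (Real.log β / β) :=
      mul_le_mul_of_nonneg_right (mul_le_mul_of_nonneg_left (hC₀ b hb) hK.le) hL0
    have e : K * (C₀ * (b : ℝ) ^ 4) * (Real.log β / β) = K * C₀ * (Real.log β / β) * (b : ℝ) ^ 4 := by ring
    linarith [h, hc, e.le, e.ge]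
  have hintK : Integrable (kernelAction ρ β b n k₀) (wilsonMeasure (d := 4) (L := 2 * ((2 * n + 2) * b + 1) + 1) ρ β) :=
    integrable_of_continuous _ (continuous_kernelAction ρ hρ hρu β b n k₀)
  have hintA : Integrable (fun V => wilsonBoundaryAction ρ (rowRegion b n) (glueWith (rowRegion b n) (ζ₀ V)
        (twistΦ b (comb b ((2 * n + 2) * b + 1) k₀) (torusLift (2 * ((2 * n + 2) * b + 1) + 1) V))))
      (wilsonMeasure (d := 4) (L := 2 * ((2 * n + 2) * b + 1) + 1) ρ β) :=
    Integrable.of_bound hmeas.aestronglyMeasurable (2 * N * (plaquettesTouching (rowRegion b n)).card)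
      (ae_of_all _ fun V => by
        rw [Real.norm_eq_abs, abs_of_nonneg (wilsonBoundaryAction_nonneg ρ hρu _ _)]
        exact wilsonBoundaryAction_le_card ρ hρu _ _)
  have hintS : Integrable (fun V => wilsonBoundaryAction ρ (rowRegion b n) (glueWith (rowRegion b n) (ζ₀ V)
        (twistΦ b (comb b ((2 * n + 2) * b + 1) k₀) (torusLift (2 * ((2 * n + 2) * b + 1) + 1) V))) +
        K * C₀ * (Real.log β / β) * (b : ℝ) ^ 4) (wilsonMeasure (d := 4) (L := 2 * ((2 * n + 2) * b + 1) + 1) ρ β) :=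
    hintA.add (integrable_const _)
  have h45 : (b : ℝ) ^ 4 ≤ (b : ℝ) ^ 5 := pow_le_pow_right₀ hb1 (by norm_num)
  have hgrow := mul_le_mul_of_nonneg_left h45 hKC
  calc ∫ V, kernelAction ρ β b n k₀ V ∂(wilsonMeasure (d := 4) (L := 2 * ((2 * n + 2) * b + 1) + 1) ρ β)
      ≤ ∫ V, (wilsonBoundaryAction ρ (rowRegion b n) (glueWith (rowRegion b n) (ζ₀ V)
          (twistΦ b (comb b ((2 * n + 2) * b + 1) k₀) (torusLift (2 * ((2 * n + 2) * b + 1) + 1) V))) +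
          K * C₀ * (Real.log β / β) * (b : ℝ) ^ 4)
          ∂(wilsonMeasure (d := 4) (L := 2 * ((2 * n + 2) * b + 1) + 1) ρ β) :=
        integral_mono hintK hintS hptV
    _ = ∫ V, wilsonBoundaryAction ρ (rowRegion b n) (glueWith (rowRegion b n) (ζ₀ V)
          (twistΦ b (comb b ((2 * n + 2) * b + 1) k₀) (torusLift (2 * ((2 * n + 2) * b + 1) + 1) V)))
          ∂(wilsonMeasure (d := 4) (L := 2 * ((2 * n + 2) * b + 1) + 1) ρ β) +
          K * C₀ * (Real.log β / β) * (b : ℝ) ^ 4 := by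
        rw [integral_add hintA (integrable_const _), integral_const, probReal_univ, one_smul]
    _ ≤ C₁ * (b : ℝ) ^ 5 * (Real.log β / β) + K * C₀ * (Real.log β / β) * (b : ℝ) ^ 5 := add_le_add hint hgrow
    _ = (C₁ + K * C₀) * (b : ℝ) ^ 5 * (Real.log β / β) := by ring




end RefAssembly

/-! ## §4k (PROVED; rev 10) Region counts: `#Λ_b + #touching(Λ_b) + 1 ≤ C₀(n) b⁴` (R3) -/

section Counts

/-- A cell of the standard mesh-`b` frame has at most `64 b⁴` edges. -/
theorem card_cellEdges_stdFrame_le (b : ℕ) (y : Fin 4 → ℤ) : (cellEdges (stdFrame b) y).card ≤ 64 * b ^ 4 := by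
  have hwid : ∀ i ∈ (Finset.univ : Finset (Fin 4)),
      (Finset.Ico (stdFrame b i (y i)) (stdFrame b i (y i + 1))).card ≤ 2 * b := by
    intro i _
    rw [Int.card_Ico]
    have h := (stdFrame_admissible b i (y i)).2
    omega
  rw [Summit.QuantumFields.YangMills.Cruxes.IR.Tempered.cellEdges, Finset.card_product, Fintype.card_piFinset,
    Finset.card_univ, Fintype.card_fin]
  calc (∏ i : Fin 4, (Finset.Ico (stdFrame b i (y i)) (stdFrame b i (y i + 1))).card) * 4
      ≤ (∏ _i : Fin 4, 2 * b) * 4 :=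
        Nat.mul_le_mul_right 4 (Finset.prod_le_prod (fun i _ => Nat.zero_le _) hwid)
    _ = 64 * b ^ 4 := by rw [Finset.prod_const, Finset.card_univ, Fintype.card_fin]; ring

/-- `#rowRegion b n ≤ #rowCells n · 64 b⁴`. -/
theorem card_rowRegion_le (b n : ℕ) : (rowRegion b n).card ≤ (rowCells n).card * (64 * b ^ 4) := by
  unfold rowRegion Summit.QuantumFields.YangMills.Cruxes.IR.Tempered.regionEdges
  calc ((rowCells n).biUnion (cellEdges (stdFrame b))).card ≤ ∑ y ∈ rowCells n, (cellEdges (stdFrame b) y).card :=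
        Finset.card_biUnion_le
    _ ≤ (rowCells n).card • (64 * b ^ 4) :=
        Finset.sum_le_card_nsmul _ _ _ fun y _ => card_cellEdges_stdFrame_le b y
    _ = (rowCells n).card * (64 * b ^ 4) := smul_eq_mul _ _

/-- **Region counts (PROVED):** `#Λ_b + #touching(Λ_b) + 1 ≤ C₀(n) b⁴` for `b ≥ 1`. -/
theorem rowRegion_counts (n : ℕ) : ∃ C₀ : ℝ, ∀ b : ℕ, 1 ≤ b →
    ((rowRegion b n).card : ℝ) + (plaquettesTouching (rowRegion b n)).card + 1 ≤ C₀ * (b : ℝ) ^ 4 := by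
  refine ⟨(rowCells n).card * 64 * (1 + (1 + 4) * Fintype.card {p : Fin 4 × Fin 4 // p.1 < p.2}) + 1,
    fun b hb => ?_⟩
  have h1 : ((rowRegion b n).card : ℝ) ≤ (rowCells n).card * (64 * (b : ℝ) ^ 4) := by
    exact_mod_cast card_rowRegion_le b n
  have h2 : ((plaquettesTouching (rowRegion b n)).card : ℝ) ≤
      (1 + 4) * Fintype.card {p : Fin 4 × Fin 4 // p.1 < p.2} * (rowRegion b n).card := by
    exact_mod_cast card_plaquettesTouching_le (rowRegion b n)
  have hb4 : (1 : ℝ) ≤ (b : ℝ) ^ 4 := one_le_pow₀ (by exact_mod_cast hb)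
  have hP : (0 : ℝ) ≤ Fintype.card {p : Fin 4 × Fin 4 // p.1 < p.2} := by positivity
  have h2' : ((plaquettesTouching (rowRegion b n)).card : ℝ) ≤
      (1 + 4) * Fintype.card {p : Fin 4 × Fin 4 // p.1 < p.2} * ((rowCells n).card * (64 * (b : ℝ) ^ 4)) :=
    h2.trans (mul_le_mul_of_nonneg_left h1 (by positivity))
  have e : ((rowCells n).card * 64 * (1 + (1 + 4) * Fintype.card {p : Fin 4 × Fin 4 // p.1 < p.2}) + 1) * (b : ℝ) ^ 4
      = (rowCells n).card * (64 * (b : ℝ) ^ 4) +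
        (1 + 4) * Fintype.card {p : Fin 4 × Fin 4 // p.1 < p.2} * ((rowCells n).card * (64 * (b : ℝ) ^ 4)) +
        (b : ℝ) ^ 4 := by ring
  rw [e]
  linarith

end Counts

/-! ## §4l (PROVED; rev 11) The reference filling typed (`refFill`, `refConfig`), its continuity, and R1 ⇐ R1d:
integrating a DETERMINISTIC weighted domination against the torus Wilson measure (`AfOnset.exists_plaquetteCost_moments_le`) -/

section Weighted

open scoped Matrix Matrix.Norms.Frobenius
open Literature.MathematicalPhysics.QuantumFieldTheory (wilsonMeasure GaugeConfig isProbabilityMeasure_wilsonMeasure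
  LatticeRep plaquetteCost Plaquette)
open Summit.QuantumFields.YangMills.Theorems.TunedSequenceExists.Negative.Freezing (plaquetteHolonomyZd_torusLift'
  integrable_of_continuous)

variable {G : Type} [Group G] [TopologicalSpace G] [IsTopologicalGroup G] [CompactSpace G]
  [SecondCountableTopology G] [MeasurableSpace G] [BorelSpace G]
  {N : ℕ} (ρ : G →* Matrix (Fin N) (Fin N) ℂ)

/-- **The REFERENCE FILLING** of `Λ = rowRegion b n` (R1's witness): the restriction to `Λ` of the gauge transform of `σ` by
the layer gauge `h = layerGauge_b(comb_b k₀ σ)` (`R = (2n+2)b+1`). -/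
def refFill (b n : ℕ) (k₀ : G) (σ : LGConfig 4 G) : ↥(rowRegion b n) → G :=
  fun e => gaugeTransformZd (layerGauge b (comb b ((2 * n + 2) * b + 1) k₀ σ)) σ e

/-- **The REFERENCE CONFIGURATION**: the reference filling glued to the twisted datum `σ' = topTwist_b(comb_b k₀ σ) σ`. -/
noncomputable def refConfig (b n : ℕ) (k₀ : G) (σ : LGConfig 4 G) : LGConfig 4 G :=
  glueWith (rowRegion b n) (refFill b n k₀ σ) (twistΦ b (comb b ((2 * n + 2) * b + 1) k₀) σ)

omit [CompactSpace G] [SecondCountableTopology G] [MeasurableSpace G] [BorelSpace G] in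
/-- Continuity of the layer gauge of the comb in the configuration. -/
theorem continuous_layerGauge_comb (b R : ℕ) (k₀ : G) (x : Site 4) :
    Continuous fun ζ : LGConfig 4 G => layerGauge b (comb b R k₀ ζ) x := by
  unfold layerGauge
  by_cases hx : x 0 = (b : ℤ) + 1
  · simp only [if_pos hx]; exact continuous_comb b R k₀ x
  · simp only [if_neg hx]; exact continuous_const

omit [CompactSpace G] [SecondCountableTopology G] [MeasurableSpace G] [BorelSpace G] in
/-- **PROVED.** The reference configuration depends continuously on `σ`. -/
theorem continuous_refConfig (b n : ℕ) (k₀ : G) : Continuous (refConfig (G := G) b n k₀) := by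
  refine continuous_pi fun e => ?_
  by_cases he : e ∈ rowRegion b n
  · have h : (fun σ => refConfig b n k₀ σ e) =
        fun σ => gaugeTransformZd (layerGauge b (comb b ((2 * n + 2) * b + 1) k₀ σ)) σ e := by
      funext σ; simp only [refConfig, glueWith, dif_pos he, refFill]
    rw [h]
    unfold gaugeTransformZd
    exact ((continuous_layerGauge_comb _ _ _ _).mul (continuous_apply e)).mul
      (continuous_layerGauge_comb _ _ _ _).inv
  · have h : (fun σ => refConfig b n k₀ σ e) =
        fun σ => topTwist b (comb b ((2 * n + 2) * b + 1) k₀ σ) σ e := by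
      funext σ; simp only [refConfig, glueWith, dif_neg he, twistΦ]
    rw [h]
    exact (continuous_apply e).comp (continuous_twist_comb b _ k₀)

omit [TopologicalSpace G] [IsTopologicalGroup G] [CompactSpace G] [SecondCountableTopology G] [MeasurableSpace G]
  [BorelSpace G] in
/-- The lifted `ℤ⁴` plaquette energy IS the torus plaquette cost (all oriented plaquettes). -/
theorem plaquetteEnergy_torusLift (L : ℕ) (V : GaugeConfig 4 L G) (q : ZdPlaquette 4) :
    (N : ℝ) - plaquetteObs ρ q.1 q.2.1.1 q.2.1.2 (torusLift L V) =
      plaquetteCost ρ V (Torus.proj L q.1, q.2) := by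
  simp only [plaquetteObs, plaquetteHolonomyZd_torusLift', plaquetteCost]

/-- **R1 from R1d (PROVED, rev 11): the `μ`-mean energy of the reference filling.**  Integrate the deterministic
domination against the torus Wilson measure (`σ = lift V`): each oriented plaquette energy of the lift is a torus plaquette
cost with mean `≤ K(1+log β)/β` (`AfOnset.exists_plaquetteCost_moments_le`), so the mean is `≤ (Σ_P w) K(1+log β)/β ≤
(2CK+1) b⁵ log β/β` for `β ≥ 3`; measurability from `continuous_refConfig`. -/
theorem integral_refAction_le_of_weighted (hρ : Continuous ρ) (hρi : Function.Injective ρ)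
    (hρu : ∀ g, ρ g ∈ Matrix.unitaryGroup (Fin N) ℂ) (n : ℕ) (k₀ : G)
    (hW : ∃ C : ℝ, 0 < C ∧ ∀ b : ℕ, 1 ≤ b → ∃ (P : Finset (ZdPlaquette 4)) (w : ZdPlaquette 4 → ℝ),
      (∀ q, 0 ≤ w q) ∧ ∑ q ∈ P, w q ≤ C * (b : ℝ) ^ 5 ∧
      ∀ σ : LGConfig 4 G, wilsonBoundaryAction ρ (rowRegion b n) (refConfig b n k₀ σ) ≤
        ∑ q ∈ P, w q * ((N : ℝ) - plaquetteObs ρ q.1 q.2.1.1 q.2.1.2 σ)) :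
    ∃ C₁ : ℝ, 0 < C₁ ∧ ∃ β₂ : ℝ, ∀ β : ℝ, β₂ ≤ β → ∀ b : ℕ, 1 ≤ b →
      ∃ ζ₀ : GaugeConfig 4 (2 * ((2 * n + 2) * b + 1) + 1) G → (↥(rowRegion b n) → G),
        Measurable (fun V => wilsonBoundaryAction ρ (rowRegion b n) (glueWith (rowRegion b n) (ζ₀ V)
          (twistΦ b (comb b ((2 * n + 2) * b + 1) k₀) (torusLift (2 * ((2 * n + 2) * b + 1) + 1) V)))) ∧
        ∫ V, wilsonBoundaryAction ρ (rowRegion b n) (glueWith (rowRegion b n) (ζ₀ V)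
          (twistΦ b (comb b ((2 * n + 2) * b + 1) k₀) (torusLift (2 * ((2 * n + 2) * b + 1) + 1) V)))
          ∂(wilsonMeasure (d := 4) (L := 2 * ((2 * n + 2) * b + 1) + 1) ρ β) ≤ C₁ * (b : ℝ) ^ 5 * (Real.log β / β) := by
  obtain ⟨C, hC, hCb⟩ := hW
  set r : LatticeRep G := ⟨N, ρ, hρ, hρi, hρu⟩ with hr
  obtain ⟨K, hK0, hmom⟩ := AfOnset.exists_plaquetteCost_moments_le r
  refine ⟨2 * C * K + 1, by positivity, 3, fun β hβ b hb => ?_⟩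
  obtain ⟨P, w, hw0, hwsum, hdom⟩ := hCb b hb
  set S : ℕ := 2 * ((2 * n + 2) * b + 1) + 1 with hS
  refine ⟨fun V => refFill b n k₀ (torusLift S V), ?_, ?_⟩
  · change Measurable fun V : GaugeConfig 4 S G =>
      wilsonBoundaryAction ρ (rowRegion b n) (refConfig b n k₀ (torusLift S V))
    exact ((continuous_wilsonBoundaryAction ρ hρ _).comp
      ((continuous_refConfig b n k₀).comp (continuous_torusLift S))).measurable
  · change ∫ V, wilsonBoundaryAction ρ (rowRegion b n) (refConfig b n k₀ (torusLift S V))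
        ∂(wilsonMeasure (d := 4) (L := S) ρ β) ≤ (2 * C * K + 1) * (b : ℝ) ^ 5 * (Real.log β / β)
    set μ := wilsonMeasure (d := 4) (L := S) ρ β with hμ
    haveI : IsProbabilityMeasure μ := isProbabilityMeasure_wilsonMeasure ρ hρ β
    have hβ0 : 0 < β := by linarith
    have hβ1 : 1 ≤ β := by linarith
    have hlog1 : 1 ≤ Real.log β := by
      rw [Real.le_log_iff_exp_le hβ0]
      have := Real.exp_one_lt_d9; norm_num at this; linarith
    have hL1 : 1 ≤ (2 * n + 2) * b + 1 := by omega
    -- the plaquette energies of the lift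
    have hφcont : ∀ q : ZdPlaquette 4, Continuous fun V : GaugeConfig 4 S G =>
        (N : ℝ) - plaquetteObs ρ q.1 q.2.1.1 q.2.1.2 (torusLift S V) := fun q =>
      continuous_const.sub ((continuous_plaquetteObs ρ hρ _ _ _).comp (continuous_torusLift S))
    have hφint : ∀ q : ZdPlaquette 4, Integrable (fun V : GaugeConfig 4 S G =>
        (N : ℝ) - plaquetteObs ρ q.1 q.2.1.1 q.2.1.2 (torusLift S V)) μ := fun q =>
      integrable_of_continuous μ (hφcont q)
    have hφmean : ∀ q : ZdPlaquette 4,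
        ∫ V, ((N : ℝ) - plaquetteObs ρ q.1 q.2.1.1 q.2.1.2 (torusLift S V)) ∂μ ≤ K * (1 + Real.log β) / β := by
      intro q
      have h := (hmom ((2 * n + 2) * b + 1) hL1 β hβ1 (Torus.proj S q.1, q.2)).1
      have heq : ∫ V, ((N : ℝ) - plaquetteObs ρ q.1 q.2.1.1 q.2.1.2 (torusLift S V)) ∂μ =
          ∫ V, plaquetteCost r.ρ V (Torus.proj S q.1, q.2) ∂μ :=
        integral_congr_ae (ae_of_all _ fun V => plaquetteEnergy_torusLift ρ S V q)
      rw [heq]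
      exact h
    -- integrate the domination
    have hintA : Integrable (fun V : GaugeConfig 4 S G =>
        wilsonBoundaryAction ρ (rowRegion b n) (refConfig b n k₀ (torusLift S V))) μ :=
      integrable_of_continuous μ ((continuous_wilsonBoundaryAction ρ hρ _).comp
        ((continuous_refConfig b n k₀).comp (continuous_torusLift S)))
    have hintS : Integrable (fun V : GaugeConfig 4 S G =>
        ∑ q ∈ P, w q * ((N : ℝ) - plaquetteObs ρ q.1 q.2.1.1 q.2.1.2 (torusLift S V))) μ :=
      integrable_finsetSum P fun q _ => (hφint q).const_mul (w q)
    have hpt : ∀ V : GaugeConfig 4 S G,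
        wilsonBoundaryAction ρ (rowRegion b n) (refConfig b n k₀ (torusLift S V)) ≤
          ∑ q ∈ P, w q * ((N : ℝ) - plaquetteObs ρ q.1 q.2.1.1 q.2.1.2 (torusLift S V)) := fun V =>
      hdom (torusLift S V)
    have hKβ : 0 ≤ K * (1 + Real.log β) / β := by positivity
    have hb5 : (0 : ℝ) ≤ C * (b : ℝ) ^ 5 := by positivity
    have hkey : K * (1 + Real.log β) ≤ 2 * K * Real.log β := by nlinarith [hK0, hlog1]
    have hnn : (0 : ℝ) ≤ (b : ℝ) ^ 5 * (Real.log β / β) :=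
      mul_nonneg (pow_nonneg (Nat.cast_nonneg _) _) (div_nonneg (by linarith) hβ0.le)
    calc ∫ V, wilsonBoundaryAction ρ (rowRegion b n) (refConfig b n k₀ (torusLift S V)) ∂μ
        ≤ ∫ V, ∑ q ∈ P, w q * ((N : ℝ) - plaquetteObs ρ q.1 q.2.1.1 q.2.1.2 (torusLift S V)) ∂μ :=
          integral_mono hintA hintS hpt
      _ = ∑ q ∈ P, w q * ∫ V, ((N : ℝ) - plaquetteObs ρ q.1 q.2.1.1 q.2.1.2 (torusLift S V)) ∂μ := by
          rw [integral_finsetSum P fun q _ => (hφint q).const_mul (w q)]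
          refine Finset.sum_congr rfl fun q _ => ?_
          exact integral_const_mul _ _
      _ ≤ ∑ q ∈ P, w q * (K * (1 + Real.log β) / β) :=
          Finset.sum_le_sum fun q _ => mul_le_mul_of_nonneg_left (hφmean q) (hw0 q)
      _ = (∑ q ∈ P, w q) * (K * (1 + Real.log β) / β) := by rw [Finset.sum_mul]
      _ ≤ C * (b : ℝ) ^ 5 * (K * (1 + Real.log β) / β) := mul_le_mul_of_nonneg_right hwsum hKβ
      _ = C * (b : ℝ) ^ 5 * (K * (1 + Real.log β)) / β := by ring
      _ ≤ C * (b : ℝ) ^ 5 * (2 * K * Real.log β) / β :=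
          div_le_div_of_nonneg_right (mul_le_mul_of_nonneg_left hkey hb5) hβ0.le
      _ = 2 * C * K * ((b : ℝ) ^ 5 * (Real.log β / β)) := by ring
      _ ≤ (2 * C * K + 1) * ((b : ℝ) ^ 5 * (Real.log β / β)) := by nlinarith [hnn]
      _ = (2 * C * K + 1) * (b : ℝ) ^ 5 * (Real.log β / β) := by ring

end Weighted

/-! ## §4m (PROVED; rev 12) Toward R1d: the reference filling IS the twisted configuration (`refConfig_eq_twistΦ`); plaquette
cases under the twist (off the top face: unchanged; top face: a conjugate of the LINK DEFECT enters); the top-face energy bound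
`≤ 4‖ρ(hairpin) − 1‖² + 2φ_p(σ)` for the comb (commutator algebra).  Residual of R1d: hairpin Stokes + Cauchy–Schwarz + counting. -/

section TwistEnergy

open scoped Matrix Matrix.Norms.Frobenius

variable {G : Type} [Group G] {N : ℕ} (ρ : G →* Matrix (Fin N) (Fin N) ℂ)

/-- Edges of the row region are based at heights `≤ b`. -/
theorem height_le_of_mem_rowRegion {b n : ℕ} {e : ZdEdge 4} (he : e ∈ rowRegion b n) : e.1 0 ≤ (b : ℤ) := by
  unfold rowRegion regionEdges at he
  obtain ⟨c, hc, hec⟩ := Finset.mem_biUnion.1 he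
  have hc0 : c 0 = 0 := by unfold rowCells at hc; exact (Finset.mem_filter.1 hc).2
  have h := base_height_of_mem_cellEdges hec
  rw [hc0] at h
  linarith [h.2]

/-- **PROVED — THE REFERENCE FILLING IS THE TWISTED CONFIGURATION.**  On `Λ` (heights `≤ b`) the layer gauge transform IS the
twist (`gaugeTransformZd_layerGauge_apply`), so `refConfig σ = topTwist_b(comb_b k₀ σ) σ = σ'`: R1d is a statement about the
boundary Wilson action OF THE TWISTED CONFIGURATION ITSELF. -/
theorem refConfig_eq_twistΦ (b n : ℕ) (k₀ : G) (σ : LGConfig 4 G) :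
    refConfig b n k₀ σ = twistΦ b (comb b ((2 * n + 2) * b + 1) k₀) σ := by
  funext e
  by_cases he : e ∈ rowRegion b n
  · simp only [refConfig, glueWith, dif_pos he, refFill, twistΦ]
    exact gaugeTransformZd_layerGauge_apply _ _ (height_le_of_mem_rowRegion he)
  · simp only [refConfig, glueWith, dif_neg he]

/-- The twist changes only temporal links. -/
theorem topTwist_apply_of_dir_ne {b : ℕ} (k : Site 4 → G) (U : LGConfig 4 G) {e : ZdEdge 4} (he : e.2 ≠ 0) :
    topTwist b k U e = U e := by
  unfold topTwist; exact if_neg fun h => he h.1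

/-- **PROVED (cases, I).** A plaquette `(x, i, j)` (`j ≠ 0`) that is NOT a top-face plaquette (`¬(i = 0 ∧ x₀ = b)`) has the same
holonomy in the twisted configuration as in `σ` — whatever the twisting field `k`. -/
theorem plaquetteHolonomyZd_topTwist_of_not_topFace (b : ℕ) (k : Site 4 → G) (σ : LGConfig 4 G) (x : Site 4)
    {i j : Fin 4} (hj : j ≠ 0) (h : ¬ (i = 0 ∧ x 0 = (b : ℤ))) :
    plaquetteHolonomyZd (topTwist b k σ) x i j = plaquetteHolonomyZd σ x i j := by
  unfold plaquetteHolonomyZd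
  have e2 : topTwist b k σ (x + Pi.single i 1, j) = σ (x + Pi.single i 1, j) := topTwist_apply_of_dir_ne k σ hj
  have e4 : topTwist b k σ (x, j) = σ (x, j) := topTwist_apply_of_dir_ne k σ hj
  by_cases hi : i = 0
  · have hx : x 0 ≠ (b : ℤ) := fun hx => h ⟨hi, hx⟩
    have e1 : topTwist b k σ (x, i) = σ (x, i) := topTwist_apply_of_ne k σ hx
    have hx' : ((x + Pi.single j (1 : ℤ) : Site 4)) 0 ≠ (b : ℤ) := by
      rw [add_single_apply_zero, if_neg hj, add_zero]; exact hx
    have e3 : topTwist b k σ (x + Pi.single j 1, i) = σ (x + Pi.single j 1, i) := topTwist_apply_of_ne k σ hx'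
    rw [e1, e2, e3, e4]
  · have e1 : topTwist b k σ (x, i) = σ (x, i) := topTwist_apply_of_dir_ne k σ hi
    have e3 : topTwist b k σ (x + Pi.single j 1, i) = σ (x + Pi.single j 1, i) := topTwist_apply_of_dir_ne k σ hi
    rw [e1, e2, e3, e4]

/-- The LINK DEFECT of the twisting field `k` across the layer link `(y, j)`: `k(y)⁻¹ σ(y,j) k(y+e_j) σ(y,j)⁻¹` (`= 1` iff `k` is
covariantly constant along the link). -/
def linkDefect (k : Site 4 → G) (σ : LGConfig 4 G) (y : Site 4) (j : Fin 4) : G :=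
  (k y)⁻¹ * σ (y, j) * k (y + Pi.single j 1) * (σ (y, j))⁻¹

/-- **PROVED (cases, II).** A TOP-FACE plaquette `(x, 0, j)`, `x₀ = b`, `j ≠ 0`: its twisted holonomy is the untwisted one
multiplied by a conjugate of the link defect of `k` across the layer link `(x + e₀, j)`. -/
theorem plaquetteHolonomyZd_topTwist_topFace (b : ℕ) (k : Site 4 → G) (σ : LGConfig 4 G) (x : Site 4) {j : Fin 4}
    (hj : j ≠ 0) (hx : x 0 = (b : ℤ)) :
    plaquetteHolonomyZd (topTwist b k σ) x 0 j =
      σ (x, 0) * linkDefect k σ (x + Pi.single 0 1) j * (σ (x, 0))⁻¹ * plaquetteHolonomyZd σ x 0 j := by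
  unfold plaquetteHolonomyZd linkDefect
  have e1 : topTwist b k σ (x, 0) = σ (x, 0) * (k (x + Pi.single 0 1))⁻¹ := by
    unfold topTwist; exact if_pos ⟨rfl, hx⟩
  have e2 : topTwist b k σ (x + Pi.single 0 1, j) = σ (x + Pi.single 0 1, j) := topTwist_apply_of_dir_ne k σ hj
  have hx' : ((x + Pi.single j (1 : ℤ) : Site 4)) 0 = (b : ℤ) := by
    rw [add_single_apply_zero, if_neg hj, add_zero]; exact hx
  have e3 : topTwist b k σ (x + Pi.single j 1, 0) =
      σ (x + Pi.single j 1, 0) * (k (x + Pi.single j 1 + Pi.single 0 1))⁻¹ := by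
    unfold topTwist; exact if_pos ⟨rfl, hx'⟩
  have e4 : topTwist b k σ (x, j) = σ (x, j) := topTwist_apply_of_dir_ne k σ hj
  rw [e1, e2, e3, e4]
  have hc : x + Pi.single j (1 : ℤ) + Pi.single 0 1 = x + Pi.single 0 1 + Pi.single j 1 := add_right_comm _ _ _
  rw [hc]
  group

/-- **PROVED (algebra, I).** ENERGY OF A TOP-FACE PLAQUETTE of the twisted configuration: `≤ ‖ρ(link defect) − 1‖²_F +
2·φ_p(σ)` (`‖AB − 1‖ ≤ ‖A − 1‖ + ‖B − 1‖` for unitaries, conjugation invariance, `N − Re tr ρ U = ‖ρ U − 1‖²_F/2`). -/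
theorem topFace_energy_le (hρu : ∀ g, ρ g ∈ Matrix.unitaryGroup (Fin N) ℂ) (b : ℕ) (k : Site 4 → G)
    (σ : LGConfig 4 G) (x : Site 4) {j : Fin 4} (hj : j ≠ 0) (hx : x 0 = (b : ℤ)) :
    (N : ℝ) - plaquetteObs ρ x 0 j (topTwist b k σ) ≤
      ‖ρ (linkDefect k σ (x + Pi.single 0 1) j) - 1‖ ^ 2 + 2 * ((N : ℝ) - plaquetteObs ρ x 0 j σ) := by
  unfold plaquetteObs
  rw [plaquetteHolonomyZd_topTwist_topFace b k σ x hj hx, sub_re_trace_eq_norm_sq ρ hρu, sub_re_trace_eq_norm_sq ρ hρu]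
  have h1 : ‖ρ (σ (x, 0) * linkDefect k σ (x + Pi.single 0 1) j * (σ (x, 0))⁻¹ * plaquetteHolonomyZd σ x 0 j) - 1‖ ≤
      ‖ρ (linkDefect k σ (x + Pi.single 0 1) j) - 1‖ + ‖ρ (plaquetteHolonomyZd σ x 0 j) - 1‖ := by
    calc _ ≤ ‖ρ (σ (x, 0) * linkDefect k σ (x + Pi.single 0 1) j * (σ (x, 0))⁻¹) - 1‖ +
          ‖ρ (plaquetteHolonomyZd σ x 0 j) - 1‖ := norm_map_mul_sub_one_le ρ hρu _ _
      _ = _ := by rw [norm_map_conj_sub_one ρ hρu]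
  nlinarith [h1, norm_nonneg (ρ (σ (x, 0) * linkDefect k σ (x + Pi.single 0 1) j * (σ (x, 0))⁻¹ *
    plaquetteHolonomyZd σ x 0 j) - 1), norm_nonneg (ρ (linkDefect k σ (x + Pi.single 0 1) j) - 1),
    norm_nonneg (ρ (plaquetteHolonomyZd σ x 0 j) - 1),
    sq_nonneg (‖ρ (linkDefect k σ (x + Pi.single 0 1) j) - 1‖ - ‖ρ (plaquetteHolonomyZd σ x 0 j) - 1‖)]

/-- The comb HAIRPIN holonomy across the layer link `(y, j)`: `W = stair(y)·σ(y,j)·stair(y+e_j)⁻¹` (a closed staircase loop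
through the comb root; `= 1` for flat `σ` in the layer — `stair_add_single_of_flatZd` — and identically for `j = 3`). -/
def hairpin (b R : ℕ) (σ : LGConfig 4 G) (y : Site 4) (j : Fin 4) : G :=
  stair b R σ y * σ (y, j) * (stair b R σ (y + Pi.single j 1))⁻¹

/-- **PROVED (algebra, II).** The link defect of the COMB is conjugate to the commutator `k₀⁻¹ W k₀ W⁻¹` of `k₀` with the
hairpin holonomy, hence `‖ρ(defect) − 1‖_F ≤ 2‖ρ(W) − 1‖_F`. -/
theorem norm_linkDefect_comb_le (hρu : ∀ g, ρ g ∈ Matrix.unitaryGroup (Fin N) ℂ) (b R : ℕ) (k₀ : G)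
    (σ : LGConfig 4 G) (y : Site 4) (j : Fin 4) :
    ‖ρ (linkDefect (comb b R k₀ σ) σ y j) - 1‖ ≤ 2 * ‖ρ (hairpin b R σ y j) - 1‖ := by
  have hD : linkDefect (comb b R k₀ σ) σ y j =
      (stair b R σ y)⁻¹ * (k₀⁻¹ * hairpin b R σ y j * k₀ * (hairpin b R σ y j)⁻¹) * (stair b R σ y)⁻¹⁻¹ := by
    unfold linkDefect comb hairpin; group
  rw [hD, norm_map_conj_sub_one ρ hρu]
  have h1 := norm_map_mul_sub_one_le ρ hρu (k₀⁻¹ * hairpin b R σ y j * k₀) (hairpin b R σ y j)⁻¹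
  have h2 := norm_map_conj_sub_one ρ hρu k₀⁻¹ (hairpin b R σ y j)
  rw [inv_inv] at h2
  rw [norm_map_inv_sub_one ρ hρu, h2] at h1
  linarith

/-- **PROVED (the top-face bound with the comb).** `energy_p(σ') ≤ 4‖ρ(W_p) − 1‖²_F + 2φ_p(σ)` for every top-face plaquette
`p = (x, 0, j)`, `W_p` the hairpin across the layer link above it.  What remains for R1d: the HAIRPIN STOKES bound
`‖ρ(W) − 1‖_F ≤ Σ_{hairpin plaquettes} ‖ρ(σ_q) − 1‖_F` (`≤ combLen y 2 + combLen y 3 ≤ 4R` plaquettes), Cauchy–Schwarz and counting. -/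
theorem topFace_energy_comb_le (hρu : ∀ g, ρ g ∈ Matrix.unitaryGroup (Fin N) ℂ) (b R : ℕ) (k₀ : G)
    (σ : LGConfig 4 G) (x : Site 4) {j : Fin 4} (hj : j ≠ 0) (hx : x 0 = (b : ℤ)) :
    (N : ℝ) - plaquetteObs ρ x 0 j (topTwist b (comb b R k₀ σ) σ) ≤
      4 * ‖ρ (hairpin b R σ (x + Pi.single 0 1) j) - 1‖ ^ 2 + 2 * ((N : ℝ) - plaquetteObs ρ x 0 j σ) := by
  have h1 := topFace_energy_le ρ hρu b (comb b R k₀ σ) σ x hj hx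
  have h2 := norm_linkDefect_comb_le ρ hρu b R k₀ σ (x + Pi.single 0 1) j
  have h0 := norm_nonneg (ρ (linkDefect (comb b R k₀ σ) σ (x + Pi.single 0 1) j) - 1)
  nlinarith [h1, h2, h0]

/-- **PROVED (cases, I, as energies).** Off the top face the twisted configuration has the plaquette energies of `σ`. -/
theorem energy_topTwist_of_not_topFace (b : ℕ) (k : Site 4 → G) (σ : LGConfig 4 G) (q : ZdPlaquette 4)
    (h : ¬ (q.2.1.1 = 0 ∧ q.1 0 = (b : ℤ))) :
    (N : ℝ) - plaquetteObs ρ q.1 q.2.1.1 q.2.1.2 (topTwist b k σ) = (N : ℝ) - plaquetteObs ρ q.1 q.2.1.1 q.2.1.2 σ := by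
  have hj : q.2.1.2 ≠ 0 := fun h0 => by have := q.2.2; rw [h0] at this; exact (Fin.not_lt_zero _) this
  unfold plaquetteObs
  rw [plaquetteHolonomyZd_topTwist_of_not_topFace b k σ q.1 hj h]

end TwistEnergy

/-! ## §5 Freeze_poly PROVED at exponent `1/4`; the ONE remaining (deterministic) stub R1d (plan + §4m toolkit; `sorry`); R1, K1‴…K1 and the assembled floor `1/7` PROVED from it -/

section Stubs

open Literature.MathematicalPhysics.QuantumFieldTheory (wilsonMeasure GaugeConfig isProbabilityMeasure_wilsonMeasure)

variable {G : Type} [Group G] [TopologicalSpace G] [IsTopologicalGroup G] [CompactSpace G]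
  [SecondCountableTopology G] [MeasurableSpace G] [BorelSpace G]
  {N : ℕ} (ρ : G →* Matrix (Fin N) (Fin N) ℂ)

/-- **Freeze_poly at exponent `1/4` — PROVED** (was STUB in rev 1).  From §4b: `1 − E_{L_b,β}[W ∘ lift] ≤
((b+1)(2n+1)b)²/N · K(1+log β)/β ≤ 8(2n+1)² K b⁴ log β/(Nβ)` (`β ≥ e`), which is `≤ η` whenever
`b ≤ c (β/log β)^{1/4}`, `c = min 1 (ηN / (8(2n+1)²(K+1)))`.  Inputs: the deterministic Stokes inequality
`one_sub_loopObs_le` (this file) and the tree's `AfOnset.exists_plaquetteCost_moments_le` (chessboard ∕ FILS).  The exponent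
`1/4` is what `area² × (energy per plaquette)` gives without using cancellations between plaquettes. -/
theorem loopFreezingPoly_quarter (hρ : Continuous ρ) (hρi : Function.Injective ρ)
    (hρu : ∀ g, ρ g ∈ Matrix.unitaryGroup (Fin N) ℂ) (hN : 1 ≤ N) (n : ℕ) :
    LoopFreezingPoly ρ n (1 / 4) := by
  intro η hη
  obtain ⟨K, hK0, hK⟩ := one_sub_integral_loopObs_le ρ hρ hρi hρu hN
  have hN0 : (0 : ℝ) < N := by exact_mod_cast hN
  set D : ℝ := 8 * (2 * n + 1) ^ 2 * (K + 1) with hD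
  have hD0 : 0 < D := by positivity
  set c : ℝ := min 1 (η * N / D) with hc
  have hc0 : 0 < c := lt_min one_pos (by positivity)
  have hc1 : c ≤ 1 := min_le_left _ _
  have hcD : c ≤ η * N / D := min_le_right _ _
  refine ⟨c, hc0, Real.exp 1, fun β hβ b hb hbc => ?_⟩
  have hβ1 : 1 ≤ β := (Real.one_lt_exp_iff.2 one_pos).le.trans hβ |>.trans' le_rfl
  have hβ0 : 0 < β := by linarith
  have hlog1 : 1 ≤ Real.log β := by
    rw [← Real.log_exp 1]; exact Real.log_le_log (Real.exp_pos 1) hβ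
  have hlog0 : 0 < Real.log β := by linarith
  set L : ℕ := (2 * n + 2) * b + 1 with hL
  have hL1 : 1 ≤ L := by omega
  have hmain := hK L hL1 β hβ1 hb ((2 * n + 1) * b)
  -- b⁴ ≤ c⁴ β / log β ≤ c β / log β
  have hx0 : 0 ≤ β / Real.log β := by positivity
  have hb4 : (b : ℝ) ^ 4 ≤ c * (β / Real.log β) := by
    have h1 : (b : ℝ) ^ 4 ≤ (c * (β / Real.log β) ^ (1 / 4 : ℝ)) ^ 4 :=
      pow_le_pow_left₀ (by positivity) hbc 4
    have h2 : ((β / Real.log β) ^ (1 / 4 : ℝ)) ^ 4 = β / Real.log β := by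
      rw [show (1 / 4 : ℝ) = ((4 : ℕ) : ℝ)⁻¹ by norm_num]
      exact Real.rpow_inv_natCast_pow hx0 (by norm_num)
    have h3 : c ^ 4 ≤ c := by
      calc c ^ 4 ≤ c ^ 1 := pow_le_pow_of_le_one hc0.le hc1 (by norm_num)
        _ = c := pow_one c
    calc (b : ℝ) ^ 4 ≤ c ^ 4 * (β / Real.log β) := by rw [mul_pow, h2] at h1; exact h1
      _ ≤ c * (β / Real.log β) := by gcongr
  -- ((b+1)(2n+1)b)² ≤ 4(2n+1)² b⁴
  have hb1 : (1 : ℝ) ≤ b := by exact_mod_cast hb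
  have hA : (((b + 1 : ℕ) : ℝ) * (((2 * n + 1) * b : ℕ) : ℝ)) ^ 2 ≤ 4 * (2 * n + 1) ^ 2 * (b : ℝ) ^ 4 := by
    push_cast
    have : ((b : ℝ) + 1) ≤ 2 * b := by linarith
    calc (((b : ℝ) + 1) * ((2 * n + 1) * b)) ^ 2 = ((b : ℝ) + 1) ^ 2 * ((2 * n + 1) * b) ^ 2 := by ring
      _ ≤ (2 * (b : ℝ)) ^ 2 * ((2 * n + 1) * b) ^ 2 := by gcongr
      _ = 4 * (2 * n + 1) ^ 2 * (b : ℝ) ^ 4 := by ring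
  -- assemble
  have hlogβ : (1 + Real.log β) / β ≤ 2 * Real.log β / β := by
    gcongr; linarith
  have hfinal : (((b + 1 : ℕ) : ℝ) * (((2 * n + 1) * b : ℕ) : ℝ)) ^ 2 / N * (K * (1 + Real.log β) / β) ≤ η := by
    calc (((b + 1 : ℕ) : ℝ) * (((2 * n + 1) * b : ℕ) : ℝ)) ^ 2 / N * (K * (1 + Real.log β) / β)
        ≤ 4 * (2 * n + 1) ^ 2 * (c * (β / Real.log β)) / N * (K * (2 * Real.log β / β)) := by
          have hK1 : K * (1 + Real.log β) / β ≤ K * (2 * Real.log β / β) := by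
            rw [mul_div_assoc]; exact mul_le_mul_of_nonneg_left hlogβ hK0
          gcongr
          exact hA.trans (by gcongr)
      _ = 8 * (2 * n + 1) ^ 2 * K * c / N := by
          field_simp
          ring
      _ ≤ D * c / N := by
          gcongr
          rw [hD]; nlinarith [sq_nonneg (2 * (n : ℝ) + 1), hK0]
      _ ≤ η := by
          rw [div_le_iff₀ hN0]
          calc D * c ≤ D * (η * N / D) := by gcongr
            _ = η * N := by field_simp
  have hcast : ((b + 1 : ℕ) * ((2 * n + 1) * b : ℕ) : ℝ) = ((b + 1 : ℕ) : ℝ) * (((2 * n + 1) * b : ℕ) : ℝ) := by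
    push_cast; ring
  linarith [hmain, hfinal]


/-- **REV 14: PROVED** over tree terms as `CruxIdea2g7Hairpin.twistAction_le_weighted` in the companion workfile
`Cruxes/IR/CruxIdea2HairpinStokes.lean` rev 3 (06e197071208; NO sorry).  The `sorry` below is an IMPORT PLACEHOLDER ONLY (crux workfiles
cannot import each other and this file is at the size cap); with that file in scope it is replaced by
`obtain ⟨C, hC, h⟩ := CruxIdea2g7Hairpin.twistAction_le_weighted ρ hρu n k₀; refine ⟨C, hC, fun b hb => ?_⟩;
obtain ⟨P, w, hw, hs, hd⟩ := h b hb; exact ⟨P, w, hw, hs, fun σ => by rw [refConfig_eq_twistΦ]; exact hd σ⟩` — the COMBINED CHECK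
(this file + that file inlined + these 4 lines) is `lean check` rc 0 with ZERO sorries (evidence `combined-check.md` on stmt-19354).
(Was:) **STUB R1d — DETERMINISTIC WEIGHTED DOMINATION of the reference filling's boundary action (the ONE remaining input,
rev 11; R1 ⇐ R1d PROVED in §4l; the cases ∕ commutator half PROVED in §4m, rev 12).**  For every `b ≥ 1` there are nonnegative weights `w` on a finite set `P` of (oriented) `ℤ⁴`-plaquettes with
TOTAL WEIGHT `Σ_P w ≤ C b⁵` such that FOR EVERY configuration `σ` (no measure, no `β`):
`A_Λ(refConfig σ) ≤ Σ_{q ∈ P} w_q · (N − Re tr ρ(σ_q))`.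
PLAN (cases + one telescoping + Cauchy–Schwarz + counting): `refConfig σ` equals the gauge transform `h·σ`
(`h = layerGauge_b(comb σ)`) on every edge based at height `≠ b+1` (`gaugeTransformZd_layerGauge_apply`,
`topTwist_eq_gauge_on_rowLayer`) and `σ` on the site layer `b+1`, so every touching plaquette NOT in the top face has energy
`φ_p(σ)` exactly (weight `1`; `plaquetteHolonomyZd_gaugeTransformZd` + conjugation invariance of `Re tr`); a TOP-FACE plaquette
`p = (y,0,j)`, `y₀ = b`, reads the layer link through `k(x)⁻¹σ(x,j)k(x+e_j) = σ(x,j)·[Ad-defect of the HAIRPIN holonomy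
W(x,j) = stair(x)σ(x,j)stair(x+e_j)⁻¹ on k₀]` (`comb = stair⁻¹k₀stair`), `‖ρ(W) − 1‖_F ≤ Σ_{q ∈ hairpin(x,j)} ‖ρ(σ_q) − 1‖_F`
(`norm_list_prod_sub_one_le`, `≤ 4R` plaquettes, `R = (2n+2)b+1`), hence with `N − Re tr ρ U = ‖ρ U − 1‖²_F/2`
(`sub_re_trace_eq_norm_sq`) and Cauchy–Schwarz `energy_p(refConfig σ) ≤ 4(#hairpin + 1) Σ_{q ∈ hairpin ∪ {p}} φ_q(σ)`;
weights: `1` on the `≤ C(n)b⁴` touching plaquettes (§4k) plus `≤ 4(4R+1)·(multiplicity ≤ 2)` per (top-face link, hairpin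
plaquette) incidence, `≤ 3(4n+1)³b³ · (4R+1)` incidences: total `≤ C b⁵`.
RESIDUAL after §4m (which PROVES `refConfig σ = σ'`, the off-top-face invariance `energy_topTwist_of_not_topFace` and the top-face bound
`topFace_energy_comb_le : energy_p(σ') ≤ 4‖ρ(hairpin_p σ) − 1‖² + 2φ_p(σ)`): the HAIRPIN STOKES bound `‖ρ(hairpin b R σ y j) − 1‖_F ≤
Σ_{q ∈ H(y,j)} ‖ρ(σ_q) − 1‖_F` for some `H(y,j)` with `#H ≤ combLen R y 2 + combLen R y 3 ≤ 4R` (`y` in the layer, `InLayer b R y`; two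
staircase strips, cf. `mul_zline_eq_of_flatZd` for the flat case), then Cauchy–Schwarz (`(Σ_{H} a_q)² ≤ #H · Σ a_q²`, `a_q² = 2φ_q`) and the
count of top-face plaquettes touching `Λ` (`≤ #plaquettesTouching Λ ≤ C(n) b⁴` trivially; `≤ 3(4n+1)³b³` sharp).
Why it might fail: only bookkeeping.  Orientation conventions (`i < j` in `ZdPlaquette`) are absorbed by `Re tr ρ(U⁻¹) = Re tr ρ(U)`. -/
theorem refAction_le_weighted (hρu : ∀ g, ρ g ∈ Matrix.unitaryGroup (Fin N) ℂ) (hN : 1 ≤ N) (n : ℕ) (k₀ : G) :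
    ∃ C : ℝ, 0 < C ∧ ∀ b : ℕ, 1 ≤ b → ∃ (P : Finset (ZdPlaquette 4)) (w : ZdPlaquette 4 → ℝ),
      (∀ q, 0 ≤ w q) ∧ ∑ q ∈ P, w q ≤ C * (b : ℝ) ^ 5 ∧
      ∀ σ : LGConfig 4 G, wilsonBoundaryAction ρ (rowRegion b n) (refConfig b n k₀ σ) ≤
        ∑ q ∈ P, w q * ((N : ℝ) - plaquetteObs ρ q.1 q.2.1.1 q.2.1.2 σ) := by
  sorry

/-- **R1 — the `μ`-MEAN ENERGY OF THE REFERENCE FILLING (PROVED from R1d by §4l, rev 11; was the rev-10 STUB).**  For `β ≥ 3`,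
`b ≥ 1` the filling `ζ₀(V) = refFill b n k₀ (lift V)` of `Λ = rowRegion b n`, glued to the twisted datum `σ'_V = topTwist_b(comb_b k₀ σ) σ`
(`σ = lift V`; the glued configuration is `refConfig b n k₀ σ`), is measurable in `V` (`continuous_refConfig`) and has `μ_{L_b,β}`-mean
boundary Wilson action `≤ C₁ b⁵ log β/β` (`integral_refAction_le_of_weighted`).  With R3 (`rowRegion_counts`, §4k) it gives K1‴
`integral_kernelAction_le` by `integral_kernelAction_le_of_ref` (§4j). -/
theorem integral_refAction_le (hρ : Continuous ρ) (hρi : Function.Injective ρ)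
    (hρu : ∀ g, ρ g ∈ Matrix.unitaryGroup (Fin N) ℂ) (hN : 1 ≤ N) (n : ℕ) (k₀ : G) :
    ∃ C₁ : ℝ, 0 < C₁ ∧ ∃ β₂ : ℝ, ∀ β : ℝ, β₂ ≤ β → ∀ b : ℕ, 1 ≤ b →
      ∃ ζ₀ : GaugeConfig 4 (2 * ((2 * n + 2) * b + 1) + 1) G → (↥(rowRegion b n) → G),
        Measurable (fun V => wilsonBoundaryAction ρ (rowRegion b n) (glueWith (rowRegion b n) (ζ₀ V)
          (twistΦ b (comb b ((2 * n + 2) * b + 1) k₀) (torusLift (2 * ((2 * n + 2) * b + 1) + 1) V)))) ∧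
        ∫ V, wilsonBoundaryAction ρ (rowRegion b n) (glueWith (rowRegion b n) (ζ₀ V)
          (twistΦ b (comb b ((2 * n + 2) * b + 1) k₀) (torusLift (2 * ((2 * n + 2) * b + 1) + 1) V)))
          ∂(wilsonMeasure (d := 4) (L := 2 * ((2 * n + 2) * b + 1) + 1) ρ β) ≤ C₁ * (b : ℝ) ^ 5 * (Real.log β / β) :=
  integral_refAction_le_of_weighted ρ hρ hρi hρu n k₀ (refAction_le_weighted ρ hρu hN n k₀)

/-- **K1‴ (PROVED from R1 + R3 by §4j, rev 10; was the rev-9 STUB)** — the in-mean BOUNDARY WILSON ACTION of `Λ = rowRegion b n`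
under the twisted-boundary kernel: `E_{L_b,β} E_{γ_Λ(·|σ'_V)} wilsonBoundaryAction ρ Λ ≤ C b⁵ log β/β` for `β ≥ β₁`, `b ≥ 1`
(`σ'_V = topTwist_b(comb_b k₀ σ) σ`, `σ = lift V`).  It implies (§4i, constant `2C`) K1″ `integral_kernelPlaqDefectSq_le`, then (§4h) K1′,
(§4g) K1, (§4e + §4f) `KernelDefectPoly ρ n k₀ (1/7)`.  Proof = `integral_kernelAction_le_of_ref` (energy–entropy against the reference
filling `refConfig`, §4j) + R1 `integral_refAction_le` (§4l ⇐ R1d) + R3 `rowRegion_counts` (§4k).  The rev-9 plan text (steps (a)–(e)) is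
now realised by §4f–§4m; what remains of it is exactly the ONE stub R1d `refAction_le_weighted` (hairpin Stokes + counting). -/
theorem integral_kernelAction_le (hρ : Continuous ρ) (hρi : Function.Injective ρ)
    (hρu : ∀ g, ρ g ∈ Matrix.unitaryGroup (Fin N) ℂ) (hN : 1 ≤ N) (n : ℕ) (k₀ : G) :
    ∃ C : ℝ, 0 < C ∧ ∃ β₁ : ℝ, ∀ β : ℝ, β₁ ≤ β → ∀ b : ℕ, 1 ≤ b →
      ∫ V, kernelAction ρ β b n k₀ V ∂(wilsonMeasure (d := 4) (L := 2 * ((2 * n + 2) * b + 1) + 1) ρ β) ≤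
        C * (b : ℝ) ^ 5 * (Real.log β / β) :=
  integral_kernelAction_le_of_ref ρ hρ hρi hρu (rowRegion_counts n) (integral_refAction_le ρ hρ hρi hρu hN n k₀)

/-- **K1″ (PROVED from K1‴ by §4i): the in-mean plaquette ENERGY of the film on `Σ` under the twisted-boundary kernel,**
`E_{L_b,β} E_{γ_Λ(·|σ')} Σ_{p∈Σ} ‖ρ(U_p) − 1‖²_F ≤ C b⁵ log β/β` (every plaquette of `Σ` touches `Λ`, so the energy on `Σ` is
`≤ 2 A_Λ`). -/
theorem integral_kernelPlaqDefectSq_le (hρ : Continuous ρ) (hρi : Function.Injective ρ)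
    (hρu : ∀ g, ρ g ∈ Matrix.unitaryGroup (Fin N) ℂ) (hN : 1 ≤ N) (n : ℕ) (k₀ : G) :
    ∃ C : ℝ, 0 < C ∧ ∃ β₁ : ℝ, ∀ β : ℝ, β₁ ≤ β → ∀ b : ℕ, 1 ≤ b →
      ∫ V, kernelPlaqDefectSq ρ β b n k₀ V ∂(wilsonMeasure (d := 4) (L := 2 * ((2 * n + 2) * b + 1) + 1) ρ β) ≤
        C * (b : ℝ) ^ 5 * (Real.log β / β) :=
  integral_kernelPlaqDefectSq_le_of_action ρ hρ hρu (integral_kernelAction_le ρ hρ hρi hρu hN n k₀)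

/-- **K1′ (PROVED from K1″ by §4h): the in-mean plaquette-DEFECT bound of the film under the twisted-boundary kernel,**
`E_{L_b,β} E_{γ_Λ(·|σ')} Σ_{p∈Σ} ‖ρ(U_p) − 1‖_F ≤ C b^{7/2} √(log β/β)`. -/
theorem integral_kernelPlaqDefect_le (hρ : Continuous ρ) (hρi : Function.Injective ρ)
    (hρu : ∀ g, ρ g ∈ Matrix.unitaryGroup (Fin N) ℂ) (hN : 1 ≤ N) (n : ℕ) (k₀ : G) :
    ∃ C : ℝ, 0 < C ∧ ∃ β₁ : ℝ, ∀ β : ℝ, β₁ ≤ β → ∀ b : ℕ, 1 ≤ b →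
      ∫ V, kernelPlaqDefect ρ β b n k₀ V ∂(wilsonMeasure (d := 4) (L := 2 * ((2 * n + 2) * b + 1) + 1) ρ β) ≤
        C * (b : ℝ) ^ (7 / 2 : ℝ) * Real.sqrt (Real.log β / β) :=
  integral_kernelPlaqDefect_le_of_sq ρ hρ hρu (integral_kernelPlaqDefectSq_le ρ hρ hρi hρu hN n k₀)

/-- **K1 (PROVED from K1′ by §4g, K1′ from K1″ by §4h): the in-mean twist-defect bound.** -/
theorem integral_twistDefect_le (hρ : Continuous ρ) (hρi : Function.Injective ρ)
    (hρu : ∀ g, ρ g ∈ Matrix.unitaryGroup (Fin N) ℂ) (hN : 1 ≤ N) (n : ℕ) (k₀ : G) :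
    ∃ C : ℝ, 0 < C ∧ ∃ β₁ : ℝ, ∀ β : ℝ, β₁ ≤ β → ∀ b : ℕ, 1 ≤ b →
      ∫ V, twistDefect ρ β b n k₀ V ∂(wilsonMeasure (d := 4) (L := 2 * ((2 * n + 2) * b + 1) + 1) ρ β) ≤
        C * (b : ℝ) ^ (7 / 2 : ℝ) * Real.sqrt (Real.log β / β) :=
  integral_twistDefect_le_of_kernelPlaqDefect ρ hρ hρu (integral_kernelPlaqDefect_le ρ hρ hρi hρu hN n k₀)

/-- **INPUT K_poly of exponent `1/7` (assembled from K1 `integral_twistDefect_le` by §4e, with K0 = §4f; K1 is PROVED down to the ONE stub R1d).** -/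
theorem kernelDefectPoly_seventh (hρ : Continuous ρ) (hρi : Function.Injective ρ)
    (hρu : ∀ g, ρ g ∈ Matrix.unitaryGroup (Fin N) ℂ) (hN : 1 ≤ N) (n : ℕ) (k₀ : G) :
    KernelDefectPoly ρ n k₀ (1 / 7) :=
  kernelDefectPoly_of_mean ρ hρ hρu (fun β b => measurable_twistDefect ρ hρ hρu β b n k₀)
    (integral_twistDefect_le ρ hρ hρi hρu hN n k₀)

/-- **INPUT F_poly of exponent `1/7` (PROVED from `kernelDefectPoly_seventh` by ROUTE B §4d; hence from the ONE stub R1d).** -/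
theorem frameValuePoly_seventh (hρ : Continuous ρ) (hρi : Function.Injective ρ)
    (hρu : ∀ g, ρ g ∈ Matrix.unitaryGroup (Fin N) ℂ) (hN : 1 ≤ N) (n : ℕ) {k₀ : G} (hk₀ : k₀ ≠ 1) :
    FrameValuePoly ρ n k₀ (1 / 7) :=
  frameValuePoly_of_kernelDefectPoly ρ hρ hρu hN (re_trace_div_lt_one ρ hρi hρu hN hk₀)
    (kernelDefectPoly_seventh ρ hρ hρi hρu hN n k₀)

/-- **THE POLYNOMIAL ROW FLOOR OF EXPONENT `1/7` (assembled; `sorry` = exactly the ONE stub R1d `refAction_le_weighted`).**  For every compact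
(second countable) `G`, continuous faithful unitary `ρ`, `N ≥ 1`, `k₀ ≠ 1`, window `n`, `ε < 1`, `0 ≤ δ`,
`4·#windowCellsPlus(n)·δ < 1`:  `∃ c > 0, ∃ β₀, ∀ β ≥ β₀, ∀ b, 1 ≤ b ≤ c (β / log β)^{1/7} → ¬ TypShellCond ρ β b n ε δ`. -/
theorem rowFloorPoly_seventh (hρ : Continuous ρ) (hρi : Function.Injective ρ)
    (hρu : ∀ g, ρ g ∈ Matrix.unitaryGroup (Fin N) ℂ) (hN : 1 ≤ N) {k₀ : G} (hk₀ : k₀ ≠ 1)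
    (n : ℕ) {ε δ : ℝ} (hε : ε < 1) (hδ0 : 0 ≤ δ) (hδ : 4 * ((windowCellsPlus n).card : ℝ) * δ < 1) :
    RowFloorPoly ρ n ε δ (1 / 7) :=
  rowFloorPoly_of_inputs ρ hρ hρi hρu hN hk₀ n hε hδ0 hδ
    (loopFreezingPoly_mono ρ (by norm_num) (loopFreezingPoly_quarter ρ hρ hρi hρu hN n))
    (frameValuePoly_seventh ρ hρ hρi hρu hN n hk₀)

/-- The floor in onset currency (assembled): for `[Nontrivial G]` nothing needs choosing. -/
theorem typFloor_seventh [Nontrivial G] (hρ : Continuous ρ) (hρi : Function.Injective ρ)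
    (hρu : ∀ g, ρ g ∈ Matrix.unitaryGroup (Fin N) ℂ) (hN : 1 ≤ N)
    (n : ℕ) {ε δ : ℝ} (hε : ε < 1) (hδ0 : 0 ≤ δ) (hδ : 4 * ((windowCellsPlus n).card : ℝ) * δ < 1) :
    ∃ c : ℝ, 0 < c ∧ ∃ β₀ : ℝ, ∀ β : ℝ, β₀ ≤ β → ∀ b : ℕ, 1 ≤ b → TypShellCond ρ β b n ε δ →
      c * (β / Real.log β) ^ (1 / 7 : ℝ) < b := by
  obtain ⟨k₀, hk₀⟩ := exists_ne (1 : G)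
  exact typFloor_of_rowFloorPoly ρ (rowFloorPoly_seventh ρ hρ hρi hρu hN hk₀ n hε hδ0 hδ)

end Stubs

end Summit.QuantumFields.YangMills.Cruxes.IR.CruxIdea2g7

end
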